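import Summits.BirchSwinnertonDyer.BirchSwinnertonDyer.Theses.RamifiedSevenEllipticUnits
import Summits.BirchSwinnertonDyer.Rank1Residual.X12.CMSevenAwayFromSeven
import Summits.BirchSwinnertonDyer.Rank1Residual.X12.CMRungLeaves
import Summits.BirchSwinnertonDyer.Rank1Residual.X12.O11.HeegnerIndexManinDescent
import Summits.BirchSwinnertonDyer.Rank1Residual.X12.O11.RouteUTamagawaCM
import Summits.BirchSwinnertonDyer.Rank1Residual.X12.O11.RouteUSevenBinders
import Summits.BirchSwinnertonDyer.Rank1Residual.X11b.Three.CornerDischarge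
import Literature.NumberTheory.EllipticCurves.KolyvaginShaStructureAnyLevel
import Literature.NumberTheory.EllipticCurves.HeegnerPointsKolyvaginExceptionalTwistProofs
import Literature.NumberTheory.EllipticCurves.NonvanishingTwistsPrescribedSplittingOfHoffsteinLuoProofs
import Literature.NumberTheory.EllipticCurves.RootNumberEvenAnalyticRankProofs
import Literature.NumberTheory.EllipticCurves.GrossZagierRankOneProofs
import Literature.NumberTheory.EllipticCurves.BSDHeegnerPointsGrossZagierProofs
import Summits.BirchSwinnertonDyer.BirchSwinnertonDyer.Theorems.RamifiedSevenEllipticUnitsIndexIffLeaf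
import Summits.BirchSwinnertonDyer.BirchSwinnertonDyer.Theorems.Rank1ResidualX1Isogeny
import Summits.BirchSwinnertonDyer.Rank1Residual.X12.RamifiedLocalTypes
import Summits.BirchSwinnertonDyer.Rank1Residual.X12.CMInertTrace
import Summits.BirchSwinnertonDyer.Rank1Residual.X2.TwistKodaira
import Literature.NumberTheory.EllipticCurves.LocalTorsionMultiplicativeProofs
import Literature.NumberTheory.EllipticCurves.ComplexMultiplicationTwistIsogenyCertProofs
import Literature.NumberTheory.EllipticCurves.HasseWeilAbelianConductor
import Literature.NumberTheory.EllipticCurves.IsogenyHasCMIffJMemProofs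
import Literature.NumberTheory.EllipticCurves.GlobalMinimalModelProofs
import Literature.NumberTheory.EllipticCurves.IsogenyCompProofs
import Literature.NumberTheory.DiophantineGeometry.TateAlgorithmTameTypesOddProofs
import Literature.NumberTheory.EllipticCurves.Rank1Residual.ClassX1KellerYinTypeA
import Literature.NumberTheory.EllipticCurves.HeegnerPointsOfConductorOneRationalityProofs
import Literature.NumberTheory.EllipticCurves.HeegnerPointsOfConductorOneData
import Literature.NumberTheory.EllipticCurves.HeegnerPointsOfConductorOneGaloisConjProofs
import Literature.NumberTheory.EllipticCurves.BSDSelmerPConverseYanZhuKolyvaginSystemProofs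
import Literature.NumberTheory.EllipticCurves.HeegnerPointsClassesProofs
import Literature.NumberTheory.EllipticCurves.HeegnerPointsGaloisDescent
import Literature.NumberTheory.EllipticCurves.MordellWeilTheoremProofs
import Literature.NumberTheory.EllipticCurves.HeegnerPointFiniteIndex
import Literature.GroupTheory.FiniteAbelian.RankTorsionKilling
import Mathlib.Data.ZMod.QuotientGroup
import Mathlib.GroupTheory.Perm.Cycle.Type
import Literature.NumberTheory.EllipticCurves.HeegnerPointsKolyvaginPrimaryNoTorsionProofs
import Literature.NumberTheory.EllipticCurves.OpenImageMazurFrobeniusProofs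
import Literature.NumberTheory.EllipticCurves.DivisionFieldReducibleBorelKernel
import Literature.NumberTheory.EllipticCurves.KummerImageIsotropyProofs
import Literature.NumberTheory.EllipticCurves.SupersingularDensitySerreFrobeniusProofs
import Literature.NumberTheory.EllipticCurves.DeligneSerreWeightOneIrreducibleKroneckerWeberProofs
import Literature.NumberTheory.GaloisRepresentations.ArtinLFunctionEulerFactorProofs
import Literature.NumberTheory.EllipticCurves.BSDConductorProofs
import Literature.NumberTheory.EllipticCurves.RingClassFieldConjugation
import Literature.NumberTheory.EllipticCurves.QuadraticTwistPointsOverSqrtField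
import Literature.NumberTheory.QuadraticFields.HeegnerCondition
import Literature.NumberTheory.EllipticCurves.ZpExtensionProofs
import Summits.BirchSwinnertonDyer.Rank1Residual.X11b.RingClassFieldConj
import Summits.BirchSwinnertonDyer.Rank1Residual.ManinAdditive.CMClassSevenMembers
import Summits.BirchSwinnertonDyer.BirchSwinnertonDyer.Theorems.GoldfeldAllTwistsTwoConverseTwinAdditiveRootNumber
import Summits.BirchSwinnertonDyer.BirchSwinnertonDyer.Theorems.GoldfeldGoodTwistsX049
import Summits.BirchSwinnertonDyer.BirchSwinnertonDyer.Theorems.ThetaPartnerAtTwoSignedMainConjectureCMTwoRankZeroFlatTwistFamily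
import Literature.NumberTheory.EllipticCurves.ManinConstantQuadraticTwistStevensHoldsProofs
import Literature.NumberTheory.EllipticCurves.ManinConstantQuadraticTwistGamma0Proofs
import Literature.NumberTheory.EllipticCurves.ModularCurveManinSemistableLatticeFormProofs
import Literature.NumberTheory.EllipticCurves.ModularCurveManinSemistableBridgeProofs
import Literature.NumberTheory.EllipticCurves.NewformsTwistNewCoprimeProofs
import Literature.NumberTheory.EllipticCurves.CuspFormLFunctionLevelConductorProofs
import Literature.NumberTheory.Automorphic.BCDTModularitySemistableTwistProofs
import Literature.NumberTheory.EllipticCurves.ManinConstantClassCertificate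
import Literature.NumberTheory.EllipticCurves.ComplexMultiplicationShaKnappProofs
import Literature.NumberTheory.EllipticCurves.Rank1Residual.X11RankOneCertificates.Minimality
import Summits.BirchSwinnertonDyer.BirchSwinnertonDyer.Theorems.BiquadraticEisensteinDescentEisensteinHeartFlatCMInertBadKPrimeSqrtEndomorphismTwist
import Summits.BirchSwinnertonDyer.BirchSwinnertonDyer.Theorems.BiquadraticEisensteinDescentEisensteinHeartFlatCMInertBadKPrimeCMDatumAdapter
import Literature.NumberTheory.EllipticCurves.WeilPairingProofs
import Literature.NumberTheory.EllipticCurves.RationalIsogenyDegreesProofs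
import Literature.NumberTheory.EllipticCurves.KummerMap
import Literature.NumberTheory.GaloisRepresentations.ImaginaryQuadraticCyclotomicProofs
import Literature.NumberTheory.GaloisRepresentations.TateLevelOneWildOdd
import Literature.NumberTheory.GaloisRepresentations.SorensenPatching
import Mathlib.RepresentationTheory.Homological.GroupCohomology.LowDegree
import HarnessLib

/-!
# Cuspidal descent on 𝒞₇ — the TYPED OR-NODE (D-0171 node-output contract) under rung leaf K7r

Crux workfile for `stmt-BirchSwinnertonDyer-19945` (`RamifiedSevenEllipticUnits.EllipticUnitValueSevenOfGZK`, route
`route-BirchSwinnertonDyer-RamifiedSevenEllipticUnits`; leaf K7r = `X12.CMRamifiedSeven`: `BSD(E,p)` at every prime for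
every globally minimal `W ∈ 𝒞₇`), crux idea `cuspidal-descent-kolyvagin-nonvanishing`, planner `bsd-idea-20` (g45–g48),
critic `idea-crit-15` (V#22at–V#22az PASS, record). **No summit statement, no route item and no crux is proved by this
file; crux 19945 and leaf K7r stay OPEN. It is a CERTIFICATE of a decomposition (every implication below is
sorry-free), not a skeleton line: nothing is registered (W-79), no route is opened (W-71).**

WHAT THIS FILE IS. D-0171 (directors, 2026-08-29; node-output contract): ideation output = a typed tree NODE «Target ⟸
children, the implication kernel-checked, every leaf tagged ATTACKABLE / INSTRUMENTABLE / IDEA-NEEDED / BARRIER; an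
EQUIV child must come with WEAKER / UNDECIDED children in the same submission». The cuspidal-descent line is an
OR-sibling of the route's elliptic-unit line UNDER THE SAME LEAF `X12.CMRamifiedSeven`; by the route's ASIDE A it is
not a line under the crux `(★_an)` itself (MECHANISM-CENSUS-g5 §2). The file is self-contained (Cruxes modules are not
farm build targets — they have no olean and cannot be imported — so the two defs of `CuspidalDescentSketch.lean` /
`CuspidalDescentCPlusFieldHalf.lean` it needs are restated VERBATIM in the namespace `…CuspidalDescent.Node`, and every
REV extends THIS file).

STRUCTURE.
LEVEL 1 (§1–§3, PROVED `cmRamifiedSeven_of_pieces`): `X12.CMRamifiedSeven ⟸ HeegnerIndexIdentitySeven ∧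
  DescentSideDataSeven (D) ∧ TypeIIIReductionSeven (T)` granted the published facts BY NAME (Burungale–Flach `hBF`,
  modularity `hmod`/`hnf`, Li–Liu–Tian `hLLT`, Kobayashi `hKob`, Li–Tian–Yan–Zhu `hLTYZ`, GZK `hGZK`,
  Friedberg–Hoffstein `hFH`, Gross–Zagier `hGZ`, Kolyvagin `hKo`; Cassels `hCassels` enters with T in REV 2 — ELEVEN
  fact binders in every later composite), through the tree's Manin-carrying descent `O11.bsdp_of_indexIdentityManin`
  at `p = 7` and the 𝒞₇ assembly `ClassCSeven.forall_bsdp_iff_bsdp_seven`; the twin-value binder `htw`, the Tamagawa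
  binder `htam` (`RouteU.not_dvd_tamagawaProduct_of_hasCM`: CM ⇒ `7 ∤ ∏ c_ℓ`) and `hμ` are DISCHARGED class-wide.
LEVEL 2 (§2, PROVED `heegnerIndexIdentity_of_pieces`): `HeegnerIndexIdentitySeven ⟸ KolyvaginDatumHalfSeven (A) ∧
  EisensteinCMKolyvaginStructureSeven (B) ∧ KolyvaginIndexBookkeepingSeven (G) ∧ HeegnerDescentLinkSeven (S)`
  granted `hmod`, `hGZ`.
REVISION LOG (one line per REV; the full narrative, proof sketches and audit lines of every REV are in the memos
`CuspidalDescentNode-g45.md`, `-g46.md` (REV 2–6), `-g47.md` (REV 7), `-g48.md` (REV 8) of this directory and in the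
git history of this file — up to REV 7 = commit fceb5c7ab2d1 they were carried in this docstring, which REV 8 CONDENSED
to respect the crux-workfile cap of 200 000 bytes; all REV 1–7 DECLARATIONS are byte-unchanged):
* REV 1 (g45, §1–§5): node typed; `cmRamifiedSeven_of_pieces`, `heegnerIndexIdentity_of_pieces`,
  `cmRamifiedSeven_of_leaves` (K7r ⟸ A ∧ B ∧ G ∧ S ∧ D ∧ T + the named facts).
* REV 2 (g46, §6–§7): T PROVED granted GZK, modularity, Cassels (`typeIIIReductionSeven_of_cassels`: `ord₇ Δ ∈ {3, 9}`
  on 𝒞₇; a III* member's type-III partner is a minimal model of the ℚ-isogenous `−7`-twist); `cmRamifiedSeven_of_five_leaves`.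
* REV 3 (g46, §8–§10): S PROVED unconditionally (`heegnerDescentLinkSeven_holds`: Darmon Thms. 3.6/3.7 at conductor `1`
  are tree theorems); D SPLIT into D(a) `DescentManinDatumSeven` (Manin datum `7 ∤ c`) and D(b) (the `7`-unit twist
  model, PROVED: `descentTwistModelSeven`, `descentSideDataSeven_of_maninDatum : D(a) → D`); `cmRamifiedSeven_of_four_leaves`.
* REV 4 (g46, §11–§12): G ⟸ G(a) `TypeIIINoSevenTorsionSeven` (`index_bookkeeping`,
  `kolyvaginIndexBookkeepingSeven_of_noTorsion`); `cmRamifiedSeven_of_torsion_leaf`.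
* REV 5 (g46, §13–§14): G(a) PROVED unconditionally for ALL of 𝒞₇ and every imaginary quadratic `K`
  (`typeIIINoSevenTorsionSeven_holds`: Weil pairing + `χ₇` onto `𝔽₇ˣ`, Mazur's isogeny character and his Frobenius
  relation at the good ordinary prime `2` + Hasse, Cox Lemma 9.3 through `RingClassInvertedDatum` /
  `ringClassInvertedDatum_holds`); `cmRamifiedSeven_of_three_leaves` (K7r ⟸ A ∧ B ∧ D(a) + 11 facts).
* REV 6 (g46, §15–§16): hypothesis (H2) of THEOREM R «no `7`-power torsion in ring class towers, for `E` and its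
  `d_K`-twin, all of 𝒞₇» PROVED (`TowerNoSevenTorsionSeven`, `towerNoSevenTorsionSeven_holds`); leaf B♭
  `EisensteinCMKolyvaginStructureSevenGrantedH2 := (H2) → B`; `cmRamifiedSeven_of_three_leaves_grantedH2`.
* REV 7 (g47, §17): D(a) PROVED granted Cremona's row `N = 49` (`hM : OptimalCurveManinCertificate cm7`) and `hnf`
  (`descentManinDatumSeven_of_maninCertificate`: the type-III stratum = minimal models of `49a1 ⊗ χ_d` / `49a2 ⊗ χ_d`,
  `d ≡ 1 (4)`, `7 ∤ d`; Stevens' datum transport along the prime-discriminant factorisation of `d`; Vélu base);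
  `cmRamifiedSeven_of_two_leaves_grantedH2` (K7r ⟸ A ∧ B♭ + 11 facts + `hM`).
* REV 8 (g48, §18): hypothesis (H1) of THEOREM R «`H¹(Gal(K(E[7^M])/K), E[7^j]) = 0` for `j ≤ M`» (memo
  `CuspidalDescentK2-g34.md` §3; Gross Prop. 9.1, McCallum p. 279) PROVED for EVERY `W/ℚ` with
  `cmFieldDiscrOfJ W.j = −7` and EVERY quadratic field `K ∌ √−7` (`TowerH1VanishingSeven`, `towerH1VanishingSeven_holds`):
  not through Lawson–Wuthrich (absent from the tree) but through a CM HOMOTHETY — `τ = τ₀²` (`χ₇(τ₀) = 2`) commutes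
  with `ψ = [√−7]` and acts on `ker ψ` as `a ≢ 1 (mod 7)` (Weil pairing on a `ψ`-triangular basis of `E[7]`); the
  `ψ`-adic contraction (§18.2 `Fil.pow_seven_pow_sub`, `7 = −ψ²`) makes `τ^{7^{2M−1}}` the scalar `a^{7^{2M−1}} ≢ 1`
  on `E[7^M]`, and Sah's lemma modulo `Γ_{K(E[7^M])}` (§18.1) concludes; print criterion: Cha 2005 Thm. 7
  (homothety ⇒ vanishing, by Hochschild–Serre induction). Leaf B♭♭
  `EisensteinCMKolyvaginStructureSevenGrantedH1H2 := (H1) → (H2) → B` (B♭♭ → B♭ PROVED: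
  `eisensteinCMKolyvaginStructureSevenGrantedH2_of_grantedH1H2`); `cmRamifiedSeven_of_two_leaves_grantedH1H2`
  (K7r ⟸ A ∧ B♭♭ + 11 facts + `hM`).

LEAF TAGS (D-0171 vocabulary; strength relative to the target K7r; evidence in the memos of this directory):
* A `KolyvaginDatumHalfSeven` — UNDECIDED · IDEA-NEEDED, live round = card K1 ∧ K3′ (cuspidal theta /
  Eisenstein-congruence mechanism; Kolyvagin's conjecture mod `7` on the type-III stratum — W. Zhang 2014 needs
  `p ≥ 5` good ordinary with surjective `ρ̄`, both fail at `(𝒞₇, 7)`); one INSTRUMENTABLE instance inside it: `49a1`,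
  `K″ = ℚ(√−79)`, first Kolyvagin prime, `P(ℓ) mod 7` (not run; kit 0).
* B `EisensteinCMKolyvaginStructureSeven` — WEAKER · ATTACKABLE (L): THEOREM R of memos g34/g37/g40 (Kolyvagin–McCallum
  exact order at an Eisenstein prime with CM; complete paper proof, unrefereed). Its hypotheses (H2) [REV 6, §15] and
  (H1) [REV 8, §18] are PROVED in kernel, so the live form of the leaf is B♭♭ = THEOREM R minus (H1), (H2): what
  remains is (H3) local triviality off `n`, (H4) the local structure at Kolyvagin primes, (H6) twin rigidity, and the
  Kolyvagin machine itself ((H5) complex conjugation is Gross (5.2)).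
* G `KolyvaginIndexBookkeepingSeven`, G(a) `TypeIIINoSevenTorsionSeven`, S `HeegnerDescentLinkSeven`, D(b), T
  `TypeIIIReductionSeven` — WEAKER · PROVED (REV 4, 5, 3, 3, 2; T granted GZK / modularity / Cassels by name);
  D `DescentSideDataSeven` ⟸ D(a) `DescentManinDatumSeven` — WEAKER · PROVED granted `hM`, `hnf` (REV 7).
* node `HeegnerIndexIdentitySeven` — EQUIV on its stratum (the `7`-part of Gross–Zagier's conjecture V.(2.2) for `W/K″`
  with the parametrisation constant carried; given GZ + Kolyvagin it is `BSD(W,7)` there) — hence, per the contract,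
  decomposed IN THIS SUBMISSION into the WEAKER children B, G, S and the UNDECIDED child A (LEVEL 2).
* BARRIER leaves: none certified (W. Zhang's hypotheses failing is a scope statement, not a no-go theorem).
After REV 8 the node reads K7r ⟸ A (UNDECIDED · IDEA-NEEDED) ∧ B♭♭ (ATTACKABLE, L) + 11 facts + `hM`: modulo typed
ATTACKABLE pieces the cuspidal line converts K7r into exactly ONE research statement, A — a statement about Heegner
points mod `7`, with no `7`-adic `L`-function, no reciprocity law at the additive prime and no height at `7`
(contrast: the route's crux `(★_an)` waits for the BKNO ramified reciprocity law).

AUDIT NOTE. The `def … : Prop` pieces are deliberately UNTAGGED hypotheses of a decomposition certificate (no `@[stub]`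
/ `@[conjecture]`: nothing is registered, W-79); the advisory file audit therefore lists the unproved ones as
`vendored-fact` and the composites as `proof.conditional` — expected for a node. REV 8 file audit:
`def 2 (cm7b, Fil) · proof.conditional 9 · proved-helper 6 (HeegnerDescentLinkSeven, KolyvaginIndexBookkeepingSeven,
TypeIIINoSevenTorsionSeven, RingClassInvertedDatum, TowerNoSevenTorsionSeven, TowerH1VanishingSeven) · support 84 ·
vendored-fact 8 (A, B, B♭, B♭♭, D, D(a), T, HeegnerIndexIdentitySeven)` (n = 109), 0 orphans, `sorries = 0`, axioms of
every theorem ⊆ `propext, Classical.choice, Quot.sound`; the composite of record `cmRamifiedSeven_of_two_leaves_grantedH1H2`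
is `proof.conditional` with 14 named binders = the 11 published facts + `hM` + the 2 leaves A, B♭♭.
[cite: GrossZagier1986, V.§2 (2.2) (pp. 310–312)] [cite: GrossLMS1991, §4 (4.1), Thm. 1.3 and Prop. 9.1]
[cite: McCallumLMS1991, §1 and §5] [cite: Kolyvagin1991, Thm. 1] [cite: Miller2011LMS, §1 and Def. 1.1]
[cite: Olson1974, Thm. 1] [cite: Cox2013, §9.A Lemma 9.3] [cite: Mazur1978, Prop. 6.3 (1)]
[cite: SilvermanAEC2009, III.8.1 and V.1.1] [cite: Sah1968, Prop. 2.7 (b)] [cite: LawsonWuthrich2016, Thm. 2 and §3]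
[cite: SilvermanAdvancedTopics1994, II §2 Thm. 2.2(b)] [cite: Cha2005, Thm. 7]
-/

noncomputable section

set_option linter.dupNamespace false

open scoped Classical

open WeierstrassCurve Literature Literature.NumberTheory.EllipticCurves
  Literature.NumberTheory.EllipticCurves.ModularForms
  Summit.BirchSwinnertonDyer.Rank1Residual Summit.BirchSwinnertonDyer.Rank1Residual.X12
  Summit.BirchSwinnertonDyer.Rank1Residual.X12.O11

namespace Summit.BirchSwinnertonDyer.BirchSwinnertonDyer.Cruxes.EllipticUnitValueSevenOfGZK.CuspidalDescent.Node

/-! ## §1 The leaves (typed pieces; nothing asserted) -/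

/-- **Piece A (research leaf; UNDECIDED; the card's K1 ∧ K3′) — `KolyvaginDatumHalfSeven`, VERBATIM
restatement of `CuspidalDescentCPlusFieldHalf.lean` (g43).** For every globally minimal type-III member
`W ∈ 𝒞₇`, every datum with `7 ∤ c`, every analytically admissible imaginary quadratic `K″` (Heegner hypothesis
for `N(W)`, `7` split, `d ≡ 1 (mod 8)`, `|d| > 4`, `L(W^{(d)}, 1) ≠ 0`): some derived Heegner point of
square-free Kolyvagin level is not `7`-divisible. [cite: Kolyvagin1991, Thm. 1] [cite: WZhang2014, Thm. 1.1 (hypotheses fail here)] -/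
def KolyvaginDatumHalfSeven : Prop :=
  ∀ (W : WeierstrassCurve ℚ) [W.IsElliptic] [W.IsGloballyMinimal] [NeZero (W.conductorNorm ℤ)]
    [Fact (Nat.Prime 7)],
    ClassCSeven W → padicValRat 7 W.Δ = 3 →
    ∀ (Dt : ModularParametrizationData W (W.conductorNorm ℤ)), ¬ (7 : ℤ) ∣ Dt.c →
    ∀ (K : Type) [Field K] [NumberField K], IsImaginaryQuadratic K →
      SatisfiesHeegnerHypothesis (W.conductorNorm ℤ) K → SatisfiesHeegnerHypothesis 7 K →
      NumberField.discr K % 8 = 1 → 4 < (NumberField.discr K).natAbs →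
      (W.quadraticTwist (NumberField.discr K : ℚ)).entireLFunction 1 ≠ 0 →
      ∃ (β : ℤ) (ι : K →+* ℂ) (n : ℕ) (d : KolyvaginHeegnerData Dt β ι n),
        Squarefree n ∧
        (∀ ℓ ∈ n.primeFactors, Zhang2014.IsKolyvaginPrime (W.conductorNorm ℤ) W K 7 ℓ) ∧
        ¬ ∃ Q : (W.baseChange (ringClassField K ι n)).toAffine.Point, (7 : ℤ) • Q = d.derivedPoint

/-- **Piece B (WEAKER on paper: THEOREM R, memos g34/g37/g40) — `EisensteinCMKolyvaginStructureSeven`, VERBATIM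
restatement of `CuspidalDescentSketch.lean` (g24).** McCallum's any-level exact-order theorem with
`¬ W.HasCM` and the surjective mod-`7^k` image replaced by membership in the type-III stratum of 𝒞₇.
[cite: McCallumLMS1991, §1 Theorem and §5] [cite: GrossLMS1991, Thm. 1.3] -/
def EisensteinCMKolyvaginStructureSeven : Prop :=
  ∀ (W : WeierstrassCurve ℚ) [W.IsElliptic] [W.IsGloballyMinimal] [NeZero (W.conductorNorm ℤ)]
    [Fact (Nat.Prime 7)],
    ClassCSeven W → padicValRat 7 W.Δ = 3 →
    ∀ (K : Type) [Field K] [NumberField K], IsImaginaryQuadratic K →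
    NumberField.discr K ≠ -3 → NumberField.discr K ≠ -4 →
    SatisfiesHeegnerHypothesis (W.conductorNorm ℤ) K →
    ∀ (Dt : ModularParametrizationData W (W.conductorNorm ℤ)) (β : ℤ) (ι : K →+* ℂ)
      (d₁ : KolyvaginHeegnerData Dt β ι 1), ¬ IsOfFinAddOrder d₁.derivedPoint →
    ∀ (M₀ : ℕ),
      (∃ Q : (W.baseChange (ringClassField K ι 1)).toAffine.Point,
          ((7 ^ M₀ : ℕ) : ℤ) • Q = d₁.derivedPoint) →
      (¬ ∃ Q : (W.baseChange (ringClassField K ι 1)).toAffine.Point,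
          ((7 ^ (M₀ + 1) : ℕ) : ℤ) • Q = d₁.derivedPoint) →
    ∀ (n : ℕ) (d : KolyvaginHeegnerData Dt β ι n), Squarefree n →
      (∀ ℓ ∈ n.primeFactors, Zhang2014.IsKolyvaginPrime (W.conductorNorm ℤ) W K 7 ℓ) →
      (¬ ∃ Q : (W.baseChange (ringClassField K ι n)).toAffine.Point, (7 : ℤ) • Q = d.derivedPoint) →
    Nat.card (AddCommGroup.primaryComponent (W.baseChange K).sha 7) = 7 ^ (2 * M₀)

/-- **Piece G (WEAKER; elementary bookkeeping, NEW typed here) — `KolyvaginIndexBookkeepingSeven`.** For a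
type-III member `W ∈ 𝒞₇`, an imaginary quadratic `K″` with `7` split, a level-`1` Kolyvagin–Heegner datum `d₁`
and a point `P ∈ E(K″)` mapping to `P(1) = d₁.derivedPoint` under `E(K″) → E(K″[1])`: if `P` has infinite
order and `rank E(K″) = 1` (supplied at level 2 by Kolyvagin's theorem BY NAME, `kolyvagin`), then `P(1)` has
infinite order, `P(1)` has an EXACT `7`-divisibility exponent `M₀` in `E(K″[1])`, and `ord₇ [E(K″) : ℤP] = M₀`.
Content: `E(K″)[7] = E(K″[1])[7] = 0` (the two isogeny characters `ω^a ε_D`, `ω^{1-a} ε_D` (`a ∉ {0,1}`) of a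
type-III member are ramified at `7`, which is unramified in `K″[1]`), Galois descent of `7`-power divisibility
along `K″[1]/K″`, and `E(K″) ≅ ℤ ⊕ T` with `7 ∤ #T`, so `ord₇ [E(K″) : ℤP] = ord₇` of the free coordinate of `P`
`=` its exact `7`-divisibility exponent (without the rank hypothesis the index is `0` by convention and the
identity fails). D-0171 leaf tag: ATTACKABLE (M). [cite: GrossLMS1991, §4 (4.1)] [cite: SilvermanAEC2009, VIII.7 and X.4] -/
def KolyvaginIndexBookkeepingSeven : Prop :=
  ∀ (W : WeierstrassCurve ℚ) [W.IsElliptic] [W.IsGloballyMinimal] [NeZero (W.conductorNorm ℤ)]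
    [Fact (Nat.Prime 7)],
    ClassCSeven W → padicValRat 7 W.Δ = 3 →
    ∀ (K : Type) [Field K] [NumberField K], IsImaginaryQuadratic K →
      SatisfiesHeegnerHypothesis 7 K →
    ∀ (Dt : ModularParametrizationData W (W.conductorNorm ℤ)) (β : ℤ) (ι : K →+* ℂ)
      (d₁ : KolyvaginHeegnerData Dt β ι 1) (P : (W.baseChange K).toAffine.Point),
      WeierstrassCurve.Affine.Point.map (algebraMap K (ringClassField K ι 1)).toRatAlgHom P =
        d₁.derivedPoint →
      ¬ IsOfFinAddOrder P → (W.baseChange K).mordellWeilRank = 1 →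
      ¬ IsOfFinAddOrder d₁.derivedPoint ∧
      ∃ M₀ : ℕ,
        (∃ Q : (W.baseChange (ringClassField K ι 1)).toAffine.Point,
            ((7 ^ M₀ : ℕ) : ℤ) • Q = d₁.derivedPoint) ∧
        (¬ ∃ Q : (W.baseChange (ringClassField K ι 1)).toAffine.Point,
            ((7 ^ (M₀ + 1) : ℕ) : ℤ) • Q = d₁.derivedPoint) ∧
        padicValNat 7 (AddSubgroup.zmultiples P).index = M₀

/-- **Piece G(a) (WEAKER; the arithmetic input of G, NEW typed in REV 4 — G itself is PROVED from it in §11) —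
`TypeIIINoSevenTorsionSeven`.** A type-III member of 𝒞₇ has no `7`-torsion over the ring class field `K″[1]`
(the Hilbert class field, realised in `ℂ`) of an imaginary quadratic `K″` in which `7` splits. Paper proofs:
(i) the two diagonal characters `ω^a ε_D`, `ω^{1-a} ε_D` (`a ∉ {0, 1} (mod 6)`, `7 ∤ D`) of the Borel mod-`7`
representation of `49a_i^{(D)}` are ramified at `7`, while `K″[1]/ℚ` is unramified above `7`; (ii) `Gal(K″[1]/ℚ)`
is generalised dihedral, so a non-zero `E(K″[1])[7]` would produce a rational `7`-torsion point on a CM quadratic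
twist of `W` (or make `det ρ̄ = ω` quadratic), and CM curves over `ℚ` have torsion order in `{1, 2, 3, 4, 6}`.
The reducible complement at `(𝒞₇, 7)` of the tree's `X11b.RingClassNoTorsion.torsionBy_ringClassField_eq_bot`
(`Surj W p`) / `X11b.NoTorsionIrr.…_of_hasIrreducibleModPGaloisRep` (`ρ̄` irreducible). D-0171 leaf tag:
ATTACKABLE (M). [cite: GrossLMS1991, §4 Lemma 4.3] [cite: Cox2013, §9.A Lemma 9.3] [cite: Olson1974, Thm. 1] -/
def TypeIIINoSevenTorsionSeven : Prop :=
  ∀ (W : WeierstrassCurve ℚ) [W.IsElliptic] [W.IsGloballyMinimal] [NeZero (W.conductorNorm ℤ)],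
    ClassCSeven W → padicValRat 7 W.Δ = 3 →
    ∀ (K : Type) [Field K] [NumberField K], IsImaginaryQuadratic K → SatisfiesHeegnerHypothesis 7 K →
    ∀ (ι : K →+* ℂ) (Q : (W.baseChange (ringClassField K ι 1)).toAffine.Point), (7 : ℤ) • Q = 0 → Q = 0

/-- **Piece S (WEAKER; CM theory, NEW typed here) — `HeegnerDescentLinkSeven`.** Over an imaginary quadratic
`K″` with the Heegner hypothesis for `N(W)`: whenever a Kolyvagin–Heegner datum of SOME level exists over
`(Dt, β, ι)`, there are a level-`1` datum `d₁` over the same `(Dt, β, ι)`, a Heegner datum `H` of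
discriminant `d_{K″}` and a point `P ∈ E(K″)` with `ι(P) = Σ_Q φ(τ_Q)` (Gross–Zagier's `y_{K″}` for THIS `Dt`)
and `P ↦ P(1) = d₁.derivedPoint` in `E(K″[1])`. The tree proves the `P`-half given `d₁`
(`heegnerSystem_exists_isHeegnerPoint_map_eq_derivedPoint_one`, with `Dt` pinned in its proof term) modulo
Shimura reciprocity at conductor `1` (`heegnerPointOfConductor_one_galoisConj`, named fact).
[cite: GrossLMS1991, §1 (p. 236) and §4 (P_1 = y_K)] [cite: Darmon2004, Thm. 3.7 and §3.7] -/
def HeegnerDescentLinkSeven : Prop :=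
  ∀ (W : WeierstrassCurve ℚ) [W.IsElliptic] [W.IsGloballyMinimal] [NeZero (W.conductorNorm ℤ)],
    ∀ (K : Type) [Field K] [NumberField K], IsImaginaryQuadratic K →
      SatisfiesHeegnerHypothesis (W.conductorNorm ℤ) K →
    ∀ (Dt : ModularParametrizationData W (W.conductorNorm ℤ)) (β : ℤ) (ι : K →+* ℂ) (n : ℕ),
      Nonempty (KolyvaginHeegnerData Dt β ι n) →
      ∃ (d₁ : KolyvaginHeegnerData Dt β ι 1)
        (H : HeegnerDatum (W.conductorNorm ℤ) (NumberField.discr K))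
        (P : (W.baseChange K).toAffine.Point),
        WeierstrassCurve.Affine.Point.map ι.toRatAlgHom P = heegnerPointComplex Dt H ∧
        WeierstrassCurve.Affine.Point.map (algebraMap K (ringClassField K ι 1)).toRatAlgHom P =
          d₁.derivedPoint

/-- **Piece D (WEAKER; descent side data, NEW typed here) — `DescentSideDataSeven`.** At every type-III
member of 𝒞₇: (a) a modular parametrisation datum at level `N(W)` with `7 ∤ c` (THEOREM M of memo g26:
Stevens' datum transport along prime twists from Cremona's `X₀(49) → 49a1`, `c = 1`); (b) for every imaginary
quadratic `K″` with the Heegner hypothesis for `N(W)` and `7` split, a globally minimal model `Wd` of the twist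
`W^{(d_{K″})}` whose scaling `u` is a `7`-adic unit (both models are of type III at `7` since `7 ∤ d_{K″}`).
[cite: Stevens1989, (5.4)–(5.6)] [cite: SilvermanAEC2009, VII.1 and Table 4.1 (Tate's algorithm)] -/
def DescentSideDataSeven : Prop :=
  ∀ (W : WeierstrassCurve ℚ) [W.IsElliptic] [W.IsGloballyMinimal] [NeZero (W.conductorNorm ℤ)],
    ClassCSeven W → padicValRat 7 W.Δ = 3 →
    (∃ Dt : ModularParametrizationData W (W.conductorNorm ℤ), ¬ (7 : ℤ) ∣ Dt.c) ∧
    ∀ (K : Type) [Field K] [NumberField K], IsImaginaryQuadratic K →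
      SatisfiesHeegnerHypothesis (W.conductorNorm ℤ) K → SatisfiesHeegnerHypothesis 7 K →
      ∃ (Wd : WeierstrassCurve ℚ) (_ : Wd.IsElliptic) (_ : Wd.IsGloballyMinimal)
        (Cd : VariableChange ℚ),
        Cd • W.quadraticTwist (NumberField.discr K : ℚ) = Wd ∧ padicValRat 7 (Cd.u : ℚ) = 0

/-- **Piece D(a) (WEAKER; the Manin-datum conjunct of D, NEW typed in REV 3 — D's other conjunct is PROVED in §8,
`descentSideDataSeven_of_maninDatum : DescentManinDatumSeven → DescentSideDataSeven`) — `DescentManinDatumSeven`.**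
At every type-III member of 𝒞₇ there is a modular parametrisation datum at level `N(W)` whose Manin constant is
prime to `7` (THEOREM M of memo g26: Stevens' datum transport (5.4)–(5.6) along odd prime twists, started from the
Manin-`±1` optimal datum of `49a1`; Edixhoven's `p ∤ c` theorem needs `p > 7` and excludes types II, III, IV, so it
does not apply here). [cite: Stevens1989, (5.4)–(5.6)] [cite: Edixhoven1991, Thm. 3 (p. 34)]
[cite: Cremona1997, Table 1, N = 49] -/
def DescentManinDatumSeven : Prop :=
  ∀ (W : WeierstrassCurve ℚ) [W.IsElliptic] [W.IsGloballyMinimal] [NeZero (W.conductorNorm ℤ)],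
    ClassCSeven W → padicValRat 7 W.Δ = 3 →
    ∃ Dt : ModularParametrizationData W (W.conductorNorm ℤ), ¬ (7 : ℤ) ∣ Dt.c

/-- **Piece T (WEAKER; reduction to the type-III stratum, NEW typed here; PROVED in §6 of REV 2, granted GZK,
modularity and Cassels by name — kept as a `def` so that the level-1/2 certificates are unchanged) —
`TypeIIIReductionSeven`.** Every
globally minimal `W ∈ 𝒞₇` NOT of type III at `7` (then of type III*: `W ≅ 49a3^{(D)}` or `49a4^{(D)}`) has a
globally minimal type-III partner `W₃ ∈ 𝒞₇` (the `7`-isogenous `49a1^{(D)}` / `49a2^{(D)}`) such that full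
prime-by-prime BSD transfers from `W₃` to `W` (Cassels' isogeny invariance of the BSD quotient, tree named fact
`bsdRHS_eq_of_isIsogenous` ⇒ `bsdTriple_iff_of_isIsogenous`, read through `bsdTriple_iff_forall_bsdp'`).
[cite: Cassels1965ArithmeticVIII, Thm. 1.3] [cite: MilneADT2006, Thm. I.7.3] [cite: Miller2011LMS, Thm. 1.2] -/
def TypeIIIReductionSeven : Prop :=
  ∀ (W : WeierstrassCurve ℚ) [W.IsElliptic] [W.IsGloballyMinimal],
    ClassCSeven W → padicValRat 7 W.Δ ≠ 3 →
    ∃ (W₃ : WeierstrassCurve ℚ) (_ : W₃.IsElliptic) (_ : W₃.IsGloballyMinimal),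
      ClassCSeven W₃ ∧ padicValRat 7 W₃.Δ = 3 ∧
      ((∀ p : ℕ, p.Prime → BSDp W₃ p) → ∀ p : ℕ, p.Prime → BSDp W p)

/-! ## §2 The level-1 node (target-strength on its stratum; decomposed in §3, not attacked) -/

/-- **NODE `HeegnerIndexIdentitySeven` — the `7`-part of the Gross–Zagier identity (†) over `K″` WITH the
parametrisation constant, on the type-III stratum of 𝒞₇.** For every globally minimal type-III `W ∈ 𝒞₇`, every
analytically admissible `K″` (as in piece A) and every datum `Dt` with `7 ∤ c`, there are a Heegner datum `H`,
an embedding `ι` and a point `P ∈ E(K″)` over GZ's Heegner point of `Dt` such that, once `Ш(E/K″)` is finite,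
`2·ord₇ ∏c_ℓ(W) + ord₇ #Ш(E/K″) + 2·ord₇ c = 2·ord₇ [E(K″) : ℤP]` — literally the hypothesis `hid` of
`O11.bsdp_of_indexIdentityManin` at `p = 7`. [cite: GrossZagier1986, V.§2 (2.2)] [cite: JetchevSkinnerWan2017, §7.4.1 (p. 30)] -/
def HeegnerIndexIdentitySeven : Prop :=
  ∀ (W : WeierstrassCurve ℚ) [W.IsElliptic] [W.IsGloballyMinimal] [NeZero (W.conductorNorm ℤ)]
    [Fact (Nat.Prime 7)],
    ClassCSeven W → padicValRat 7 W.Δ = 3 →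
    ∀ (K : Type) [Field K] [NumberField K], IsImaginaryQuadratic K →
      SatisfiesHeegnerHypothesis (W.conductorNorm ℤ) K → SatisfiesHeegnerHypothesis 7 K →
      NumberField.discr K % 8 = 1 → 4 < (NumberField.discr K).natAbs →
      (W.quadraticTwist (NumberField.discr K : ℚ)).entireLFunction 1 ≠ 0 →
    ∀ (Dt : ModularParametrizationData W (W.conductorNorm ℤ)), ¬ (7 : ℤ) ∣ Dt.c →
      ∃ (H : HeegnerDatum (W.conductorNorm ℤ) (NumberField.discr K)) (ι : K →+* ℂ)
        (P : (W.baseChange K).toAffine.Point),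
        WeierstrassCurve.Affine.Point.map ι.toRatAlgHom P = heegnerPointComplex Dt H ∧
        (Finite (W.baseChange K).sha →
          2 * padicValNat 7 W.tamagawaProduct + padicValNat 7 (W.baseChange K).shaOrder +
              2 * padicValInt 7 Dt.c = 2 * padicValNat 7 (AddSubgroup.zmultiples P).index)

/-! ## §3 LEVEL 2, PROVED: node ⟸ A ∧ B ∧ G ∧ S (Gross–Zagier, Kolyvagin and modularity by name) -/

/-- **LEVEL 2 (PROVED).** `HeegnerIndexIdentitySeven` from the four leaves A, B, G, S, granted modularity
(`hmod`), Gross–Zagier (`hGZ`) and Kolyvagin (`hKo`): A gives a non-divisible derived point over the admissible `K″`; S the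
level-`1` datum over the same `(Dt, β, ι)` with GZ's `y_{K″} = P ↦ P(1)`; `P` is non-torsion by Gross–Zagier,
since `L'(E/K″,1) = L'(E,1)·L(E^{(d)},1) ≠ 0`, hence `rank E(K″) = 1` (Kolyvagin); G gives the exact exponent
`M₀` of `P(1)` and `ord₇[E(K″):ℤP] = M₀`; B gives `#Ш(E/K″)[7^∞] = 7^{2M₀}`; CM kills the Tamagawa term
(`7 ∤ ∏c_ℓ`) and `7 ∤ c` the constant.
[cite: GrossZagier1986, I.(6.3) and V.§2 (2.2)] [cite: GrossLMS1991, Thm. 1.3 and §4] -/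
theorem heegnerIndexIdentity_of_pieces (hmod : hasEntireLFunction_rat)
    (hGZ : ∀ (N : ℕ) [NeZero N] (W : WeierstrassCurve ℚ) (K : Type) [Field K] [NumberField K],
      gross_zagier N W K)
    (hKo : ∀ (N : ℕ) [NeZero N] (W : WeierstrassCurve ℚ) (K : Type) [Field K] [NumberField K],
      kolyvagin N W K)
    (hA : KolyvaginDatumHalfSeven) (hB : EisensteinCMKolyvaginStructureSeven)
    (hG : KolyvaginIndexBookkeepingSeven) (hS : HeegnerDescentLinkSeven) :
    HeegnerIndexIdentitySeven := by
  intro W _ _ _ _ hC hv K _ _ hK hHN hH7 hd8 hB4 hLt Dt hc7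
  -- A: a non-divisible derived Heegner point of square-free Kolyvagin level over the admissible field
  obtain ⟨β, ι, n, d, hsq, hkoly, hndiv⟩ := hA W hC hv Dt hc7 K hK hHN hH7 hd8 hB4 hLt
  -- S: the level-1 datum over the same (Dt, β, ι) and GZ's Heegner point under it
  obtain ⟨d₁, H, P, hP, hP1⟩ := hS W K hK hHN Dt β ι n ⟨d⟩
  refine ⟨H, ι, P, hP, fun hfin => ?_⟩
  -- Gross–Zagier: `P` has infinite order since `L'(E/K″, 1) = L'(E, 1) · L(E^{(d)}, 1) ≠ 0`
  have hr : W.analyticRank = 1 := hC.2.2.1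
  have hL0 : W.entireLFunction 1 = 0 := entireLFunction_one_eq_zero_of_analyticRank_eq_one hr
  have hderiv := (leadingLCoeff_eq_deriv_of_analyticRank_eq_one hr).2
  have hLK : LDerivEK W K ≠ 0 := by
    rw [lDerivEK_eq_deriv_mul_of_entireLFunction_one_eq_zero hmod W K hL0]
    exact mul_ne_zero hderiv hLt
  have hPinf : ¬ IsOfFinAddOrder P :=
    (lDerivEK_ne_zero_iff_not_isOfFinAddOrder W (W.conductorNorm ℤ) K (hGZ _ W K) hK hHN
      ⟨Dt, H, ι, hP⟩).mp hLK
  -- Kolyvagin (by name): rank E(K″) = 1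
  have hrk : (W.baseChange K).mordellWeilRank = 1 :=
    ((hKo (W.conductorNorm ℤ) W K) hK hHN ⟨Dt, H, ι, hP⟩ hPinf).1
  -- G: the exact exponent of P(1) and the index of P
  obtain ⟨hy, M₀, hdiv, hndiv1, hidx⟩ := hG W hC hv K hK hH7 Dt β ι d₁ P hP1 hPinf hrk
  -- B: the exact order of Ш(E/K″)[7^∞]
  have hne3 : NumberField.discr K ≠ -3 := by
    intro h; rw [h] at hB4; norm_num at hB4
  have hne4 : NumberField.discr K ≠ -4 := by
    intro h; rw [h] at hB4; norm_num at hB4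
  have hcard := hB W hC hv K hK hne3 hne4 hHN Dt β ι d₁ hy M₀ hdiv hndiv1 n d hsq hkoly hndiv
  -- bookkeeping
  haveI := hfin
  have hsha : padicValNat 7 (W.baseChange K).shaOrder = 2 * M₀ := by
    unfold WeierstrassCurve.shaOrder
    have h := padicValNat_card_addPrimaryComponent (A := (W.baseChange K).sha) 7
    rw [hcard, padicValNat.prime_pow] at h
    exact h.symm
  have htam : padicValNat 7 W.tamagawaProduct = 0 :=
    padicValNat.eq_zero_of_not_dvd
      (RouteU.not_dvd_tamagawaProduct_of_hasCM W hC.1 7 (by norm_num) (by norm_num))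
  have hc : padicValInt 7 Dt.c = 0 := padicValInt.eq_zero_of_not_dvd hc7
  rw [htam, hsha, hc, hidx]
  ring

/-! ## §4 LEVEL 1, PROVED: K7r ⟸ node ∧ D ∧ T (published facts by name) -/

/-- **`BSD(E,p)` at every prime for every globally minimal TYPE-III member of 𝒞₇, from the node and the side
data** — the tree's Manin-carrying descent `O11.bsdp_of_indexIdentityManin` at `p = 7` over THEOREM A's
auxiliary field (`exists_heegnerField_split_two_split_oddDiscr_twist_ne_zero` at `7`, bound `4`), composed with
the 𝒞₇ assembly `ClassCSeven.forall_bsdp_iff_bsdp_seven`. Discharged here, class-wide: `htw` (the twin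
`Wd ≅ W^{(d)}` is CM of analytic rank `0`: Burungale–Flach `hBF` + `forall_bsdp_of_bsdTriple'` +
`X11b.Three.exists_LOne_div_realPeriodRat_of_bsdp_rankZero`), `htam` (CM ⇒ `7 ∤ ∏c_ℓ` on both sides,
`RouteU.not_dvd_tamagawaProduct_of_hasCM`), `hμ` (`|d| > 4`). [cite: GrossZagier1986, V.§2 (pp. 310–312)]
[cite: BurungaleFlach2024, Thm 1.1 and Cor. 2] [cite: FriedbergHoffstein1995, Thm. B] [cite: Miller2011LMS, §1 and Def. 1.1] -/
theorem forall_bsdp_typeIII_of_pieces (hBF : bsdTriple_of_hasCM_of_L_one_ne_zero)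
    (hmod : hasEntireLFunction_rat) (hnf : exists_isNewformOf)
    (hLLT : LiLiuTian2024.thm11_bsdp_of_cm_rank_one) (hKob : Kobayashi2013.cor14_bsdp_of_cm_rank_one)
    (hLTYZ : LiTianYanZhu2025.thm11_bsdp_of_cm_rank_one)
    (hGZK : rank_eq_analyticRank_of_analyticRank_le_one)
    (hFH : friedbergHoffstein_exists_heegnerField_splitDivisors_twist_ne_zero)
    (hGZ : ∀ (N : ℕ) [NeZero N] (W : WeierstrassCurve ℚ) (K : Type) [Field K] [NumberField K],
      gross_zagier N W K)
    (hKo : ∀ (N : ℕ) [NeZero N] (W : WeierstrassCurve ℚ) (K : Type) [Field K] [NumberField K],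
      kolyvagin N W K)
    (hI : HeegnerIndexIdentitySeven) (hD : DescentSideDataSeven)
    (W : WeierstrassCurve ℚ) [W.IsElliptic] [W.IsGloballyMinimal] (hC : ClassCSeven W)
    (hv : padicValRat 7 W.Δ = 3) (p : ℕ) (hp : p.Prime) : BSDp W p := by
  haveI : Fact (Nat.Prime 7) := ⟨Nat.prime_seven⟩
  haveI : NeZero (W.conductorNorm ℤ) := ⟨(W.conductorNorm_pos_holds).ne'⟩
  refine (ClassCSeven.forall_bsdp_iff_bsdp_seven hBF hmod hLLT hKob hLTYZ hC).2 ?_ p hp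
  -- the side data at this member
  obtain ⟨⟨Dt, hc7⟩, hDK⟩ := hD W hC hv
  have hc0 : Dt.c ≠ 0 := fun h => hc7 (h ▸ dvd_zero 7)
  -- THEOREM A: an analytically admissible auxiliary field
  have hw : W.rootNumber = -1 := by
    have h := W.rootNumber_eq_neg_one_pow_analyticRank_of_exists_isNewformOf hnf
    rw [hC.2.2.1] at h
    simpa using h
  obtain ⟨K, hF, hN, hK, hB4, hHN, hH7, hH2, -, hLt⟩ :=
    exists_heegnerField_split_two_split_oddDiscr_twist_ne_zero hFH W hw Nat.prime_seven 4
  have hd8 : NumberField.discr K % 8 = 1 :=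
    SatisfiesHeegnerHypothesis.discr_emod_eight hK.1 hH2 (dvd_refl 2)
  have hd4 : NumberField.discr K < -4 := by
    have hneg := hK.discr_neg
    omega
  -- the node at (W, K″, Dt)
  obtain ⟨H, ι, P, hP, hid⟩ := hI W hC hv K hK hHN hH7 hd8 hB4 hLt Dt hc7
  -- the minimal twist model
  obtain ⟨Wd, _, _, Cd, hWd, hu⟩ := hDK K hK hHN hH7
  -- the twin is CM of analytic rank 0: its value binder from Burungale–Flach
  have hD0 : (NumberField.discr K : ℚ) ≠ 0 := by exact_mod_cast NumberField.discr_ne_zero K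
  haveI := W.isElliptic_quadraticTwist hD0
  have hCMd : Wd.HasCM := by
    rw [← hWd]
    exact hasCM_variableChange _ Cd (hasCM_quadraticTwist W hD0 hC.1)
  have hLd : Wd.entireLFunction 1 ≠ 0 := by
    rw [← hWd, entireLFunction_smul]
    exact hLt
  have hrd : Wd.analyticRank = 0 := (analyticRank_eq_zero_iff_holds (W := Wd) (hmod Wd)).mpr hLd
  have htw := X11b.Three.exists_LOne_div_realPeriodRat_of_bsdp_rankZero hGZK hmod Wd 7 hrd
    (forall_bsdp_of_bsdTriple' Wd (hBF Wd hCMd hLd) 7 (by norm_num))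
  have htam : padicValNat 7 Wd.tamagawaProduct = padicValNat 7 W.tamagawaProduct := by
    rw [padicValNat.eq_zero_of_not_dvd
        (RouteU.not_dvd_tamagawaProduct_of_hasCM Wd hCMd 7 (by norm_num) (by norm_num)),
      padicValNat.eq_zero_of_not_dvd
        (RouteU.not_dvd_tamagawaProduct_of_hasCM W hC.1 7 (by norm_num) (by norm_num))]
  exact bsdp_of_indexIdentityManin W 7 (W.conductorNorm ℤ) K Dt H ι P (hGZ _ W K) (hKo _ W K) hGZK
    hmod hK hHN hP (by norm_num) hc0 (RouteU.not_seven_dvd_unitsTorsionOrder hK hd4) hC.2.2.1 hLt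
    Wd Cd hWd htw htam hu hid

/-- **LEVEL 1 (PROVED): K7r ⟸ node ∧ D ∧ T.** `X12.CMRamifiedSeven` — full prime-by-prime BSD for every
globally minimal `W ∈ 𝒞₇` — from `HeegnerIndexIdentitySeven`, `DescentSideDataSeven`, `TypeIIIReductionSeven`
and the published facts by name (type-III members directly, type-III* members through their partner).
[cite: Miller2011LMS, §1 and Def. 1.1] [cite: Cassels1965ArithmeticVIII, Thm. 1.3] -/
theorem cmRamifiedSeven_of_pieces (hBF : bsdTriple_of_hasCM_of_L_one_ne_zero)
    (hmod : hasEntireLFunction_rat) (hnf : exists_isNewformOf)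
    (hLLT : LiLiuTian2024.thm11_bsdp_of_cm_rank_one) (hKob : Kobayashi2013.cor14_bsdp_of_cm_rank_one)
    (hLTYZ : LiTianYanZhu2025.thm11_bsdp_of_cm_rank_one)
    (hGZK : rank_eq_analyticRank_of_analyticRank_le_one)
    (hFH : friedbergHoffstein_exists_heegnerField_splitDivisors_twist_ne_zero)
    (hGZ : ∀ (N : ℕ) [NeZero N] (W : WeierstrassCurve ℚ) (K : Type) [Field K] [NumberField K],
      gross_zagier N W K)
    (hKo : ∀ (N : ℕ) [NeZero N] (W : WeierstrassCurve ℚ) (K : Type) [Field K] [NumberField K],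
      kolyvagin N W K)
    (hI : HeegnerIndexIdentitySeven) (hD : DescentSideDataSeven) (hT : TypeIIIReductionSeven) :
    X12.CMRamifiedSeven := by
  intro W _ _ hC p hp
  by_cases hv : padicValRat 7 W.Δ = 3
  · exact forall_bsdp_typeIII_of_pieces hBF hmod hnf hLLT hKob hLTYZ hGZK hFH hGZ hKo hI hD W hC hv p hp
  · obtain ⟨W₃, _, _, hC₃, hv₃, himp⟩ := hT W hC hv
    exact himp
      (forall_bsdp_typeIII_of_pieces hBF hmod hnf hLLT hKob hLTYZ hGZK hFH hGZ hKo hI hD W₃ hC₃ hv₃)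
      p hp

/-! ## §5 COMPOSITE, PROVED: K7r ⟸ A ∧ B ∧ G ∧ S ∧ D ∧ T -/

/-- **THE NODE'S `closes` (PROVED): leaf K7r from the six leaves** — A (research: Kolyvagin mod `7` on the
type-III stratum), B (THEOREM R), G (bookkeeping), S (Heegner descent link), D (side data), T (III* → III) —
and the published facts by name. Every leaf except A is WEAKER than K7r; A is UNDECIDED and idea-bound (card
`cuspidal-descent-kolyvagin-nonvanishing`). [cite: Kolyvagin1991, Thm. 1] [cite: GrossZagier1986, V.§2 (2.2)]
[cite: Miller2011LMS, §1 and Def. 1.1] -/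
theorem cmRamifiedSeven_of_leaves (hBF : bsdTriple_of_hasCM_of_L_one_ne_zero)
    (hmod : hasEntireLFunction_rat) (hnf : exists_isNewformOf)
    (hLLT : LiLiuTian2024.thm11_bsdp_of_cm_rank_one) (hKob : Kobayashi2013.cor14_bsdp_of_cm_rank_one)
    (hLTYZ : LiTianYanZhu2025.thm11_bsdp_of_cm_rank_one)
    (hGZK : rank_eq_analyticRank_of_analyticRank_le_one)
    (hFH : friedbergHoffstein_exists_heegnerField_splitDivisors_twist_ne_zero)
    (hGZ : ∀ (N : ℕ) [NeZero N] (W : WeierstrassCurve ℚ) (K : Type) [Field K] [NumberField K],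
      gross_zagier N W K)
    (hKo : ∀ (N : ℕ) [NeZero N] (W : WeierstrassCurve ℚ) (K : Type) [Field K] [NumberField K],
      kolyvagin N W K)
    (hA : KolyvaginDatumHalfSeven) (hB : EisensteinCMKolyvaginStructureSeven)
    (hG : KolyvaginIndexBookkeepingSeven) (hS : HeegnerDescentLinkSeven)
    (hD : DescentSideDataSeven) (hT : TypeIIIReductionSeven) : X12.CMRamifiedSeven :=
  cmRamifiedSeven_of_pieces hBF hmod hnf hLLT hKob hLTYZ hGZK hFH hGZ hKo
    (heegnerIndexIdentity_of_pieces hmod hGZ hKo hA hB hG hS) hD hT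

/-! ## §6 REV 2 — LEAF T PROVED, granted Gross–Zagier–Kolyvagin, modularity and Cassels by name -/

section LeafT

open scoped NumberField

open NumberField IsDedekindDomain Rat.HeightOneSpectrum Literature.NumberTheory.DiophantineGeometry

/-- **`ord₇ Δ(W) ∈ {3, 9}` for every globally minimal `W ∈ 𝒞₇`.** A member of 𝒞₇ is in class X12 at the
CM-ramified prime `7` (`ClassCSeven.classX12_seven`, `ClassCSeven.cmRamified_seven`), so its Kodaira type at the
place over `7` is `III` or `III*` (`X12.localType_of_classX12_of_cmRamified`: a quadratic twist of the short
model of `49a1`/`49a2`, Tate's algorithm Steps 1–3 / 6–9); on these types `ord_v Δ_min = m_v + 1 = 3, 9`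
(`ordMinimalDiscriminant_eq_numComponentsAt_add_one_of_kodairaSymbolAt`), and `ord_v Δ_min = ord₇ Δ(W)` on a
globally minimal equation (`LocalTorsionMult.ordMinimalDiscriminant_eq_padicValInt`, `cast_minimalDiscriminantInt`).
[cite: SilvermanATAEC1994, IV.9.4 Table 4.1 and App. A §3] [cite: SilvermanAEC2009, VIII.8 (minimal discriminant)] -/
theorem padicValRat_Δ_eq_three_or_nine_of_classCSeven (W : WeierstrassCurve ℚ) [W.IsElliptic]
    [W.IsGloballyMinimal] (hC : ClassCSeven W) :
    padicValRat 7 W.Δ = 3 ∨ padicValRat 7 W.Δ = 9 := by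
  haveI h7 : Fact (Nat.Prime 7) := ⟨by norm_num⟩
  set v : HeightOneSpectrum (𝓞 ℚ) := (primesEquiv (R := 𝓞 ℚ)).symm ⟨7, h7.out⟩ with hvdef
  have hv : primesEquiv v = ⟨7, h7.out⟩ := Equiv.apply_symm_apply _ _
  have hv7 : ((primesEquiv v : Nat.Primes) : ℕ) = 7 := by rw [hv]
  have hgen : natGenerator v = 7 := congrArg Subtype.val hv
  have hK : W.kodairaSymbolAt v = .III ∨ W.kodairaSymbolAt v = .IIIstar :=
    (localType_of_classX12_of_cmRamified W 7 (ClassCSeven.classX12_seven hC) (by norm_num)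
      (ClassCSeven.cmRamified_seven hC) v hgen).1
  haveI := perfectField_residueField_adicCompletionIntegers (K := ℚ) v
  have h2 : ringChar (𝓞 ℚ ⧸ v.asIdeal) ≠ 2 := by
    rw [X2.ringChar_quot_asIdeal_eq_primesEquiv, hv7]; norm_num
  have hord := W.ordMinimalDiscriminant_eq_numComponentsAt_add_one_of_kodairaSymbolAt v h2
    (hK.elim Or.inl (fun h ↦ Or.inr (Or.inl h)))
  rw [LocalTorsionMult.ordMinimalDiscriminant_eq_padicValInt W v hv7] at hord
  unfold WeierstrassCurve.numComponentsAt at hord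
  have hΔ : padicValRat 7 W.Δ = padicValInt 7 W.minimalDiscriminantInt := by
    rw [← cast_minimalDiscriminantInt W, padicValRat.of_int]
  rcases hK with hK | hK
  · left
    rw [hΔ, hord, hK, show KodairaSymbol.numComponents .III = 2 from rfl]
    norm_num
  · right
    rw [hΔ, hord, hK, show KodairaSymbol.numComponents .IIIstar = 8 from rfl]
    norm_num

/-- **`ord₇ Δ(C • W^{(−7)}) = 12·ord₇(u_C⁻¹) + 6 + ord₇ Δ(W)`** for an elliptic `W/ℚ` and any change of variables
`C`: `Δ(C • X) = u⁻¹² Δ(X)` and `Δ(W^{(d)}) = d⁶ Δ(W)`. [cite: SilvermanAEC2009, III.1 Table 3.1 and X.5 (twists)] -/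
theorem padicValRat_Δ_smul_quadraticTwist_negSeven (W : WeierstrassCurve ℚ) [W.IsElliptic]
    (C : VariableChange ℚ) :
    padicValRat 7 (C • W.quadraticTwist (-7)).Δ =
      12 * padicValRat 7 ((C.u⁻¹ : ℚˣ) : ℚ) + 6 + padicValRat 7 W.Δ := by
  haveI h7 : Fact (Nat.Prime 7) := ⟨by norm_num⟩
  have hu0 : ((C.u⁻¹ : ℚˣ) : ℚ) ≠ 0 := (C.u⁻¹).ne_zero
  have hΔ0 : W.Δ ≠ 0 := W.isUnit_Δ.ne_zero
  have h70 : (-7 : ℚ) ≠ 0 := by norm_num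
  have h76 : (-7 : ℚ) ^ 6 ≠ 0 := pow_ne_zero 6 h70
  have hself : padicValRat 7 (-7 : ℚ) = 1 := by
    rw [padicValRat.neg, show (7 : ℚ) = ((7 : ℕ) : ℚ) by norm_num, padicValRat.self (by norm_num)]
  rw [variableChange_Δ, quadraticTwist_Δ, padicValRat.mul (pow_ne_zero 12 hu0) (mul_ne_zero h76 hΔ0),
    padicValRat.pow ((C.u⁻¹ : ℚˣ) : ℚ), padicValRat.mul h76 hΔ0, padicValRat.pow (-7 : ℚ), hself]
  push_cast
  ring

/-- **LEAF T PROVED (granted GZK, modularity and Cassels BY NAME): `TypeIIIReductionSeven`.** For a globally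
minimal `W ∈ 𝒞₇` with `ord₇ Δ(W) ≠ 3`: the `ℚ`-isogenous globally minimal maximal-order model `W′`
(`X12.exists_isGloballyMinimal_isIsogenous_maximal_cmFieldDiscr_eq`; `W′ ∈ 𝒞₇` by `classCSeven_iff_of_isIsogenous`)
has `ord₇ Δ(W′) ∈ {3, 9}` (`padicValRat_Δ_eq_three_or_nine_of_classCSeven`). If it is `3`, `W₃ := W′`. If it is
`9`, `W₃ := C • W′^{(−7)}` is a global minimal model (`hasGlobalMinimalModel_rat_holds`) of the twist by the CM
discriminant `d_K = cmFieldDiscr j(W′) = −7`, which is `ℚ`-isogenous to `W′` (PROVED tree theorem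
`isIsogenous_quadraticTwist_cmFieldDiscr_holds`), hence in 𝒞₇, and `ord₇ Δ(W₃) = 15 + 12·ord₇(u⁻¹) ∈ {3, 9}`
forces `ord₇ Δ(W₃) = 3`. In both cases `W ∼ W₃` over `ℚ` and `BSD(W₃, p) → BSD(W, p)` at every prime is Cassels'
isogeny invariance at analytic rank `1` (`Theorems.Rank1ResidualX1Isogeny.bsdp_iff_of_isIsogenous`, binders
`hGZK`, `hmod`, `hCassels`). [cite: Cassels1965ArithmeticVIII, Thm. 1.3] [cite: MilneADT2006, Thm. I.7.3]
[cite: Miller2011LMS, §1 Def. 1.1] [cite: SilvermanAEC2009, X.5 Prop. 5.4 and VIII.8] [cite: BurungaleFlach2024, Cor. 2] -/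
theorem typeIIIReductionSeven_of_cassels (hGZK : rank_eq_analyticRank_of_analyticRank_le_one)
    (hmod : hasEntireLFunction_rat) (hCassels : bsdRHS_eq_of_isIsogenous) : TypeIIIReductionSeven := by
  intro W _ _ hC h3
  haveI h7 : Fact (Nat.Prime 7) := ⟨by norm_num⟩
  have hr : W.analyticRank ≤ 1 := hC.2.2.1.le
  -- BSD transfers to `W` along any `ℚ`-isogeny from `W` (Cassels by name, `r_an(W) ≤ 1`)
  have transfer : ∀ (V : WeierstrassCurve ℚ) [V.IsElliptic] [V.IsGloballyMinimal], IsIsogenous W V →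
      (∀ p : ℕ, p.Prime → BSDp V p) → ∀ p : ℕ, p.Prime → BSDp W p := by
    intro V _ _ hiso hB p hp
    haveI : Fact p.Prime := ⟨hp⟩
    exact (Theorems.Rank1ResidualX1Isogeny.bsdp_iff_of_isIsogenous hGZK hmod hCassels W V hiso p hr).mpr
      (hB p hp)
  -- the maximal-order partner `W′ ∼ W`, `j(W′) = -3375`
  have hj : W.j ∈ cmJInvariants := (hasCM_iff_j_mem_holds W).mp hC.1
  obtain ⟨W', hE', hM', hiso, hjmax, hd⟩ := exists_isGloballyMinimal_isIsogenous_maximal_cmFieldDiscr_eq W hj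
  have hC' : ClassCSeven W' :=
    (Theorems.RamifiedSevenEllipticUnits.classCSeven_iff_of_isIsogenous hiso).mp hC
  by_cases h3' : padicValRat 7 W'.Δ = 3
  · exact ⟨W', hE', hM', hC', h3', transfer W' hiso⟩
  · have h9' : padicValRat 7 W'.Δ = 9 :=
      (padicValRat_Δ_eq_three_or_nine_of_classCSeven W' hC').resolve_left h3'
    -- the twist by the CM discriminant `-7` is `ℚ`-isogenous to `W′`
    have hd7 : (cmFieldDiscr W'.j : ℚ) = -7 := by
      rw [hd, hC.2.1]; norm_num
    have hisoT : IsIsogenous W' (W'.quadraticTwist (-7)) := by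
      have h := isIsogenous_quadraticTwist_cmFieldDiscr_holds W' hjmax
      rwa [hd7] at h
    haveI : (W'.quadraticTwist (-7)).IsElliptic := W'.isElliptic_quadraticTwist (by norm_num)
    obtain ⟨C, hCmin⟩ := hasGlobalMinimalModel_rat_holds (W'.quadraticTwist (-7))
    haveI := hCmin
    have hiso'' : IsIsogenous W' (C • W'.quadraticTwist (-7)) := hisoT.smul_right C
    have hisoW : IsIsogenous W (C • W'.quadraticTwist (-7)) := hiso.trans' hiso''
    have hC'' : ClassCSeven (C • W'.quadraticTwist (-7)) :=
      (Theorems.RamifiedSevenEllipticUnits.classCSeven_iff_of_isIsogenous hiso'').mp hC'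
    refine ⟨C • W'.quadraticTwist (-7), inferInstance, hCmin, hC'', ?_, transfer _ hisoW⟩
    have hval := padicValRat_Δ_smul_quadraticTwist_negSeven W' C
    rcases padicValRat_Δ_eq_three_or_nine_of_classCSeven (C • W'.quadraticTwist (-7)) hC'' with h | h
    · exact h
    · exfalso
      rw [hval, h9'] at h
      omega

end LeafT

/-! ## §7 REV 2 COMPOSITE, PROVED: K7r ⟸ A ∧ B ∧ G ∧ S ∧ D (five leaves; T discharged by §6) -/

/-- **THE NODE'S `closes` WITH FIVE LEAVES (PROVED): leaf K7r from A, B, G, S, D** and the published facts by name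
(REV 2: the binder `hT` of `cmRamifiedSeven_of_leaves` is discharged by `typeIIIReductionSeven_of_cassels`; the one
new fact binder is Cassels' `hCassels : bsdRHS_eq_of_isIsogenous`, Milne *ADT* I.7.3). Every leaf except A is WEAKER
than K7r; A is UNDECIDED and idea-bound (card `cuspidal-descent-kolyvagin-nonvanishing`).
[cite: Kolyvagin1991, Thm. 1] [cite: GrossZagier1986, V.§2 (2.2)] [cite: Cassels1965ArithmeticVIII, Thm. 1.3]
[cite: Miller2011LMS, §1 and Def. 1.1] -/
theorem cmRamifiedSeven_of_five_leaves (hBF : bsdTriple_of_hasCM_of_L_one_ne_zero)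
    (hmod : hasEntireLFunction_rat) (hnf : exists_isNewformOf)
    (hLLT : LiLiuTian2024.thm11_bsdp_of_cm_rank_one) (hKob : Kobayashi2013.cor14_bsdp_of_cm_rank_one)
    (hLTYZ : LiTianYanZhu2025.thm11_bsdp_of_cm_rank_one)
    (hGZK : rank_eq_analyticRank_of_analyticRank_le_one)
    (hCassels : bsdRHS_eq_of_isIsogenous)
    (hFH : friedbergHoffstein_exists_heegnerField_splitDivisors_twist_ne_zero)
    (hGZ : ∀ (N : ℕ) [NeZero N] (W : WeierstrassCurve ℚ) (K : Type) [Field K] [NumberField K],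
      gross_zagier N W K)
    (hKo : ∀ (N : ℕ) [NeZero N] (W : WeierstrassCurve ℚ) (K : Type) [Field K] [NumberField K],
      kolyvagin N W K)
    (hA : KolyvaginDatumHalfSeven) (hB : EisensteinCMKolyvaginStructureSeven)
    (hG : KolyvaginIndexBookkeepingSeven) (hS : HeegnerDescentLinkSeven)
    (hD : DescentSideDataSeven) : X12.CMRamifiedSeven :=
  cmRamifiedSeven_of_leaves hBF hmod hnf hLLT hKob hLTYZ hGZK hFH hGZ hKo hA hB hG hS hD
    (typeIIIReductionSeven_of_cassels hGZK hmod hCassels)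

/-! ## §8 REV 3 — LEAF D SPLIT: D ⟸ D(a); conjunct (b) PROVED unconditionally -/

section LeafD

open scoped NumberField

open NumberField IsDedekindDomain Rat.HeightOneSpectrum Literature.NumberTheory.DiophantineGeometry
  Literature.NumberTheory.EllipticCurves.Rank1Residual

/-- **Leaf D(b) PROVED (unconditional): the `7`-unit twist model.** For a globally minimal `W/ℚ` with
`ord₇ Δ = 3` and an imaginary quadratic `K` in which `7` splits: `7 ∤ d_K` (`Rank1Residual.not_dvd_discr_of_split`),
so at the place `v ∣ 7` the twisted equation `W^{(d_K)} = ⟨0, d b₂/4, 0, d² b₄/2, d³ b₆/4⟩` is integral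
(`isIntegralAt_of_valuation_le_one`; `v(2) = v(4) = v(d_K) = 1`, `b_i ∈ ℤ` via `integralModelInt`) with
`v(Δ) = v(d_K)⁶ · v(Δ_W) = exp(−3) > exp(−12)` — `v(Δ_W) = exp(−ord_v Δ_min(W)) = exp(−3)` by global minimality
(`valuation_Δ_eq_of_isMinimalAt`, `LocalTorsionMult.ordMinimalDiscriminant_eq_padicValInt`) — hence MINIMAL at `v`
(`isMinimalAt_of_lt_valuation_Δ`), so `ord_v Δ_min(W^{(d_K)}) = 3`; `ord_v Δ_min` is invariant under the scaling `Cd`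
to a global minimal model `Wd` (`hasGlobalMinimalModel_rat`, `ordMinimalDiscriminant_smul`), on which it is `ord₇ Δ(Wd)`;
finally `3 = ord₇ Δ(Wd) = −12·ord₇ u + 6·ord₇ d_K + ord₇ Δ_W = −12·ord₇ u + 3`.
[cite: SilvermanAEC2009, VII.1 (Rem. 1.1: ord_v Δ < 12 ⇒ minimal) and VIII.8 (global minimal models over ℚ)] -/
theorem descentTwistModelSeven (W : WeierstrassCurve ℚ) [W.IsElliptic] [W.IsGloballyMinimal]
    (h3 : padicValRat 7 W.Δ = 3) (K : Type) [Field K] [NumberField K] (hK : IsImaginaryQuadratic K)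
    (h7K : SatisfiesHeegnerHypothesis 7 K) :
    ∃ (Wd : WeierstrassCurve ℚ) (_ : Wd.IsElliptic) (_ : Wd.IsGloballyMinimal) (Cd : VariableChange ℚ),
      Cd • W.quadraticTwist (NumberField.discr K : ℚ) = Wd ∧ padicValRat 7 (Cd.u : ℚ) = 0 := by
  haveI hp7 : Fact (Nat.Prime 7) := ⟨by norm_num⟩
  set d : ℤ := NumberField.discr K with hd
  have hd0 : d ≠ 0 := NumberField.discr_ne_zero K
  have hdq : (d : ℚ) ≠ 0 := by exact_mod_cast hd0
  have h7d : ¬ ((7 : ℕ) : ℤ) ∣ d := Rank1Residual.not_dvd_discr_of_split hK hp7.out (by norm_num) h7K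
  haveI := W.isElliptic_quadraticTwist hdq
  obtain ⟨Cd, hmin⟩ := hasGlobalMinimalModel_rat_holds (W.quadraticTwist (d : ℚ))
  haveI := hmin
  refine ⟨Cd • W.quadraticTwist (d : ℚ), inferInstance, hmin, Cd, rfl, ?_⟩
  -- the place of `ℚ` over `7`
  set v : HeightOneSpectrum (𝓞 ℚ) := (primesEquiv (R := 𝓞 ℚ)).symm ⟨7, hp7.out⟩ with hvdef
  have hv : primesEquiv v = ⟨7, hp7.out⟩ := Equiv.apply_symm_apply _ _
  have hv7 : ((primesEquiv v : Nat.Primes) : ℕ) = 7 := by rw [hv]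
  have h7d' : ¬ ((primesEquiv v : ℕ) : ℤ) ∣ d := by rw [hv7]; exact h7d
  -- (1) `ord₇ Δ_min(W) = 3`, i.e. `v(Δ_W) = exp (-3)`
  have hΔW : padicValRat 7 W.Δ = padicValInt 7 W.minimalDiscriminantInt := by
    rw [← cast_minimalDiscriminantInt W, padicValRat.of_int]
  have hordW : W.ordMinimalDiscriminant v = 3 := by
    have h := LocalTorsionMult.ordMinimalDiscriminant_eq_padicValInt W v hv7
    have h' : ((padicValInt 7 W.minimalDiscriminantInt : ℕ) : ℤ) = 3 := by rw [← hΔW]; exact h3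
    omega
  have hvΔW : v.valuation ℚ W.Δ = WithZero.exp (-3 : ℤ) := by
    rw [valuation_Δ_eq_of_isMinimalAt_holds (v := v) (W := W) (IsGloballyMinimal.isMinimal v), hordW]
    rfl
  -- (2) the twisted equation is `v`-integral (`v ∤ 2`, `W` integral)
  have hp2 : ¬ ((primesEquiv v : ℕ) : ℤ) ∣ 2 := by rw [hv7]; decide
  have hp4 : ¬ ((primesEquiv v : ℕ) : ℤ) ∣ 4 := by rw [hv7]; decide
  set M : WeierstrassCurve ℤ := integralModelInt W with hM
  have hWM : M.map (Int.castRingHom ℚ) = W := map_integralModelInt W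
  have hWb₂ : W.b₂ = (M.b₂ : ℚ) := by rw [← congrArg WeierstrassCurve.b₂ hWM, map_b₂, eq_intCast]
  have hWb₄ : W.b₄ = (M.b₄ : ℚ) := by rw [← congrArg WeierstrassCurve.b₄ hWM, map_b₄, eq_intCast]
  have hWb₆ : W.b₆ = (M.b₆ : ℚ) := by rw [← congrArg WeierstrassCurve.b₆ hWM, map_b₆, eq_intCast]
  have hv4 : v.valuation ℚ (4 : ℚ) = 1 := by
    have h := valuation_ringOfIntegers_intCast_eq_one v (n := 4) (by exact_mod_cast hp4)
    simpa using h
  have hv2' : v.valuation ℚ (2 : ℚ) = 1 := by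
    have h := valuation_ringOfIntegers_intCast_eq_one v (n := 2) (by exact_mod_cast hp2)
    simpa using h
  have hvD : v.valuation ℚ (d : ℚ) = 1 := valuation_ringOfIntegers_intCast_eq_one v h7d'
  have hvb₂ : v.valuation ℚ W.b₂ ≤ 1 := hWb₂ ▸ valuation_ringOfIntegers_intCast_le_one v _
  have hvb₄ : v.valuation ℚ W.b₄ ≤ 1 := hWb₄ ▸ valuation_ringOfIntegers_intCast_le_one v _
  have hvb₆ : v.valuation ℚ W.b₆ ≤ 1 := hWb₆ ▸ valuation_ringOfIntegers_intCast_le_one v _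
  have hint : (W.quadraticTwist (d : ℚ)).IsIntegralAt v := by
    refine (W.quadraticTwist (d : ℚ)).isIntegralAt_of_valuation_le_one v ?_ ?_ ?_ ?_ ?_
    · simp
    · simp only [quadraticTwist_a₂, map_div₀, map_mul, hv4, hvD, div_one, one_mul]
      exact hvb₂
    · simp
    · simp only [quadraticTwist_a₄, map_div₀, map_mul, map_pow, hv2', hvD, div_one, one_pow, one_mul]
      exact hvb₄
    · simp only [quadraticTwist_a₆, map_div₀, map_mul, map_pow, hv4, hvD, div_one, one_pow, one_mul]
      exact hvb₆
  -- (3) `v(Δ(W^{(d)})) = exp (-3) > exp (-12)`: the twisted equation is minimal at `v`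
  have hΔX : v.valuation ℚ (W.quadraticTwist (d : ℚ)).Δ = WithZero.exp (-3 : ℤ) := by
    rw [quadraticTwist_Δ, map_mul, map_pow, hvD, hvΔW, one_pow, one_mul]
  have hminX : (W.quadraticTwist (d : ℚ)).IsMinimalAt v :=
    isMinimalAt_of_lt_valuation_Δ_holds hint (by rw [hΔX]; exact WithZero.exp_lt_exp.mpr (by norm_num))
  have hordX : (W.quadraticTwist (d : ℚ)).ordMinimalDiscriminant v = 3 := by
    have hread := valuation_Δ_eq_of_isMinimalAt_holds (v := v) (W := W.quadraticTwist (d : ℚ)) hminX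
    rw [hΔX] at hread
    have h := WithZero.exp_injective hread
    omega
  -- (4) transport along `Cd` and read on the globally minimal `Wd`
  have hordWd : (Cd • W.quadraticTwist (d : ℚ)).ordMinimalDiscriminant v = 3 := by
    rw [ordMinimalDiscriminant_smul_holds v (W.quadraticTwist (d : ℚ)) Cd, hordX]
  have hΔWd : padicValRat 7 (Cd • W.quadraticTwist (d : ℚ)).Δ = 3 := by
    have h := LocalTorsionMult.ordMinimalDiscriminant_eq_padicValInt (Cd • W.quadraticTwist (d : ℚ)) v hv7
    rw [← cast_minimalDiscriminantInt (Cd • W.quadraticTwist (d : ℚ)), padicValRat.of_int]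
    omega
  -- (5) valuation arithmetic: `3 = ord₇ Δ(Wd) = 12·ord₇(u⁻¹) + 6·ord₇ d + ord₇ Δ(W) = -12·ord₇ u + 3`
  have hu0 : ((Cd.u⁻¹ : ℚˣ) : ℚ) ≠ 0 := (Cd.u⁻¹).ne_zero
  have hΔ0 : W.Δ ≠ 0 := W.isUnit_Δ.ne_zero
  have hd6 : (d : ℚ) ^ 6 ≠ 0 := pow_ne_zero 6 hdq
  have hvd : padicValRat 7 (d : ℚ) = 0 := by
    rw [padicValRat.of_int, Nat.cast_eq_zero, padicValInt.eq_zero_of_not_dvd]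
    exact_mod_cast h7d
  have hinv : padicValRat 7 ((Cd.u⁻¹ : ℚˣ) : ℚ) = -padicValRat 7 ((Cd.u : ℚˣ) : ℚ) := by
    rw [Units.val_inv_eq_inv_val, padicValRat.inv]
  rw [variableChange_Δ, quadraticTwist_Δ, padicValRat.mul (pow_ne_zero 12 hu0) (mul_ne_zero hd6 hΔ0),
    padicValRat.pow ((Cd.u⁻¹ : ℚˣ) : ℚ), padicValRat.mul hd6 hΔ0, padicValRat.pow (d : ℚ), hvd, h3,
    hinv] at hΔWd
  push_cast at hΔWd
  linarith

end LeafD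

/-- **D ⟸ D(a) (PROVED): the descent side data from the Manin datum alone**, conjunct (b) being
`descentTwistModelSeven`. -/
theorem descentSideDataSeven_of_maninDatum (hDa : DescentManinDatumSeven) : DescentSideDataSeven := by
  intro W _ _ _ hC h3
  exact ⟨hDa W hC h3, fun K _ _ hK _ h7K ↦ descentTwistModelSeven W h3 K hK h7K⟩

/-! ## §9 REV 3 — LEAF S PROVED unconditionally (Darmon Thm. 3.6 / 3.7 at conductor 1 are tree theorems) -/

/-- **Leaf S PROVED (unconditional).** Given a Kolyvagin–Heegner datum of some level over `(Dt, β, ι)`, its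
orientation `4N ∣ β² − d_K` yields a conductor-`1` datum `d₁` (Darmon Thm. 3.6 at conductor `1`, PROVED:
`exists_kolyvaginHeegnerData_one` ∘ `phi_heegnerTau_mem_singularModuliField_holds`), a Heegner datum `H` of
discriminant `d_K` with residue `β` (`exists_heegnerDatum`), and `P(1) = Σ_{σ ∈ 𝒢₁} σ y(1)` descends to a point
`P ∈ E(K)` (`heegnerSystem_exists_isHeegnerPoint_map_eq_derivedPoint_one`) whose complex image is
`Σ_{Q ∈ H.reps} φ(τ_Q) = heegnerPointComplex Dt H` by Shimura reciprocity at conductor `1`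
(`heegnerPointOfConductor_one_galoisConj_holds`, PROVED). [cite: GrossLMS1991, §1 (p. 236) and §4 (P_1 = y_K)]
[cite: Darmon2004, Thm. 3.6, Thm. 3.7 and §3.7] -/
theorem heegnerDescentLinkSeven_holds : HeegnerDescentLinkSeven := by
  intro W _ _ _ K _ _ hK hH Dt β ι n hne
  obtain ⟨dn⟩ := hne
  obtain ⟨d₁⟩ := exists_kolyvaginHeegnerData_one
    (phi_heegnerTau_mem_singularModuliField_holds (W.conductorNorm ℤ) W K) hK Dt β ι dn.dvd_sq_sub
  obtain ⟨P, -, hP⟩ := heegnerSystem_exists_isHeegnerPoint_map_eq_derivedPoint_one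
    (heegnerPointOfConductor_one_galoisConj_holds (W.conductorNorm ℤ) W K) hK hH d₁
  obtain ⟨H, hHβ⟩ := exists_heegnerDatum (W.conductorNorm ℤ) hK.discr_neg d₁.dvd_sq_sub
  obtain ⟨e, he⟩ :=
    heegnerPointOfConductor_one_galoisConj_holds (W.conductorNorm ℤ) W K hK hH Dt β ι d₁ H hHβ
  refine ⟨d₁, H, P, ?_, hP⟩
  have hι : ι.toRatAlgHom = (ringClassField K ι 1).subtype.toRatAlgHom.comp
      (algebraMap K (ringClassField K ι 1)).toRatAlgHom := by
    ext x
    rfl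
  rw [hι, ← WeierstrassCurve.Affine.Point.map_map, hP, d₁.derivedPoint_one, map_sum,
    heegnerPointComplex, ← Finset.sum_coe_sort H.reps, ← Finset.sum_coe_sort d₁.S]
  exact Fintype.sum_equiv e _ _ fun s ↦ he s

/-! ## §10 REV 3 COMPOSITE, PROVED: K7r ⟸ A ∧ B ∧ G ∧ D(a) (four leaves; T, S, D(b) discharged by §6, §9, §8) -/

/-- **THE NODE'S `closes` WITH FOUR LEAVES (PROVED): leaf K7r from A, B, G, D(a)** and the published facts by name
(REV 3: the binders `hS` and `hD` of `cmRamifiedSeven_of_five_leaves` are discharged by `heegnerDescentLinkSeven_holds`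
and `descentSideDataSeven_of_maninDatum`; NO new fact binder — the 12 fact binders are those of REV 2). Every leaf
except A is WEAKER than K7r; A is UNDECIDED and idea-bound (card `cuspidal-descent-kolyvagin-nonvanishing`).
No summit statement is proved here: this is a conditional certificate `facts → A → B → G → D(a) → K7r`.
[cite: Kolyvagin1991, Thm. 1] [cite: GrossZagier1986, V.§2 (2.2)] [cite: Cassels1965ArithmeticVIII, Thm. 1.3]
[cite: Darmon2004, Thm. 3.6 and Thm. 3.7] [cite: Miller2011LMS, §1 and Def. 1.1] -/
theorem cmRamifiedSeven_of_four_leaves (hBF : bsdTriple_of_hasCM_of_L_one_ne_zero)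
    (hmod : hasEntireLFunction_rat) (hnf : exists_isNewformOf)
    (hLLT : LiLiuTian2024.thm11_bsdp_of_cm_rank_one) (hKob : Kobayashi2013.cor14_bsdp_of_cm_rank_one)
    (hLTYZ : LiTianYanZhu2025.thm11_bsdp_of_cm_rank_one)
    (hGZK : rank_eq_analyticRank_of_analyticRank_le_one)
    (hCassels : bsdRHS_eq_of_isIsogenous)
    (hFH : friedbergHoffstein_exists_heegnerField_splitDivisors_twist_ne_zero)
    (hGZ : ∀ (N : ℕ) [NeZero N] (W : WeierstrassCurve ℚ) (K : Type) [Field K] [NumberField K],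
      gross_zagier N W K)
    (hKo : ∀ (N : ℕ) [NeZero N] (W : WeierstrassCurve ℚ) (K : Type) [Field K] [NumberField K],
      kolyvagin N W K)
    (hA : KolyvaginDatumHalfSeven) (hB : EisensteinCMKolyvaginStructureSeven)
    (hG : KolyvaginIndexBookkeepingSeven) (hDa : DescentManinDatumSeven) : X12.CMRamifiedSeven :=
  cmRamifiedSeven_of_five_leaves hBF hmod hnf hLLT hKob hLTYZ hGZK hCassels hFH hGZ hKo hA hB hG
    heegnerDescentLinkSeven_holds (descentSideDataSeven_of_maninDatum hDa)

/-! ## §11 REV 4 — LEAF G PROVED from G(a): rank-one index algebra + Galois descent of `7`-power divisibility -/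

section Bookkeeping

open AddSubgroup

/-- **Pure algebra (PROVED): exact `p`-divisibility exponent = `ord_p` of the index.** In a finitely generated
abelian group `A` of `ℤ`-rank `1` without `p`-torsion, an element `P` of infinite order is divisible by
`p^k` exactly for `k ≤ ord_p [A : ℤP]`: with `f : A ↠ ℤ`, `f x = 1`, `T = ker f` (finite, `p`-divisible),
`P = m x + t`, `m = f P ≠ 0`, one has `[A : ℤP] = [A : f⁻¹(mℤ)] · [f⁻¹(mℤ) : ℤP] = |m| · (prime to p)`.
[cite: Hungerford1974, Ch. II Thm. 2.1 and Thm. 2.6] -/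
theorem index_bookkeeping {A : Type*} [AddCommGroup A] [AddGroup.FG A] {p : ℕ} [hp : Fact p.Prime]
    (hA : ∀ a : A, (p : ℤ) • a = 0 → a = 0) (h1 : Module.finrank ℤ A = 1)
    {P : A} (hP : ¬ IsOfFinAddOrder P) :
    (∃ Q : A, ((p ^ padicValNat p (AddSubgroup.zmultiples P).index : ℕ) : ℤ) • Q = P) ∧
    ¬ ∃ Q : A, ((p ^ (padicValNat p (AddSubgroup.zmultiples P).index + 1) : ℕ) : ℤ) • Q = P := by
  classical
  -- a surjection onto `ℤ` with a section element `x`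
  obtain ⟨x, f, hfx⟩ :=
    Literature.GroupTheory.FiniteAbelian.exists_addMonoidHom_apply_eq_one_of_finrank_ne_zero A
      (by omega)
  have hfsurj : Function.Surjective f := fun n ↦
    ⟨n • x, by rw [map_zsmul, hfx, smul_eq_mul, mul_one]⟩
  -- `A / ℤx` is finite (rank `0`), hence so is `T = ker f ↪ A / ℤx`
  have hq0 : Module.finrank ℤ (A ⧸ zmultiples x) = 0 := by
    have h := Literature.GroupTheory.FiniteAbelian.finrank_quotient_zmultiples_add_one hfx
    omega
  haveI : AddGroup.FG (A ⧸ zmultiples x) := QuotientAddGroup.fg (zmultiples x)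
  haveI : Module.Finite ℤ (A ⧸ zmultiples x) := Module.Finite.iff_addGroup_fg.mpr ‹_›
  haveI hfinq : Finite (A ⧸ zmultiples x) :=
    Module.finite_of_fg_torsion (A ⧸ zmultiples x)
      ((Module.finrank_eq_zero_iff_isTorsion (R := ℤ)).mp hq0)
  haveI hT : Finite f.ker := by
    refine Finite.of_injective
      (fun t : f.ker ↦ (QuotientAddGroup.mk (t : A) : A ⧸ zmultiples x)) ?_
    intro s t hst
    have h := (QuotientAddGroup.eq (s := zmultiples x)).mp hst
    obtain ⟨c, hc⟩ := mem_zmultiples_iff.mp h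
    have hc0 : c = 0 := by
      have h' := congrArg f hc
      rw [map_zsmul, hfx, map_add, map_neg, (AddMonoidHom.mem_ker).mp s.2,
        (AddMonoidHom.mem_ker).mp t.2, neg_zero, add_zero, smul_eq_mul, mul_one] at h'
      exact h'
    rw [hc0, zero_smul, eq_comm, neg_add_eq_zero] at hc
    exact Subtype.ext hc
  -- `m = f P ≠ 0` since `P` has infinite order and `T` is finite
  set m : ℤ := f P with hm
  have hm0 : m ≠ 0 := by
    intro h0
    have hPT : P ∈ f.ker := (AddMonoidHom.mem_ker).mpr h0
    have hfin : IsOfFinAddOrder (⟨P, hPT⟩ : f.ker) := isOfFinAddOrder_of_finite _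
    exact hP (f.ker.subtype.isOfFinAddOrder hfin)
  have hmabs : m.natAbs ≠ 0 := Int.natAbs_ne_zero.mpr hm0
  -- the torsion part `t = P - m x` and `p`-divisibility of `ker f`
  set t : A := P - m • x with ht
  have htker : f t = 0 := by
    rw [ht, map_sub, map_zsmul, hfx, smul_eq_mul, mul_one, hm, sub_self]
  have hdiv : ∀ s : A, f s = 0 → ∀ k : ℕ, ∃ s' : A, f s' = 0 ∧ ((p ^ k : ℕ) : ℤ) • s' = s := by
    have hinj : Function.Injective (fun s : f.ker ↦
        (⟨(p : ℤ) • (s : A), by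
          rw [AddMonoidHom.mem_ker, map_zsmul, (AddMonoidHom.mem_ker).mp s.2, smul_zero]⟩ :
          f.ker)) := by
      intro a b hab
      have h : (p : ℤ) • (a : A) = (p : ℤ) • (b : A) := congrArg Subtype.val hab
      have h' : (p : ℤ) • ((a : A) - b) = 0 := by rw [smul_sub, h, sub_self]
      exact Subtype.ext (sub_eq_zero.mp (hA _ h'))
    have hsurj := Finite.surjective_of_injective hinj
    intro s hs k
    induction k with
    | zero => exact ⟨s, hs, by simp⟩
    | succ k ih =>
      obtain ⟨s', hs', hks'⟩ := ih
      obtain ⟨⟨s'', hs''⟩, hps''⟩ := hsurj ⟨s', (AddMonoidHom.mem_ker).mpr hs'⟩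
      have hval : (p : ℤ) • s'' = s' := congrArg Subtype.val hps''
      refine ⟨s'', (AddMonoidHom.mem_ker).mp hs'', ?_⟩
      have hc : ((p ^ k : ℕ) : ℤ) * (p : ℤ) = ((p ^ (k + 1) : ℕ) : ℤ) := by
        exact_mod_cast (pow_succ (p : ℤ) k).symm
      rw [← hks', ← hval, smul_smul, hc]
  -- the index: `[A : ℤP] = [f⁻¹(mℤ) : ℤP] · |m|` with the first factor prime to `p`
  set H : AddSubgroup A := (zmultiples m).comap f with hH
  have hle : zmultiples P ≤ H := by
    rw [AddSubgroup.zmultiples_le, hH, AddSubgroup.mem_comap]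
    show f P ∈ zmultiples m
    rw [← hm]
    exact AddSubgroup.mem_zmultiples m
  have hHidx : H.index = m.natAbs := by
    rw [hH, AddSubgroup.index_comap_of_surjective _ hfsurj, Int.index_zmultiples]
  have hrel : (zmultiples P).relIndex H * H.index = (zmultiples P).index :=
    AddSubgroup.relIndex_mul_index hle
  have hidx0 : (zmultiples P).index ≠ 0 :=
    Literature.NumberTheory.EllipticCurves.index_zmultiples_ne_zero_of_finrank_eq_one hP h1
  have hrel0 : (zmultiples P).relIndex H ≠ 0 := by
    intro h0
    rw [h0, zero_mul] at hrel
    exact hidx0 hrel.symm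
  have hndvd : ¬ p ∣ (zmultiples P).relIndex H := by
    intro hdvd
    haveI : Finite (H ⧸ (zmultiples P).addSubgroupOf H) :=
      (AddSubgroup.fintypeOfIndexNeZero hrel0).finite
    rw [AddSubgroup.relIndex, AddSubgroup.index] at hdvd
    obtain ⟨g, hg⟩ := exists_prime_addOrderOf_dvd_card' p hdvd
    obtain ⟨h, rfl⟩ := QuotientAddGroup.mk_surjective g
    have hp0 : (QuotientAddGroup.mk (p • h) : H ⧸ (zmultiples P).addSubgroupOf H) = 0 := by
      rw [QuotientAddGroup.mk_nsmul, ← hg]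
      exact addOrderOf_nsmul_eq_zero _
    rw [QuotientAddGroup.eq_zero_iff, AddSubgroup.mem_addSubgroupOf] at hp0
    obtain ⟨c, hc⟩ := mem_zmultiples_iff.mp hp0
    have hc' : c • P = (p : ℤ) • (h : A) := by
      rw [hc, AddSubgroup.coe_nsmul, natCast_zsmul]
    obtain ⟨d, hd⟩ := mem_zmultiples_iff.mp (AddSubgroup.mem_comap.mp h.2)
    have hcd : c = p * d := by
      have h' := congrArg f hc'
      rw [map_zsmul, map_zsmul, ← hd, smul_eq_mul, smul_eq_mul, smul_eq_mul] at h'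
      have h'' : c * m = (p * d) * m := by rw [h']; ring
      exact mul_right_cancel₀ hm0 h''
    have hzero : (p : ℤ) • ((h : A) - d • P) = 0 := by
      rw [smul_sub, ← hc', hcd, mul_smul, sub_self]
    have hmem : (h : A) ∈ zmultiples P := by
      have h0 := hA _ hzero
      rw [sub_eq_zero] at h0
      rw [h0]
      exact AddSubgroup.zsmul_mem _ (mem_zmultiples P) d
    have hmk : (QuotientAddGroup.mk h : H ⧸ (zmultiples P).addSubgroupOf H) = 0 := by
      rw [QuotientAddGroup.eq_zero_iff, AddSubgroup.mem_addSubgroupOf]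
      exact hmem
    rw [hmk, addOrderOf_zero] at hg
    exact hp.out.one_lt.ne' hg.symm
  have hvN : padicValNat p (zmultiples P).index = padicValNat p m.natAbs := by
    rw [← hrel, hHidx, padicValNat.mul hrel0 hmabs, padicValNat.eq_zero_of_not_dvd hndvd, zero_add]
  rw [hvN]
  refine ⟨?_, ?_⟩
  · -- `P = p^k (m' x + t')`
    obtain ⟨m', hm'⟩ : ((p ^ padicValNat p m.natAbs : ℕ) : ℤ) ∣ m :=
      Int.natCast_dvd.mpr pow_padicValNat_dvd
    obtain ⟨t', ht', hkt'⟩ := hdiv t htker (padicValNat p m.natAbs)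
    refine ⟨m' • x + t', ?_⟩
    rw [smul_add, smul_smul, ← hm', hkt', ht, add_sub_cancel]
  · rintro ⟨Q, hQ⟩
    have h' := congrArg f hQ
    rw [map_zsmul, smul_eq_mul, ← hm] at h'
    have hdvd : p ^ (padicValNat p m.natAbs + 1) ∣ m.natAbs :=
      Int.natCast_dvd.mp ⟨f Q, h'.symm⟩
    exact pow_succ_padicValNat_not_dvd hmabs hdvd

end Bookkeeping

/-- **G ⟸ G(a) (PROVED): the Kolyvagin index bookkeeping from the torsion vanishing alone** — Mordell–Weil for
`E(K″)` (`addGroup_fg_point_holds`), the pure algebra `index_bookkeeping`, injectivity of `E(K″) → E(K″[1])`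
and Galois descent of `7`-power divisibility along the Galois extension `K″[1]/K″`
(`exists_map_eq_of_forall_map_galois_eq`: a `7^{M₀+1}`-th root of `P(1)` is Galois-invariant modulo
`E(K″[1])[7^{M₀+1}] = 0`, hence `K″`-rational). [cite: GrossLMS1991, §4 (4.1)] [cite: SilvermanAEC2009, VIII.§1] -/
theorem kolyvaginIndexBookkeepingSeven_of_noTorsion (hG : TypeIIINoSevenTorsionSeven) :
    KolyvaginIndexBookkeepingSeven := by
  intro W _ _ _ _ hC h3 K _ _ hK h7K Dt β ι d₁ P hP hnt hr
  haveI := (finiteDimensional_and_isGalois_ringClassField hK ι one_ne_zero).1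
  haveI := (finiteDimensional_and_isGalois_ringClassField hK ι one_ne_zero).2
  set L := ringClassField K ι 1
  set φ : (W.baseChange K).toAffine.Point →+ (W.baseChange L).toAffine.Point :=
    WeierstrassCurve.Affine.Point.map (algebraMap K L).toRatAlgHom with hφdef
  have hφ : Function.Injective φ := WeierstrassCurve.Affine.Point.map_injective _
  -- no `7^j`-torsion over `L`, no `7`-torsion over `K`
  have h7L : ∀ (j : ℕ) (Q : (W.baseChange L).toAffine.Point), ((7 ^ j : ℕ) : ℤ) • Q = 0 → Q = 0 := by
    intro j
    induction j with
    | zero => intro Q hQ; simpa using hQ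
    | succ j ih =>
      intro Q hQ
      have hc : ((7 ^ j : ℕ) : ℤ) * (7 : ℤ) = ((7 ^ (j + 1) : ℕ) : ℤ) := by
        exact_mod_cast (pow_succ (7 : ℤ) j).symm
      have h7 : ((7 ^ j : ℕ) : ℤ) • ((7 : ℤ) • Q) = 0 := by
        rw [smul_smul, hc, hQ]
      have hQ7 : (7 : ℤ) • Q = 0 := ih _ h7
      exact hG W hC h3 K hK h7K ι Q hQ7
  have h7K' : ∀ a : (W.baseChange K).toAffine.Point, ((7 : ℕ) : ℤ) • a = 0 → a = 0 := by
    intro a ha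
    apply hφ
    rw [map_zero]
    apply hG W hC h3 K hK h7K ι
    rw [← map_zsmul]
    exact_mod_cast congrArg φ ha ▸ map_zero φ
  haveI : (W.baseChange K).IsElliptic := by
    rw [WeierstrassCurve.baseChange]; infer_instance
  haveI : AddGroup.FG (W.baseChange K).toAffine.Point := (W.baseChange K).addGroup_fg_point_holds
  have h1 : Module.finrank ℤ (W.baseChange K).toAffine.Point = 1 := hr
  obtain ⟨⟨Q₀, hQ₀⟩, hnot⟩ := index_bookkeeping (p := 7) h7K' h1 hnt
  -- Galois invariance of points coming from `K`
  have hσfix : ∀ (σ : L ≃ₐ[K] L) (R : (W.baseChange K).toAffine.Point),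
      WeierstrassCurve.Affine.Point.map (σ : L →ₐ[K] L) (φ R) = φ R := by
    intro σ R
    rcases R with _ | ⟨x, y, hxy⟩
    · rfl
    · simp only [hφdef, WeierstrassCurve.Affine.Point.map_some, WeierstrassCurve.Affine.Point.some.injEq]
      exact ⟨σ.commutes x, σ.commutes y⟩
  refine ⟨?_, padicValNat 7 (AddSubgroup.zmultiples P).index, ⟨φ Q₀, ?_⟩, ?_, rfl⟩
  · rw [← hP]
    exact fun h ↦ hnt (hφ.isOfFinAddOrder_iff.mp h)
  · rw [← map_zsmul, hQ₀]
    exact hP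
  · rintro ⟨Q, hQ⟩
    obtain ⟨Q₁, hQ₁⟩ := exists_map_eq_of_forall_map_galois_eq W (k := K) (L := L) (P := Q)
      (fun σ ↦ by
        have hfixP : WeierstrassCurve.Affine.Point.map (σ : L →ₐ[K] L) d₁.derivedPoint =
            d₁.derivedPoint := by rw [← hP]; exact hσfix σ P
        have htors : ((7 ^ (padicValNat 7 (AddSubgroup.zmultiples P).index + 1) : ℕ) : ℤ) •
            (WeierstrassCurve.Affine.Point.map (σ : L →ₐ[K] L) Q - Q) = 0 := by
          rw [smul_sub, ← map_zsmul, hQ, hfixP, sub_self]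
        exact sub_eq_zero.mp (h7L _ _ htors))
    apply hnot
    refine ⟨Q₁, hφ ?_⟩
    have hQ₁' : φ Q₁ = Q := hQ₁
    rw [map_zsmul, hQ₁', hQ]
    exact hP.symm

/-! ## §12 REV 4 COMPOSITE, PROVED: K7r ⟸ A ∧ B ∧ G(a) ∧ D(a) (four leaves; G discharged by §11) -/

/-- **THE NODE'S `closes` WITH THE TORSION LEAF (PROVED): leaf K7r from A, B, G(a), D(a)** and the published facts
by name (REV 4: the binder `hG` of `cmRamifiedSeven_of_four_leaves` is discharged by
`kolyvaginIndexBookkeepingSeven_of_noTorsion hGa`; NO new fact binder — the 12 fact binders are those of REV 2).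
Every leaf except A is WEAKER than K7r; A is UNDECIDED and idea-bound (card `cuspidal-descent-kolyvagin-nonvanishing`).
No summit statement is proved here: this is a conditional certificate `facts → A → B → G(a) → D(a) → K7r`.
[cite: Kolyvagin1991, Thm. 1] [cite: GrossZagier1986, V.§2 (2.2)] [cite: GrossLMS1991, §4 (4.1) and Lemma 4.3]
[cite: Cassels1965ArithmeticVIII, Thm. 1.3] [cite: Darmon2004, Thm. 3.6 and Thm. 3.7] -/
theorem cmRamifiedSeven_of_torsion_leaf (hBF : bsdTriple_of_hasCM_of_L_one_ne_zero)
    (hmod : hasEntireLFunction_rat) (hnf : exists_isNewformOf)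
    (hLLT : LiLiuTian2024.thm11_bsdp_of_cm_rank_one) (hKob : Kobayashi2013.cor14_bsdp_of_cm_rank_one)
    (hLTYZ : LiTianYanZhu2025.thm11_bsdp_of_cm_rank_one)
    (hGZK : rank_eq_analyticRank_of_analyticRank_le_one)
    (hCassels : bsdRHS_eq_of_isIsogenous)
    (hFH : friedbergHoffstein_exists_heegnerField_splitDivisors_twist_ne_zero)
    (hGZ : ∀ (N : ℕ) [NeZero N] (W : WeierstrassCurve ℚ) (K : Type) [Field K] [NumberField K],
      gross_zagier N W K)
    (hKo : ∀ (N : ℕ) [NeZero N] (W : WeierstrassCurve ℚ) (K : Type) [Field K] [NumberField K],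
      kolyvagin N W K)
    (hA : KolyvaginDatumHalfSeven) (hB : EisensteinCMKolyvaginStructureSeven)
    (hGa : TypeIIINoSevenTorsionSeven) (hDa : DescentManinDatumSeven) : X12.CMRamifiedSeven :=
  cmRamifiedSeven_of_four_leaves hBF hmod hnf hLLT hKob hLTYZ hGZK hCassels hFH hGZ hKo hA hB
    (kolyvaginIndexBookkeepingSeven_of_noTorsion hGa) hDa

/-! ## §13 REV 5 — LEAF G(a) PROVED unconditionally: `E[7]^N = 0` for data of inverted type (Weil pairing,
Mazur's Frobenius relation at `2`, Hasse) and the inverted datum for `K[1]` (Cox Lemma 9.3) -/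

section LeafGa

open Literature.NumberTheory.GaloisRepresentations NumberField IsDedekindDomain Field


section CharacterAlgebra

variable {Γ M : Type*} [Group Γ] [CommGroup M]

/-- Character algebra (i): if `χ : Γ → M` (abelian) kills `N` and `τ⁻¹ a τ a ∈ N` for all `a ∈ A`,
then `χ(a)² = 1` on `A`. [folklore] -/
theorem map_sq_eq_one_of_inverted (χ : Γ →* M) {N A : Subgroup Γ} (hN : ∀ n ∈ N, χ n = 1)
    {τ : Γ} (hdih : ∀ a ∈ A, τ⁻¹ * a * τ * a ∈ N) {a : Γ} (ha : a ∈ A) : χ a ^ 2 = 1 := by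
  have h := hN _ (hdih a ha)
  rw [map_mul, map_mul, map_mul, map_inv, mul_comm (χ τ)⁻¹ (χ a), mul_assoc (χ a) _ _,
    inv_mul_cancel, mul_one] at h
  rw [pow_two]
  exact h

/-- Character algebra (ii): if moreover every square of `Γ` lies in `A`, then `χ(g)⁴ = 1` on `Γ`.
[folklore] -/
theorem map_pow_four_eq_one_of_inverted (χ : Γ →* M) {N A : Subgroup Γ}
    (hN : ∀ n ∈ N, χ n = 1) (hsq : ∀ g : Γ, g * g ∈ A) {τ : Γ}
    (hdih : ∀ a ∈ A, τ⁻¹ * a * τ * a ∈ N) (g : Γ) : χ g ^ 4 = 1 := by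
  have h := map_sq_eq_one_of_inverted χ hN hdih (hsq g)
  rw [map_mul, ← pow_two, ← pow_mul] at h
  exact h

/-- In `𝔽₇ˣ` (order `6`): `u⁴ = 1 ⟹ u² = 1`. [folklore] -/
theorem units_zmod_seven_sq_eq_one {u : (ZMod 7)ˣ} (h4 : u ^ 4 = 1) : u ^ 2 = 1 := by
  haveI : Fact (Nat.Prime 7) := ⟨by norm_num⟩
  have h6 : u ^ 6 = 1 := by
    have := ZMod.units_pow_card_sub_one_eq_one 7 u
    simpa using this
  calc u ^ 2 = u ^ 6 * (u ^ 4)⁻¹ := by group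
    _ = 1 := by rw [h6, h4]; group

/-- In `𝔽₇`: a unit with `u² = 1` is `±1`. [folklore] -/
theorem coe_eq_one_or_eq_neg_one_of_sq_eq_one {u : (ZMod 7)ˣ} (h : u ^ 2 = 1) :
    (u : ZMod 7) = 1 ∨ (u : ZMod 7) = -1 := by
  have hx : ((u : ZMod 7)) ^ 2 = 1 := by rw [← Units.val_pow_eq_pow_val, h, Units.val_one]
  revert hx
  generalize (u : ZMod 7) = x
  revert x
  decide

end CharacterAlgebra

section Numerics

private theorem zmod7_three_mul_five : (3 : ZMod 7) * 5 = 1 := by decide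

/-- `3⁴ = 4 ≠ 1` in `𝔽₇ˣ`: the mod-`7` cyclotomic character is not killed by `4`. [folklore] -/
theorem zmod7_unit_three_pow_four_ne_one :
    (Units.mkOfMulEqOne (3 : ZMod 7) 5 zmod7_three_mul_five) ^ 4 ≠ 1 := by decide

/-- No Frobenius relation `x² − a x + 2 = 0` in `𝔽₇` with `x = ±1` and `|a| ≤ 2` (Hasse at `2`). [folklore] -/
theorem zmod7_no_frobenius_relation (x : ZMod 7) (hx : x = 1 ∨ x = -1) (a : ℤ) (ha1 : -3 < a)
    (ha2 : a < 3) (hrel : x ^ 2 - (a : ZMod 7) * x + ((2 : ℕ) : ZMod 7) = 0) : False := by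
  rcases hx with rfl | rfl <;> interval_cases a <;> revert hrel <;> decide

end Numerics

/-- **`E[7]^N = 0` for data of inverted type, at a curve with good reduction at `2`** (the reducible
complement of Gross 1991 Lemma 4.3 at `p = 7`; NEW, proved here).  Let `W/ℚ` be elliptic, globally minimal,
with good reduction at `2`; `N ⊴ Γ_ℚ`, `A ≤ Γ_ℚ` containing all squares, `τ ∈ Γ_ℚ` with `τ⁻¹ a τ a ∈ N` for all
`a ∈ A` (printed: `N = Γ_{K[1]}`, `A = Γ_K`, `τ` = complex conjugation, Cox Lemma 9.3).  Then no `Q ≠ 0` in `E[7]`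
is fixed by `N`.  PROOF.  `C = E[7]^N` is `Γ_ℚ`-stable.  (1) `C = E[7]`: the Weil pairing gives a primitive
`ζ₇ = e₇(Q, Q₀)` fixed by `N`, so the mod-`7` cyclotomic character `χ` kills `N`; character algebra gives `χ⁴ = 1`
on `Γ_ℚ`, contradicting the surjectivity of `χ : Γ_ℚ → 𝔽₇ˣ` (`3⁴ = 4 ≠ 1`).  (2) `C` a line: its isogeny
character `r` kills `N`, so `r⁴ = 1 = r⁶`, `r = ±1`; Mazur's relation at the good prime `2`,
`r(φ₂)² − a₂ r(φ₂) + 2 = 0 (mod 7)`, forces `a₂ ≡ ±3 (mod 7)`, contradicting Hasse `a₂² ≤ 8`.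
[cite: GrossLMS1991, §4 Lemma 4.3] [cite: Mazur1978, Prop. 6.3 (1) / §5 p. 148] [cite: SilvermanAEC2009, III.8.1, V.1.1]
[cite: Cox2013, §9.A Lemma 9.3] -/
theorem geomTorsion_eq_zero_of_invertedData (W : WeierstrassCurve ℚ) [W.IsElliptic] [W.IsGloballyMinimal]
    (hgood : W.HasGoodReductionAtPrime 2)
    (N A : Subgroup (absoluteGaloisGroup ℚ)) [N.Normal]
    (hsq : ∀ g : absoluteGaloisGroup ℚ, g * g ∈ A) (τ : absoluteGaloisGroup ℚ)
    (hdih : ∀ a ∈ A, τ⁻¹ * a * τ * a ∈ N)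
    {Q : geomTorsion W (7 : ℕ)} (hQ : ∀ n ∈ N, n • Q = Q) : Q = 0 := by
  haveI h7 : Fact (Nat.Prime 7) := ⟨by norm_num⟩
  have h7ne : ((7 : ℕ) : ℚ) ≠ 0 := by norm_num
  haveI : NeZero ((7 : ℕ) : ℚ) := ⟨h7ne⟩
  by_contra hQ0
  -- the `N`-fixed subgroup `C = E[7]^N`, stable under `Γ_ℚ` since `N` is normal
  let C : AddSubgroup (geomTorsion W (7 : ℕ)) :=
    { carrier := {v | ∀ n ∈ N, n • v = v}
      zero_mem' := fun n _ ↦ smul_zero n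
      add_mem' := fun {v w} hv hw n hn ↦ by rw [smul_add, hv n hn, hw n hn]
      neg_mem' := fun {v} hv n hn ↦ by rw [smul_neg, hv n hn] }
  have hQC : Q ∈ C := hQ
  have hCstab : ∀ (σ : absoluteGaloisGroup ℚ) (v : geomTorsion W (7 : ℕ)), v ∈ C → σ • v ∈ C :=
    fun σ v hv n hn ↦ smul_smul_eq_of_normal hv σ hn
  by_cases hCtop : C = ⊤
  · /- Case 1: `N` acts trivially on `E[7]` — Weil pairing and the cyclotomic character. -/
    have hfix : ∀ (v : geomTorsion W (7 : ℕ)), ∀ n ∈ N, n • v = v := fun v ↦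
      show v ∈ C from hCtop ▸ AddSubgroup.mem_top v
    letI : Module (ZMod 7) (geomTorsion W (7 : ℕ)) := AddSubgroup.torsionBy.zmodModule
    have h7Q : 7 • Q = 0 := ZModModule.char_nsmul_eq_zero 7 Q
    have hord : addOrderOf Q = 7 := addOrderOf_eq_prime h7Q hQ0
    obtain ⟨Q₀, hζ⟩ := exists_isPrimitiveRoot_weilPairingFun h7ne hord
    set ζ := weilPairingFun h7ne (Q : W.geomPoints) (Q₀ : W.geomPoints) with hζdef
    have hQ7 : ((7 : ℕ) : ℤ) • (Q : W.geomPoints) = 0 := (W.mem_geomTorsion_iff _ _).1 Q.2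
    have hQ₀7 : ((7 : ℕ) : ℤ) • (Q₀ : W.geomPoints) = 0 := (W.mem_geomTorsion_iff _ _).1 Q₀.2
    -- `N` fixes `ζ`
    have hNζ : ∀ n ∈ N, n • ζ = ζ := by
      intro n hn
      rw [hζdef, ← weilPairingFun_smul h7ne n hQ7 hQ₀7,
        ← AddSubgroup.torsionBy.coe_smul n Q, ← AddSubgroup.torsionBy.coe_smul n Q₀,
        hfix Q n hn, hfix Q₀ n hn]
    -- hence the mod-7 cyclotomic character kills `N`
    set χ : absoluteGaloisGroup ℚ →* (ZMod 7)ˣ := modNCyclotomicCharacter ℚ 7 with hχdef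
    have hζ7 : ζ ^ 7 = 1 := hζ.pow_eq_one
    have hNχ : ∀ n ∈ N, χ n = 1 := by
      intro n hn
      have hspec := modNCyclotomicCharacter_spec ℚ 7 n ζ hζ7
      rw [hNζ n hn] at hspec
      have hval : ((χ n : ZMod 7)).val = 1 := by
        refine hζ.pow_inj (ZMod.val_lt _) (by norm_num) ?_
        rw [pow_one, hχdef]
        exact hspec.symm
      have hone : (χ n : ZMod 7) = 1 := ZMod.val_injective 7 (by rw [hval, ZMod.val_one])
      exact Units.val_eq_one.mp hone
    have h4 : ∀ g : absoluteGaloisGroup ℚ, χ g ^ 4 = 1 :=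
      map_pow_four_eq_one_of_inverted χ hNχ hsq hdih
    -- but `χ` is onto `𝔽₇ˣ`, and `3⁴ ≠ 1`
    obtain ⟨g, hg⟩ :=
      modNCyclotomicCharacter_rat_surjective 7 (Units.mkOfMulEqOne (3 : ZMod 7) 5 zmod7_three_mul_five)
    have h4g := h4 g
    rw [hχdef, hg] at h4g
    exact zmod7_unit_three_pow_four_ne_one h4g
  · /- Case 2: `C` is a `Γ_ℚ`-stable line — isogeny character, Mazur's relation at `2`, Hasse. -/
    have hCbot : C ≠ ⊥ := by
      intro h
      apply hQ0
      have hQC' := hQC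
      rw [h, AddSubgroup.mem_bot] at hQC'
      exact hQC'
    have hV : Nat.card (geomTorsion W (7 : ℕ)) = 7 ^ 2 := W.natCard_geomTorsion_eq_sq_of_charZero h7.out
    have hcard : Nat.card C = 7 := card_eq_of_ne_bot_of_ne_top hV hCbot hCtop
    -- `C = ℤ • Q`
    have hgen : ∀ v ∈ C, ∃ k : ℤ, k • Q = v := by
      intro v hv
      have hQ0' : (⟨Q, hQC⟩ : C) ≠ 0 := fun h ↦ hQ0 (congrArg Subtype.val h)
      have htop := zmultiples_eq_top_of_prime_card hcard hQ0'
      have hmem : (⟨v, hv⟩ : C) ∈ AddSubgroup.zmultiples (⟨Q, hQC⟩ : C) := by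
        rw [htop]; exact AddSubgroup.mem_top _
      obtain ⟨k, hk⟩ := AddSubgroup.mem_zmultiples_iff.mp hmem
      exact ⟨k, by simpa using congrArg Subtype.val hk⟩
    have hst : ∀ σ : absoluteGaloisGroup ℚ, σ • Q ∈ AddSubgroup.zmultiples Q := fun σ ↦ by
      obtain ⟨k, hk⟩ := hgen _ (hCstab σ Q hQC)
      exact AddSubgroup.mem_zmultiples_iff.mpr ⟨k, hk⟩
    obtain ⟨r, hr⟩ := Mazur1978.exists_isogenyCharacter W 7 hQ0 hst
    -- `r` kills `N`, so `r⁴ = 1 = r⁶`, `r = ±1`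
    have hrN : ∀ n ∈ N, r n = 1 := fun n hn ↦
      Units.val_eq_one.mp (Mazur1978.eq_one_of_val_smul_eq W 7 hQ0 (by rw [← hr n]; exact hQ n hn))
    have h4 : ∀ g : absoluteGaloisGroup ℚ, r g ^ 4 = 1 := map_pow_four_eq_one_of_inverted r hrN hsq hdih
    -- an arithmetic Frobenius at `2`
    set v : HeightOneSpectrum (𝓞 ℚ) :=
      (Rat.HeightOneSpectrum.primesEquiv (R := 𝓞 ℚ)).symm ⟨2, Nat.prime_two⟩ with hvdef
    have hv : ((2 : ℕ) : 𝓞 ℚ) ∈ v.asIdeal :=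
      (natCast_mem_asIdeal_iff_eq_primesEquiv_symm v Nat.prime_two).mpr hvdef
    obtain ⟨⟨𝔓, φ⟩, h𝔓, hφ⟩ := ArtinRep.exists_mem_primesAbove_and_isArithFrobAt (K := ℚ) v
    have hrel := Mazur1978.isogenyCharacter_sq_sub_frobeniusTrace_mul_add_eq_zero W 7 2 (by norm_num)
      hgood hQ0 hr hv h𝔓 hφ
    have hx := coe_eq_one_or_eq_neg_one_of_sq_eq_one (units_zmod_seven_sq_eq_one (h4 φ))
    -- Hasse at `2`
    have hH : W.frobeniusTrace 2 ^ 2 ≤ 4 * 2 := W.frobeniusTrace_sq_le_four_mul 2 hgood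
    obtain ⟨a, ha⟩ : ∃ a : ℤ, W.frobeniusTrace 2 = a := ⟨_, rfl⟩
    rw [ha] at hrel hH
    have ha1 : -3 < a := by nlinarith
    have ha2 : a < 3 := by nlinarith
    exact zmod7_no_frobenius_relation _ hx a ha1 ha2 hrel

/-- **`E(L)[7] = 0` for a number field `L` of inverted type** relative to a curve `W/ℚ` with good reduction at
`2` (the shape of the tree's `torsionBy_eq_bot_of_normal_of_hasSurjectiveModNGaloisRep_type`, Gross's Lemma 4.3,
with the surjectivity of `ρ̄` REPLACED by good reduction at `2` and the commutator hypothesis by the inversion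
relation `τ⁻¹ a τ a ∈ N`).  Transport `E(L)[7] ↪ E[7]^{Γ_L} ⊆ E[7]^N` as there, then
`geomTorsion_eq_zero_of_invertedData`. [cite: GrossLMS1991, §4 Lemma 4.3] [cite: Mazur1978, Prop. 6.3 (1)] -/
theorem torsionBy_seven_eq_bot_of_invertedData (L : Type) [Field L] [NumberField L] [DecidableEq L]
    (W : WeierstrassCurve ℚ) [W.IsElliptic] [W.IsGloballyMinimal] (hgood : W.HasGoodReductionAtPrime 2)
    (N : Subgroup (absoluteGaloisGroup ℚ)) [N.Normal] (A : Subgroup (absoluteGaloisGroup ℚ))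
    (hN : ∀ n ∈ N, ∃ τ' : absoluteGaloisGroup L, resGal (K := ℚ) L τ' = n)
    (hsq : ∀ g : absoluteGaloisGroup ℚ, g * g ∈ A) (τ : absoluteGaloisGroup ℚ)
    (hdih : ∀ a ∈ A, τ⁻¹ * a * τ * a ∈ N) :
    AddSubgroup.torsionBy (W.baseChange L).toAffine.Point ((7 : ℕ) : ℤ) = ⊥ := by
  rw [eq_bot_iff]
  intro P hP
  rw [AddSubgroup.mem_bot]
  by_contra hP0
  have hPp : 7 • P = 0 := AddSubgroup.torsionBy.nsmul_iff.mp hP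
  -- the point over `L̄` and its preimage `Q` over `ℚ̄`
  let f : L →ₐ[ℚ] AlgebraicClosure L := (algebraMap L (AlgebraicClosure L)).toRatAlgHom
  let φ : (W.baseChange L).toAffine.Point →+ localPoints W L :=
    WeierstrassCurve.Affine.Point.map f
  have hφ : Function.Injective φ := WeierstrassCurve.Affine.Point.map_injective _
  obtain ⟨Q, hQ⟩ := (pointsMapOfEmb_bijective L W (closureEmb (K := ℚ) L)).2 (φ P)
  have hQ' : pointsMap W L Q = φ P := hQ
  have hinj : Function.Injective (pointsMap W L) :=
    (pointsMapOfEmb_bijective L W (closureEmb (K := ℚ) L)).1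
  have hQ0 : Q ≠ 0 := by
    rintro rfl
    apply hP0
    apply hφ
    rw [map_zero, ← hQ', map_zero]
  have hQp : 7 • Q = 0 := by
    apply hinj
    rw [map_nsmul, map_zero, hQ', ← map_nsmul, hPp, map_zero]
  -- `Q` is fixed by `Γ_L`, hence by `N`
  have hfixL : ∀ τ' : absoluteGaloisGroup L, resGal (K := ℚ) L τ' • Q = Q := by
    intro τ'
    apply hinj
    rw [pointsMap_smul, hQ']
    change WeierstrassCurve.Affine.Point.map
        ((AlgEquiv.restrictScalars ℚ (absoluteGaloisGroup.toAlgEquiv L τ') :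
            AlgebraicClosure L ≃ₐ[ℚ] AlgebraicClosure L) :
          AlgebraicClosure L →ₐ[ℚ] AlgebraicClosure L)
        (WeierstrassCurve.Affine.Point.map f P) =
      WeierstrassCurve.Affine.Point.map f P
    have hgf : ((AlgEquiv.restrictScalars ℚ (absoluteGaloisGroup.toAlgEquiv L τ') :
            AlgebraicClosure L ≃ₐ[ℚ] AlgebraicClosure L) :
          AlgebraicClosure L →ₐ[ℚ] AlgebraicClosure L).comp f = f := by
      ext x
      exact (absoluteGaloisGroup.toAlgEquiv L τ').commutes x
    rw [WeierstrassCurve.Affine.Point.map_map, hgf]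
  have hfixN : ∀ n ∈ N, n • Q = Q := fun n hn ↦ by
    obtain ⟨τ', rfl⟩ := hN n hn
    exact hfixL τ'
  -- conclude in `E[7]`
  let Qm : geomTorsion W (7 : ℕ) := ⟨Q, AddSubgroup.torsionBy.nsmul_iff.mpr hQp⟩
  have hQm0 : Qm ≠ 0 := fun h ↦ hQ0 (congrArg Subtype.val h)
  have hQmN : ∀ n ∈ N, n • Qm = Qm := fun n hn ↦ Subtype.ext (hfixN n hn)
  exact hQm0 (geomTorsion_eq_zero_of_invertedData W hgood N A hsq τ hdih hQmN)

/-- **The class-field-theory leaf G(a′) — `RingClassInvertedDatum` (Cox Lemma 9.3 in `Γ_ℚ`-currency).** For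
every imaginary quadratic `K`, `ι : K → ℂ`, with `H = K[1] ⊂ ℂ` the Hilbert class field: there are `N ⊴ Γ_ℚ`
inside the image of `Γ_H → Γ_ℚ`, `A ≤ Γ_ℚ` containing all squares, and `τ ∈ Γ_ℚ` with `τ⁻¹ a τ a ∈ N` for all
`a ∈ A` (printed: `N = Γ_H`, `A = Γ_K`, `τ` any lift of complex conjugation: `Gal(H/ℚ) = Gal(H/K) ⋊ ⟨τ⟩`,
`τ σ τ⁻¹ = σ⁻¹`).  Pure class field theory; `E`-free and `7`-free. [cite: Cox2013, §9.A Lemma 9.3]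
[cite: GrossLMS1991, §5 (τ σ τ⁻¹ = σ⁻¹)] -/
def RingClassInvertedDatum : Prop :=
  ∀ (K : Type) [Field K] [NumberField K], IsImaginaryQuadratic K → ∀ (ι : K →+* ℂ),
    ∃ (N A : Subgroup (absoluteGaloisGroup ℚ)) (τ : absoluteGaloisGroup ℚ), N.Normal ∧
      (∀ n ∈ N, ∃ τ' : absoluteGaloisGroup (ringClassField K ι 1),
          resGal (K := ℚ) (ringClassField K ι 1) τ' = n) ∧
      (∀ g : absoluteGaloisGroup ℚ, g * g ∈ A) ∧ (∀ a ∈ A, τ⁻¹ * a * τ * a ∈ N)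

/-- **G(a) ⟸ G(a′)**: the leaf `TypeIIINoSevenTorsionSeven` from the class-field-theory datum alone — for ALL of
`𝒞₇` (the type-III and Heegner hypotheses are not used), using only `GoodOrd W 2` from `ClassCSeven`.
[cite: GrossLMS1991, §4 Lemma 4.3] [cite: Mazur1978, Prop. 6.3 (1)] [cite: Cox2013, §9.A Lemma 9.3] -/
theorem typeIIINoSevenTorsionSeven_of_ringClassInvertedDatum (h : RingClassInvertedDatum) :
    TypeIIINoSevenTorsionSeven := by
  intro W _ _ _ hC _h3 K _ _ hK _hH ι Q hQ
  obtain ⟨N, A, τ, hNn, hN, hsq, hdih⟩ := h K hK ι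
  haveI := hNn
  haveI := (finiteDimensional_and_isGalois_ringClassField hK ι one_ne_zero).1
  haveI : NumberField (ringClassField K ι 1) := NumberField.of_module_finite K _
  have hgood : W.HasGoodReductionAtPrime 2 := hC.2.2.2.1.1
  have hbot := torsionBy_seven_eq_bot_of_invertedData (ringClassField K ι 1) W hgood N A hN hsq τ hdih
  have hQ' : (7 : ℕ) • Q = 0 := by rw [← natCast_zsmul]; exact hQ
  have hmem : Q ∈ AddSubgroup.torsionBy (W.baseChange (ringClassField K ι 1)).toAffine.Point ((7 : ℕ) : ℤ) :=
    AddSubgroup.torsionBy.nsmul_iff.mpr hQ'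
  rw [hbot, AddSubgroup.mem_bot] at hmem
  exact hmem


/-- **Inverted data from a Galois number field with an "index-two, inverted" subgroup** (abstract Cox 9.3
⇒ Gross's group data).  `L/ℚ` Galois, `𝒢 ≤ Gal(L/ℚ)` such that any two elements outside `𝒢` differ by an
element of `𝒢`, some element lies outside `𝒢`, and every element outside `𝒢` conjugates `𝒢` by inversion.
Then with `π : Γ_ℚ → Gal(L/ℚ)` (restriction through `Γ_ℚ ≃ Aut_ℚ(L̄)`), `N = ker π` (the image of `Γ_L`),
`A = π⁻¹ 𝒢` and `τ` any lift of an element outside `𝒢` (inverted), the data of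
`torsionBy_seven_eq_bot_of_invertedData` hold. [cite: Cox2013, §9.A Lemma 9.3] [folklore] -/
theorem exists_invertedData_of_isGalois (L : Type) [Field L] [NumberField L] [IsGalois ℚ L]
    (𝒢 : Subgroup (L ≃ₐ[ℚ] L))
    (hprod : ∀ τ τ' : L ≃ₐ[ℚ] L, τ ∉ 𝒢 → τ' ∉ 𝒢 → τ⁻¹ * τ' ∈ 𝒢)
    (hex : ∃ τ₁ : L ≃ₐ[ℚ] L, τ₁ ∉ 𝒢)
    (hinv : ∀ τ σ : L ≃ₐ[ℚ] L, τ ∉ 𝒢 → σ ∈ 𝒢 → τ * σ * τ⁻¹ = σ⁻¹) :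
    ∃ (N A : Subgroup (absoluteGaloisGroup ℚ)) (τ : absoluteGaloisGroup ℚ), N.Normal ∧
      (∀ n ∈ N, ∃ τ' : absoluteGaloisGroup L, resGal (K := ℚ) L τ' = n) ∧
      (∀ g : absoluteGaloisGroup ℚ, g * g ∈ A) ∧ (∀ a ∈ A, τ⁻¹ * a * τ * a ∈ N) := by
  -- ### the fields `ℚ ⊂ L ⊂ L̄`
  haveI : IsScalarTower ℚ L (AlgebraicClosure L) :=
    IsScalarTower.of_algebraMap_eq' (RingHom.ext_rat _ _).symm
  haveI : Algebra.IsAlgebraic ℚ (AlgebraicClosure L) := Algebra.IsAlgebraic.trans ℚ L _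
  haveI : Normal ℚ (AlgebraicClosure L) := (IsAlgClosure.mk inferInstance inferInstance :
    IsAlgClosure ℚ (AlgebraicClosure L)).normal
  -- ### `π : Γ_ℚ ≃ Aut_ℚ(L̄) → Gal(L/ℚ)`, onto
  let Φ : absoluteGaloisGroup ℚ ≃* (AlgebraicClosure L ≃ₐ[ℚ] AlgebraicClosure L) :=
    absGaloisTransport (K := ℚ) (L := L)
  let rL : (AlgebraicClosure L ≃ₐ[ℚ] AlgebraicClosure L) →* (L ≃ₐ[ℚ] L) :=
    AlgEquiv.restrictNormalHom L
  let π : absoluteGaloisGroup ℚ →* (L ≃ₐ[ℚ] L) := rL.comp Φ.toMonoidHom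
  have hπ : Function.Surjective π :=
    (AlgEquiv.restrictNormalHom_surjective (F := ℚ) (K₁ := L) (E := AlgebraicClosure L)).comp
      Φ.surjective
  obtain ⟨τ₁, hτ₁⟩ := hex
  obtain ⟨g₁, hg₁⟩ := hπ τ₁
  refine ⟨π.ker, 𝒢.comap π, g₁⁻¹, inferInstance, ?_, ?_, ?_⟩
  · -- ### `ker π` is the image of `Γ_L → Γ_ℚ`
    intro n hn
    have h1 : rL (Φ n) = 1 := hn
    suffices h : ∀ x : L, Φ n (algebraMap L (AlgebraicClosure L) x) =
        algebraMap L (AlgebraicClosure L) x by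
      obtain ⟨τ, hτ⟩ := (mem_range_absGaloisRestrict_iff (K := ℚ) (L := L) n).mpr h
      exact ⟨τ, hτ⟩
    intro x
    have h2 := AlgEquiv.restrictNormal_commutes (Φ n) L x
    change algebraMap L (AlgebraicClosure L) (rL (Φ n) x) = _ at h2
    rw [h1, AlgEquiv.one_apply] at h2
    exact h2.symm
  · -- ### every square lands in `𝒢` (`𝒢` has index two)
    intro g
    change π (g * g) ∈ 𝒢
    rw [map_mul]
    by_cases hg : π g ∈ 𝒢
    · exact 𝒢.mul_mem hg hg
    · have h := hprod (π g)⁻¹ (π g) (fun h ↦ hg (inv_mem_iff.mp h)) hg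
      rwa [inv_inv] at h
  · -- ### the inversion relation `τ⁻¹ a τ a ∈ N` for `τ = g₁⁻¹`, `π g₁ = τ₁ ∉ 𝒢`
    intro a ha
    have ha' : π a ∈ 𝒢 := ha
    change π (g₁⁻¹⁻¹ * a * g₁⁻¹ * a) = 1
    rw [inv_inv, map_mul, map_mul, map_mul, map_inv, hg₁, hinv τ₁ (π a) hτ₁ ha', inv_mul_cancel]

/-- **Leaf G(a′) PROVED: the class-field-theory datum holds** — Cox Lemma 9.3 for the Hilbert class field
`K[1] ⊂ ℂ` (tree: `IsGalois ℚ K[1]`, `inv_mul_mem_ringClassGal_of_not_mem`,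
`exists_not_mem_ringClassGal_forall_mul_mul_inv_eq_inv`, `mul_mul_inv_eq_inv_of_not_mem_ringClassGal`) fed to
`exists_invertedData_of_isGalois`. [cite: Cox2013, §9.A Lemma 9.3] [cite: GrossLMS1991, §5] -/
theorem ringClassInvertedDatum_holds : RingClassInvertedDatum := by
  intro K _ _ hK ι
  haveI := (finiteDimensional_and_isGalois_ringClassField hK ι one_ne_zero).1
  haveI : NumberField (ringClassField K ι 1) := NumberField.of_module_finite K _
  haveI := Summit.BirchSwinnertonDyer.Rank1Residual.X11b.RingClassConj.isGalois_rat_ringClassField hK ι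
    one_ne_zero
  obtain ⟨τ₁, hτ₁, -⟩ := exists_not_mem_ringClassGal_forall_mul_mul_inv_eq_inv hK ι one_ne_zero
  exact exists_invertedData_of_isGalois (ringClassField K ι 1) (ringClassGal ι 1)
    (fun τ τ' hτ hτ' ↦ inv_mul_mem_ringClassGal_of_not_mem hK ι 1 hτ hτ') ⟨τ₁, hτ₁⟩
    (fun τ σ hτ hσ ↦ mul_mul_inv_eq_inv_of_not_mem_ringClassGal hK ι one_ne_zero hτ hσ)

/-- **Leaf G(a) PROVED** (the REV 4 leaf, byte-unchanged): `E(K[1])[7] = 0` for every `E ∈ 𝒞₇`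
and every imaginary quadratic `K` — Gross's Lemma 4.3 in the REDUCIBLE (CM, Borel) case, from good ordinary
reduction at `2`, Mazur's Frobenius relation, Hasse, the Weil pairing and Cox Lemma 9.3; no use of the type
(`v₇(Δ) = 3`), of the Heegner hypothesis, or of CM. [cite: GrossLMS1991, §4 Lemma 4.3]
[cite: Mazur1978, Prop. 6.3 (1)] [cite: Cox2013, §9.A Lemma 9.3] [cite: SilvermanAEC2009, III.8.1, V.1.1] -/
theorem typeIIINoSevenTorsionSeven_holds : TypeIIINoSevenTorsionSeven :=
  typeIIINoSevenTorsionSeven_of_ringClassInvertedDatum ringClassInvertedDatum_holds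

/-- **Leaf G PROVED unconditionally** (REV 4's `kolyvaginIndexBookkeepingSeven_of_noTorsion` at the proved G(a)).
[cite: GrossLMS1991, §4 (4.1) and Lemma 4.3] [cite: McCallumLMS1991, §5] -/
theorem kolyvaginIndexBookkeepingSeven_holds : KolyvaginIndexBookkeepingSeven :=
  kolyvaginIndexBookkeepingSeven_of_noTorsion typeIIINoSevenTorsionSeven_holds

end LeafGa

/-! ## §14 REV 5 COMPOSITE, PROVED: K7r ⟸ A ∧ B ∧ D(a) (three leaves; T, S, D(b), G, G(a) discharged by §6, §9, §8, §11, §13) -/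

/-- **THE NODE'S `closes` AFTER REV 5 (PROVED): leaf K7r from A, B, D(a)** and the ELEVEN published facts by name
(`hBF, hmod, hnf, hLLT, hKob, hLTYZ, hGZK, hCassels, hFH, hGZ, hKo`; the binder `hGa` of `cmRamifiedSeven_of_torsion_leaf`
is discharged by `typeIIINoSevenTorsionSeven_holds`; NO new fact binder).  B and D(a) are WEAKER than K7r and ATTACKABLE
(THEOREM R, THEOREM M of the memos); A is UNDECIDED and idea-bound (card `cuspidal-descent-kolyvagin-nonvanishing`).
No summit statement is proved here: this is a conditional certificate `facts → A → B → D(a) → K7r`.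
[cite: Kolyvagin1991, Thm. 1] [cite: GrossZagier1986, V.§2 (2.2)] [cite: GrossLMS1991, §4 (4.1) and Lemma 4.3]
[cite: Cassels1965ArithmeticVIII, Thm. 1.3] [cite: Darmon2004, Thm. 3.6 and Thm. 3.7] [cite: Mazur1978, Prop. 6.3 (1)]
[cite: Cox2013, §9.A Lemma 9.3] -/
theorem cmRamifiedSeven_of_three_leaves (hBF : bsdTriple_of_hasCM_of_L_one_ne_zero)
    (hmod : hasEntireLFunction_rat) (hnf : exists_isNewformOf)
    (hLLT : LiLiuTian2024.thm11_bsdp_of_cm_rank_one) (hKob : Kobayashi2013.cor14_bsdp_of_cm_rank_one)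
    (hLTYZ : LiTianYanZhu2025.thm11_bsdp_of_cm_rank_one)
    (hGZK : rank_eq_analyticRank_of_analyticRank_le_one)
    (hCassels : bsdRHS_eq_of_isIsogenous)
    (hFH : friedbergHoffstein_exists_heegnerField_splitDivisors_twist_ne_zero)
    (hGZ : ∀ (N : ℕ) [NeZero N] (W : WeierstrassCurve ℚ) (K : Type) [Field K] [NumberField K],
      gross_zagier N W K)
    (hKo : ∀ (N : ℕ) [NeZero N] (W : WeierstrassCurve ℚ) (K : Type) [Field K] [NumberField K],
      kolyvagin N W K)
    (hA : KolyvaginDatumHalfSeven) (hB : EisensteinCMKolyvaginStructureSeven)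
    (hDa : DescentManinDatumSeven) : X12.CMRamifiedSeven :=
  cmRamifiedSeven_of_torsion_leaf hBF hmod hnf hLLT hKob hLTYZ hGZK hCassels hFH hGZ hKo hA hB
    typeIIINoSevenTorsionSeven_holds hDa

/-! ## §15 REV 6 — hypothesis (H2) «no torsion in ring class towers» of THEOREM R (leaf B, memo g34 §3)
DISCHARGED in kernel: `E(K[n])[7^M] = 0` and `E^{(d_K)}(K[n])[7^M] = 0` for every `E ∈ 𝒞₇` (indeed every globally
minimal `E/ℚ` good at `2`), every imaginary quadratic `K`, every `n ≠ 0`, every `M` -/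

section TowerH2

open Literature.NumberTheory.GaloisRepresentations NumberField IsDedekindDomain Field


/-- **The inverted datum at every level `n ≠ 0` of the ring class tower** (Cox Lemma 9.3 for `K[n]`:
`Gal(K[n]/ℚ) = Gal(K[n]/K) ⋊ ⟨τ⟩`, `τ σ τ⁻¹ = σ⁻¹`), in `Γ_ℚ`-currency — the `n`-general form of
`ringClassInvertedDatum_holds` (same proof, the tree lemmas being stated for all `n ≠ 0`). [cite: Cox2013, §9.A Lemma 9.3] -/
theorem exists_invertedData_ringClassField {K : Type} [Field K] [NumberField K] (hK : IsImaginaryQuadratic K)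
    (ι : K →+* ℂ) {n : ℕ} (hn : n ≠ 0) :
    ∃ (N A : Subgroup (absoluteGaloisGroup ℚ)) (τ : absoluteGaloisGroup ℚ), N.Normal ∧
      (∀ m ∈ N, ∃ τ' : absoluteGaloisGroup (ringClassField K ι n),
          resGal (K := ℚ) (ringClassField K ι n) τ' = m) ∧
      (∀ g : absoluteGaloisGroup ℚ, g * g ∈ A) ∧ (∀ a ∈ A, τ⁻¹ * a * τ * a ∈ N) := by
  haveI := (finiteDimensional_and_isGalois_ringClassField hK ι hn).1
  haveI : NumberField (ringClassField K ι n) := NumberField.of_module_finite K _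
  haveI := Summit.BirchSwinnertonDyer.Rank1Residual.X11b.RingClassConj.isGalois_rat_ringClassField hK ι hn
  obtain ⟨τ₁, hτ₁, -⟩ := exists_not_mem_ringClassGal_forall_mul_mul_inv_eq_inv hK ι hn
  exact exists_invertedData_of_isGalois (ringClassField K ι n) (ringClassGal ι n)
    (fun τ τ' hτ hτ' ↦ inv_mul_mem_ringClassGal_of_not_mem hK ι n hτ hτ') ⟨τ₁, hτ₁⟩
    (fun τ σ hτ hσ ↦ mul_mul_inv_eq_inv_of_not_mem_ringClassGal hK ι hn hτ hσ)

/-- **`E(K[n])[7] = 0` along the whole ring class tower** (`n ≠ 0`; `K` ANY imaginary quadratic field; `E/ℚ` ANY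
globally minimal elliptic curve with good reduction at `2` — no surjectivity or irreducibility of `ρ̄_{E,7}`): Gross's
Lemma 4.3 / McCallum's (5) at `p = 7` in the reducible-friendly form, = hypothesis (H2) «no torsion in ring class
towers» of THEOREM R (leaf B, memo g34 §3) for `E` (for the twin `E^{(d_{K})}` it follows through the
`K`-isomorphism `E^{(d_K)} ≅ E`, `K ⊂ K[n]`; not spelled out here). [cite: GrossLMS1991, §4 Lemma 4.3] [cite: McCallumLMS1991, §4 (5)] [cite: Mazur1978, Prop. 6.3 (1)]
[cite: Cox2013, §9.A Lemma 9.3] -/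
theorem torsionBy_ringClassField_seven_eq_bot (W : WeierstrassCurve ℚ) [W.IsElliptic] [W.IsGloballyMinimal]
    (hgood : W.HasGoodReductionAtPrime 2) {K : Type} [Field K] [NumberField K] (hK : IsImaginaryQuadratic K)
    (ι : K →+* ℂ) {n : ℕ} (hn : n ≠ 0) :
    AddSubgroup.torsionBy (W.baseChange (ringClassField K ι n)).toAffine.Point ((7 : ℕ) : ℤ) = ⊥ := by
  haveI := (finiteDimensional_and_isGalois_ringClassField hK ι hn).1
  haveI : NumberField (ringClassField K ι n) := NumberField.of_module_finite K _
  obtain ⟨N, A, τ, hNn, hN, hsq, hdih⟩ := exists_invertedData_ringClassField hK ι hn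
  haveI := hNn
  exact torsionBy_seven_eq_bot_of_invertedData (ringClassField K ι n) W hgood N A hN hsq τ hdih

/-- **`E(K[n])[7^M] = 0` along the whole ring class tower** (no `7`-torsion ⇒ no `7^M`-torsion, tree
`torsionBy_pow_eq_bot`) — the form in which (H2) is consumed (uniqueness of `7^M`-division points in `E(K[n])`,
McCallum §4 (5) / §5 Lemma 5.1). [cite: McCallumLMS1991, §4 (5) and §5 Lemma 5.1] [cite: GrossLMS1991, §4 Lemma 4.3] -/
theorem torsionBy_ringClassField_seven_pow_eq_bot (W : WeierstrassCurve ℚ) [W.IsElliptic] [W.IsGloballyMinimal]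
    (hgood : W.HasGoodReductionAtPrime 2) {K : Type} [Field K] [NumberField K] (hK : IsImaginaryQuadratic K)
    (ι : K →+* ℂ) {n : ℕ} (hn : n ≠ 0) (M : ℕ) :
    AddSubgroup.torsionBy (W.baseChange (ringClassField K ι n)).toAffine.Point ((7 ^ M : ℕ) : ℤ) = ⊥ :=
  torsionBy_pow_eq_bot (p := 7) (torsionBy_ringClassField_seven_eq_bot W hgood hK ι hn) M

/-- **(H2) on the class 𝒞₇, element form**: for `W ∈ 𝒞₇` (any `7`-type), any imaginary quadratic `K`, `n ≠ 0`, `M`: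
`7^M • R = 0 ⇒ R = 0` in `E(K[n])`. [cite: McCallumLMS1991, §4 (5)] [cite: GrossLMS1991, §4 Lemma 4.3] -/
theorem classCSeven_ringClassField_no_seven_pow_torsion (W : WeierstrassCurve ℚ) [W.IsElliptic]
    [W.IsGloballyMinimal] (hC : ClassCSeven W) {K : Type} [Field K] [NumberField K] (hK : IsImaginaryQuadratic K)
    (ι : K →+* ℂ) {n : ℕ} (hn : n ≠ 0) (M : ℕ) (R : (W.baseChange (ringClassField K ι n)).toAffine.Point)
    (hR : ((7 ^ M : ℕ) : ℤ) • R = 0) : R = 0 := by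
  have hbot := torsionBy_ringClassField_seven_pow_eq_bot W hC.2.2.2.1.1 hK ι hn M
  have hR' : (7 ^ M : ℕ) • R = 0 := by rw [← natCast_zsmul]; exact hR
  have hmem : R ∈ AddSubgroup.torsionBy (W.baseChange (ringClassField K ι n)).toAffine.Point ((7 ^ M : ℕ) : ℤ) :=
    AddSubgroup.torsionBy.nsmul_iff.mpr hR'
  rw [hbot, AddSubgroup.mem_bot] at hmem
  exact hmem

end TowerH2

section TwinH2

open Literature.NumberTheory.GaloisRepresentations NumberField IsDedekindDomain Field


open scoped Classical in
/-- **(H2) for the twin, abstract form**: over a number field `L` carrying inverted data `(N, A, τ)` (as in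
`torsionBy_seven_eq_bot_of_invertedData`) and a square root `θ` of `d ∈ ℚˣ`, every `ℚ`-model `Wd` of the twist
`W^{(d)}` (`Cd • W^{(d)} = Wd`, the shape of D(b)) has no `7^M`-torsion in `Wd(L)` — through the twist isomorphism
`W^{(d)} ≅ W` over `L ∋ θ = √d` (tree `twistPointEquiv`, Silverman X.5 Cor. 5.4 (iii); stated with the classical
decidability instances that isomorphism carries) and the `E`-statement. [cite: SilvermanAEC2009, X.5 Cor. 5.4]
[cite: McCallumLMS1991, §4 (5)] [cite: GrossLMS1991, §4 Lemma 4.3] -/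
theorem twist_no_seven_pow_torsion_of_invertedData (L : Type) [Field L] [NumberField L]
    (W : WeierstrassCurve ℚ) [W.IsElliptic] [W.IsGloballyMinimal] (hgood : W.HasGoodReductionAtPrime 2)
    (N A : Subgroup (absoluteGaloisGroup ℚ)) [N.Normal]
    (hN : ∀ n ∈ N, ∃ τ' : absoluteGaloisGroup L, resGal (K := ℚ) L τ' = n)
    (hsq : ∀ g : absoluteGaloisGroup ℚ, g * g ∈ A) (τ : absoluteGaloisGroup ℚ)
    (hdih : ∀ a ∈ A, τ⁻¹ * a * τ * a ∈ N) (M : ℕ) {d : ℚ} (hd : d ≠ 0) {θ : L}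
    (hθ : θ ^ 2 = algebraMap ℚ L d) {Wd : WeierstrassCurve ℚ} {Cd : VariableChange ℚ}
    (hWd : Cd • W.quadraticTwist d = Wd) (R : (Wd.baseChange L).toAffine.Point)
    (hR : ((7 ^ M : ℕ) : ℤ) • R = 0) : R = 0 := by
  subst hWd
  obtain ⟨C, hC⟩ := W.exists_variableChange_quadraticTwist_one
  have e₁ := (VariableChange.pointEquivBaseChange (W.quadraticTwist d) Cd L).symm
  have e₂ := WeierstrassCurve.twistPointEquiv W hC hd hθ
  have hbot := torsionBy_pow_eq_bot (p := 7) (torsionBy_seven_eq_bot_of_invertedData L W hgood N A hN hsq τ hdih) M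
  have hsm : ((7 ^ M : ℕ) : ℤ) • e₂ (e₁ R) = 0 := by
    rw [← map_zsmul e₂, ← map_zsmul e₁, hR, map_zero, map_zero]
  have hsm' : (7 ^ M : ℕ) • e₂ (e₁ R) = 0 := by rw [← natCast_zsmul]; exact hsm
  have hmem : e₂ (e₁ R) ∈ AddSubgroup.torsionBy (W.baseChange L).toAffine.Point ((7 ^ M : ℕ) : ℤ) :=
    AddSubgroup.torsionBy.nsmul_iff.mpr hsm'
  rw [hbot, AddSubgroup.mem_bot] at hmem
  have h1 : e₁ R = 0 := e₂.injective (by rw [hmem, map_zero])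
  exact e₁.injective (by rw [h1, map_zero])

/-- **(H2) for the twin along the ring class tower**: if `d ∈ ℚˣ` is a square in `K` (e.g. `d = d_K`), every
`ℚ`-model `Wd` of `W^{(d)}` has `Wd(K[n])[7^M] = 0` (`n ≠ 0`) — (H2) of THEOREM R for `E^{tw} = E^{(d_{K″})}` (memo
g34 §3). [cite: McCallumLMS1991, §4 (5)] [cite: SilvermanAEC2009, X.5 Cor. 5.4] [cite: Cox2013, §9.A Lemma 9.3] -/
theorem twist_ringClassField_no_seven_pow_torsion (W : WeierstrassCurve ℚ) [W.IsElliptic] [W.IsGloballyMinimal]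
    (hgood : W.HasGoodReductionAtPrime 2) {K : Type} [Field K] [NumberField K] (hK : IsImaginaryQuadratic K)
    (ι : K →+* ℂ) {n : ℕ} (hn : n ≠ 0) (M : ℕ) {d : ℚ} (hd : d ≠ 0) {y : K} (hy : y ^ 2 = algebraMap ℚ K d)
    {Wd : WeierstrassCurve ℚ} {Cd : VariableChange ℚ} (hWd : Cd • W.quadraticTwist d = Wd)
    (R : (Wd.baseChange (ringClassField K ι n)).toAffine.Point) (hR : ((7 ^ M : ℕ) : ℤ) • R = 0) : R = 0 := by
  haveI := (finiteDimensional_and_isGalois_ringClassField hK ι hn).1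
  haveI : NumberField (ringClassField K ι n) := NumberField.of_module_finite K _
  obtain ⟨N, A, τ, hNn, hN, hsq, hdih⟩ := exists_invertedData_ringClassField hK ι hn
  haveI := hNn
  have hθ : (algebraMap K (ringClassField K ι n) y) ^ 2 = algebraMap ℚ (ringClassField K ι n) d := by
    rw [← map_pow, hy, ← IsScalarTower.algebraMap_apply]
  refine twist_no_seven_pow_torsion_of_invertedData (ringClassField K ι n) W hgood N A hN hsq τ hdih M hd hθ
    hWd R ?_
  convert hR

/-- **(H2) for the twin by `d_K`** (the case of THEOREM R: `K″ = ℚ(√d_{K″})`, `E^{tw} = E^{(d_{K″})}`): `√d_K ∈ K`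
by the tree's `exists_sq_eq_discr`. [cite: McCallumLMS1991, §4 (5)] [cite: Cox2013, §5.B (5.13)–(5.14)] -/
theorem discrTwist_ringClassField_no_seven_pow_torsion (W : WeierstrassCurve ℚ) [W.IsElliptic]
    [W.IsGloballyMinimal] (hgood : W.HasGoodReductionAtPrime 2) {K : Type} [Field K] [NumberField K]
    (hK : IsImaginaryQuadratic K) (ι : K →+* ℂ) {n : ℕ} (hn : n ≠ 0) (M : ℕ)
    {Wd : WeierstrassCurve ℚ} {Cd : VariableChange ℚ} (hWd : Cd • W.quadraticTwist (NumberField.discr K : ℚ) = Wd)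
    (R : (Wd.baseChange (ringClassField K ι n)).toAffine.Point) (hR : ((7 ^ M : ℕ) : ℤ) • R = 0) : R = 0 := by
  obtain ⟨-, -, δ, -, hδ⟩ := Literature.NumberTheory.QuadraticFields.Quadratic.exists_sq_eq_discr hK.1
  have hd : (NumberField.discr K : ℚ) ≠ 0 := by exact_mod_cast NumberField.discr_ne_zero K
  have hy : (algebraMap (𝓞 K) K δ) ^ 2 = algebraMap ℚ K (NumberField.discr K : ℚ) := by
    rw [← map_pow, hδ]; simp
  exact twist_ringClassField_no_seven_pow_torsion W hgood hK ι hn M hd hy hWd R hR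

end TwinH2

/-- **(H2) of THEOREM R (leaf B, memo g34 §3) as a typed Prop — `TowerNoSevenTorsionSeven`.** For every `W ∈ 𝒞₇`
(any `7`-type), every imaginary quadratic `K`, every level `n ≠ 0` and exponent `M`: `E(K[n])` has no `7^M`-torsion,
and neither has `Wd(K[n])` for any `ℚ`-model `Wd` of the twist `W^{(d_K)}` (`Cd • W^{(d_K)} = Wd`). McCallum's (5) /
Gross's Lemma 4.3 «no torsion in ring class towers» for the curve AND its `d_K`-twin, at the Eisenstein prime `7`.
PROVED below (`towerNoSevenTorsionSeven_holds`). [cite: McCallumLMS1991, §4 (5)] [cite: GrossLMS1991, §4 Lemma 4.3] -/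
def TowerNoSevenTorsionSeven : Prop :=
  ∀ (W : WeierstrassCurve ℚ) [W.IsElliptic] [W.IsGloballyMinimal], ClassCSeven W →
    ∀ (K : Type) [Field K] [NumberField K], IsImaginaryQuadratic K → ∀ (ι : K →+* ℂ) (n : ℕ), n ≠ 0 →
    ∀ (M : ℕ),
      (∀ R : (W.baseChange (ringClassField K ι n)).toAffine.Point, ((7 ^ M : ℕ) : ℤ) • R = 0 → R = 0) ∧
      ∀ (Wd : WeierstrassCurve ℚ) (Cd : VariableChange ℚ),
        Cd • W.quadraticTwist (NumberField.discr K : ℚ) = Wd →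
        ∀ R : (Wd.baseChange (ringClassField K ι n)).toAffine.Point, ((7 ^ M : ℕ) : ℤ) • R = 0 → R = 0

/-- **(H2) of THEOREM R holds** — unconditionally, for all of 𝒞₇, every imaginary quadratic `K`, every `n ≠ 0`, `M`,
for `E` and for its `d_K`-twin (§13 + §15). [cite: McCallumLMS1991, §4 (5)] [cite: GrossLMS1991, §4 Lemma 4.3]
[cite: Mazur1978, Prop. 6.3 (1)] [cite: Cox2013, §9.A Lemma 9.3] [cite: SilvermanAEC2009, X.5 Cor. 5.4] -/
theorem towerNoSevenTorsionSeven_holds : TowerNoSevenTorsionSeven := by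
  intro W _ _ hC K _ _ hK ι n hn M
  exact ⟨classCSeven_ringClassField_no_seven_pow_torsion W hC hK ι hn M,
    fun Wd Cd hWd R hR ↦ discrTwist_ringClassField_no_seven_pow_torsion W hC.2.2.2.1.1 hK ι hn M hWd R hR⟩


/-! ## §16 REV 6 — leaf B refined to B♭ := «THEOREM R granted (H2)», and the composite with B♭ -/

/-- **Piece B♭ (a LIGHTER typing target than B; NEW in REV 6) — `EisensteinCMKolyvaginStructureSevenGrantedH2 :=
TowerNoSevenTorsionSeven → EisensteinCMKolyvaginStructureSeven`.** THEOREM R (memos g34/g37/g40) rests on six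
hypotheses (H1)–(H6) given paper proofs in memo g34 §3; (H2) «no torsion in ring class towers, for `E` and its twin»
is now PROVED in kernel (§15 `towerNoSevenTorsionSeven_holds`), so the typist of leaf B may ASSUME it: B♭ is what
remains. Trivially `B → B♭` (`fun h _ ↦ h`), and `B♭ → B` by §15 (`eisensteinCMKolyvaginStructureSeven_of_grantedH2`); the level-1/2
certificates of B are unchanged (B is byte-unchanged). D-0171 tag: ATTACKABLE (L) — THEOREM R minus (H2).
[cite: McCallumLMS1991, §1 Theorem, §4 (5) and §5] [cite: GrossLMS1991, Thm. 1.3 and §4 Lemma 4.3] -/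
def EisensteinCMKolyvaginStructureSevenGrantedH2 : Prop :=
  TowerNoSevenTorsionSeven → EisensteinCMKolyvaginStructureSeven

/-- `B♭ → B`: (H2) is discharged by §15. [cite: McCallumLMS1991, §4 (5)] [cite: GrossLMS1991, §4 Lemma 4.3] -/
theorem eisensteinCMKolyvaginStructureSeven_of_grantedH2 (h : EisensteinCMKolyvaginStructureSevenGrantedH2) :
    EisensteinCMKolyvaginStructureSeven :=
  h towerNoSevenTorsionSeven_holds

/-- **REV 6 COMPOSITE — K7r from A, B♭ and D(a)** (plus the eleven named facts of §14): leaf B is replaced by the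
lighter B♭ = «THEOREM R granted (H2)», (H2) being supplied in kernel by §15; everything else as
`cmRamifiedSeven_of_three_leaves`. The remaining open leaves of the node are A (`KolyvaginDatumHalfSeven`,
UNDECIDED·IDEA-NEEDED), B♭ (ATTACKABLE L: THEOREM R minus (H2)) and D(a) (`DescentManinDatumSeven`, ATTACKABLE M:
THEOREM M). No summit statement and no crux is proved here. [cite: GrossZagier1986, Thm. I.6.3]
[cite: KolyvaginEuler1990, Thm. A] [cite: McCallumLMS1991, §1 Theorem and §5] [cite: GrossLMS1991, §4 Lemma 4.3]
[cite: Stevens1989, (5.4)–(5.6)] [cite: Mazur1978, Prop. 6.3 (1)] -/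
theorem cmRamifiedSeven_of_three_leaves_grantedH2 (hBF : bsdTriple_of_hasCM_of_L_one_ne_zero)
    (hmod : hasEntireLFunction_rat) (hnf : exists_isNewformOf)
    (hLLT : LiLiuTian2024.thm11_bsdp_of_cm_rank_one) (hKob : Kobayashi2013.cor14_bsdp_of_cm_rank_one)
    (hLTYZ : LiTianYanZhu2025.thm11_bsdp_of_cm_rank_one)
    (hGZK : rank_eq_analyticRank_of_analyticRank_le_one)
    (hCassels : bsdRHS_eq_of_isIsogenous)
    (hFH : friedbergHoffstein_exists_heegnerField_splitDivisors_twist_ne_zero)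
    (hGZ : ∀ (N : ℕ) [NeZero N] (W : WeierstrassCurve ℚ) (K : Type) [Field K] [NumberField K],
      gross_zagier N W K)
    (hKo : ∀ (N : ℕ) [NeZero N] (W : WeierstrassCurve ℚ) (K : Type) [Field K] [NumberField K],
      kolyvagin N W K)
    (hA : KolyvaginDatumHalfSeven) (hBflat : EisensteinCMKolyvaginStructureSevenGrantedH2)
    (hDa : DescentManinDatumSeven) : X12.CMRamifiedSeven :=
  cmRamifiedSeven_of_three_leaves hBF hmod hnf hLLT hKob hLTYZ hGZK hCassels hFH hGZ hKo hA
    (eisensteinCMKolyvaginStructureSeven_of_grantedH2 hBflat) hDa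

/-! ## §17 REV 7 — leaf D(a) `DescentManinDatumSeven` in kernel, granted Cremona's row `N = 49` by name

THEOREM M of memo g26 (`CuspidalDescentManin-g26.md`; skeleton `CuspidalDescentManinTransport.lean`, whose odd step and
isogeny step are re-proved VERBATIM in §17.1 because `Cruxes/` modules are not importable), run as a FAMILY INDUCTION over
the prime discriminants of the twisting parameter, with exactly ONE printed input beyond the eleven facts of §14:
`hM : OptimalCurveManinCertificate cm7` («`49a1 = [1,−1,0,−2,−1]` is the `X₀(49)`-optimal curve of its class and its Manin
constant is `±1`»: Cremona's Table 1, row `N = 49`, with Agashe–Ribet–Stein Thm. 2.6 — the binder already consumed by the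
landed Goldfeld theorems, ledger item `GoldfeldAllTwistsTwoConverse.OptimalManinCertificateX049`), and modularity `hnf`.

* §17.5 (classification, kernel): a type-III member `W` of `𝒞₇` (`ord₇ Δ_W = 3`, good at `2`) is `ℚ`-isomorphic to
  `E₀ ⊗ χ_d` with `E₀ ∈ {49a1, 49a2 = [1,−1,0,−37,−78]}` (the two CM `j`-invariants `−3375`, `16581375` with field
  `ℚ(√−7)`; same `j ∉ {0, 1728}` ⇒ quadratic twist, tree theorem), `d` squarefree, `d ≡ 1 (mod 4)` (both `E₀` are good
  at `2`: the tree's `FlatTwist.Family.emod_four_eq_one_of_hasGoodReductionAtPrime_two`) and `7 ∤ d`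
  (`3 = ord₇ Δ_W = 12k + 6·ord₇ d + 3`); §17.6: such a `d` is the product of its prime discriminants,
  `d = ∏_{q ∣ d} q*`, `q* = (−1)^{(q−1)/2} q`, all `q` odd and `≠ 7`.
* §17.3 (base): `49a1` carries an `X₀(N(49a1))`-datum with `7 ∤ c` (`hM`), and so does `49a2` at the SAME level with the
  SAME constant: the `2`-isogeny `49a1 → 49a2` has pull-back scalar `1` on the Néron pairs (the tree's Vélu computation
  `ManinAdditive.KatoCurve.CMTwinMinimal.lattice_le_of_velu_two_kleinian` at `u = 1`, from `(c₄, c₆)(49a1) = (105, 1323)`,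
  `(c₄, c₆)(49a2) = (1785, 75411)`), so the isogeny step applies with `a = 1`; `N(49a2) = N(49a1)` by `hnf`.
* §17.4 (induction on the finite set `S` of primes): every globally minimal model `C` of `E₀ ⊗ χ_{d_S}`,
  `d_S = ∏_{q∈S} q*`, carries an `X₀(N(C))`-datum with `7 ∤ c`, and `N(C) = N(E₀) ∏_{q∈S} q²`. Step: the odd step
  (Stevens (5.2)/(5.4), Atkin–Li, `aₙ(C) = χ_q(n) aₙ(A)` by the twisting identity at `q ∤ N(A)`) applied to a globally
  minimal model `A` of `E₀ ⊗ χ_{d_{S∖q}}` — `q ∤ N(A) = 49 ∏ q'²` because `q ≠ 7` and `q ∉ S ∖ q` — the identification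
  `A ⊗ χ_{q*} ≅ C` being the tree's composition law `(E₀ ⊗ χ_a) ⊗ χ_b = E₀ ⊗ χ_{ab}` under a variable change; base
  `S = ∅`: transfer of a datum along a `ℚ`-isomorphism of globally minimal models (§17.2: `u = ±1`, Silverman VII.1.3(b),
  so `c₄`, `c₆`, the Néron pair and the `aₙ` are unchanged).

No optimality of `W`, no Cremona range bound, no Edixhoven / Mazur `p ∤ c` theorem (both exclude additive type III at
`p = 7`), no isogeny of degree divisible by `7` (so no pull-back-scalar control is needed beyond Vélu's `a = 1`).
New composite `cmRamifiedSeven_of_two_leaves_grantedH2`: K7r ⟸ A ∧ B♭, given the eleven facts of §14 and `hM`.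
No summit statement and no crux is proved here. [cite: Stevens1989, Lemmas (5.2), (5.4) pp. 96–97]
[cite: AtkinLi1978, Thm. 3.1] [cite: CremonaAlgorithms1997, §2.10 and Table 1 (N = 49)] [cite: AgasheRibetStein2006, Thm. 2.6]
[cite: SilvermanAEC2009, VII.1.3(b), X.2 Ex. 10.16, X.5 Prop. 5.4] [cite: SilvermanATAEC1994, App. A §3] -/

section DescentManin

open CongruenceSubgroup Literature.NumberTheory.Automorphic
open scoped MatrixGroups ModularForm

/-! ### §17.1 Datum transport: the `χ`-generic core, the odd step and the isogeny step (memo g26, verbatim) -/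

/-- **Transport of a parametrisation datum along a character twist, same constant** (memo g26, M0). `D_A` any
`X₀(N')`-datum of any `A`; `χ` primitive quadratic mod `m`, `N' ∣ N`, `m² ∣ N`; `f_C ∈ S₂(Γ₀(N))` the newform of `C`
with `aₙ(f_C) = χ(n) aₙ(f_{D_A})`; `Λ_C` a Néron-type pair of `C` with `Λ_C = g(χ)⁻¹ Λ_A`. Then `C` has an
`X₀(N)`-datum `D` with `D.f = f_C`, `D.L = Λ_C`, `D.c = D_A.c`. [cite: Stevens1989, Lemma (5.4) p. 97 and (5.5)]
[cite: CremonaAlgorithms1997, §2.10] [cite: SilvermanAEC2009, Prop. VI.3.6(b)] -/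
theorem exists_datum_c_eq_of_charTwist
    {A : WeierstrassCurve ℚ} [A.IsElliptic] {N' : ℕ} [NeZero N'] (DA : ModularParametrizationData A N')
    {C : WeierstrassCurve ℚ} [C.IsElliptic] {N : ℕ} [NeZero N]
    {m : ℕ} [NeZero m] {χ : DirichletCharacter ℂ m} (hχ : χ.IsQuadratic) (hprim : χ.IsPrimitive)
    (hN : N' ∣ N) (hm : m ^ 2 ∣ N)
    {fC : CuspForm (Gamma0 N) 2} (hfC : IsNewformOf C fC)
    (hf : ∀ n : ℕ, cuspCoeff fC n = χ n * cuspCoeff DA.f n)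
    {LC : PeriodPair} (hLC : IsNeronLatticeOf (C.baseChange ℂ) LC)
    (hmem : ∀ z : ℂ, z ∈ LC.lattice ↔ gaussSum χ (ZMod.stdAddChar (N := m)) * z ∈ DA.L.lattice) :
    ∃ D : ModularParametrizationData C N, D.f = fC ∧ D.L = LC ∧ D.c = DA.c := by
  have hfeq : fC = charTwist N hN hm hχ DA.f :=
    eq_of_forall_cuspCoeff_eq_gamma0 fun n ↦ by rw [hf, cuspCoeff_charTwist N hN hm hχ hprim]
  have hc : DA.c ≠ 0 := DA.maninConstant_ne_zero_holds
  have hle : ∀ w ∈ periodLattice fC, (DA.c : ℂ) * w ∈ LC.lattice := by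
    intro w hw
    rw [hfeq] at hw
    have hw' : gaussSum χ (ZMod.stdAddChar (N := m)) * w ∈ periodLattice DA.f :=
      gaussSum_mul_mem_periodLattice_of_mem_charTwist N hN hm hχ hprim DA.f hw
    have h3 : (DA.c : ℂ) * (gaussSum χ (ZMod.stdAddChar (N := m)) * w) ∈ DA.L.lattice :=
      DA.smul_periodLattice_le _ hw'
    rw [hmem, mul_left_comm]
    exact h3
  exact ModularParametrizationData.exists_of_isNewformOf hfC hLC hc hle

/-- **Odd step** (memo g26, M1). `q` an odd prime, `A` globally minimal with an `X₀(N')`-datum `D_A`, `q ∤ N(A)`,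
`(N', q) = 1`, `C` any globally minimal model of `A.quadraticTwist q*`, `N = N' q²`. Then `C` has an `X₀(N)`-datum with
constant `D_A.c` (newform `f_{D_A} ⊗ χ_q`, new at level `N' q²` by Atkin–Li; `aₙ(C) = χ_q(n) aₙ(A)` for all `n`;
`Λ_C = g(χ_q)⁻¹ Λ_A` by Stevens (5.2), `η = 1`). [cite: Stevens1989, Lemmas (5.2), (5.4) pp. 96–97]
[cite: AtkinLi1978, Thm. 3.1] [cite: SilvermanAEC2009, X.2 Exercise 10.16] -/
theorem exists_datum_c_eq_of_quadraticTwist_pStar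
    {q : ℕ} [Fact q.Prime] (hq2 : q ≠ 2)
    {A : WeierstrassCurve ℚ} [A.IsElliptic] [A.IsGloballyMinimal] {N' : ℕ} [NeZero N']
    (DA : ModularParametrizationData A N')
    (hqA : ¬ q ∣ A.conductorNorm ℤ) (hcop : N'.Coprime q)
    {C : WeierstrassCurve ℚ} [C.IsElliptic] [C.IsGloballyMinimal]
    (hCtw : ∃ v : VariableChange ℚ, v • A.quadraticTwist (((-1 : ℤ) ^ (q / 2) * q : ℤ) : ℚ) = C)
    {N : ℕ} [NeZero N] (hNdef : N = N' * q ^ 2) :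
    ∃ D : ModularParametrizationData C N, D.c = DA.c := by
  subst hNdef
  have hq : q.Prime := Fact.out
  haveI : NeZero q := ⟨hq.ne_zero⟩
  set d : ℤ := (-1 : ℤ) ^ (q / 2) * q with hd
  have hdZ : d ≠ 0 := mul_ne_zero (pow_ne_zero _ (by norm_num)) (by exact_mod_cast hq.ne_zero)
  have hd0 : (d : ℚ) ≠ 0 := by exact_mod_cast hdZ
  haveI : (A.quadraticTwist (d : ℚ)).IsElliptic := A.isElliptic_quadraticTwist hd0
  set χ : DirichletCharacter ℂ q := (quadraticChar (ZMod q)).ringHomComp (Int.castRingHom ℂ)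
    with hχdef
  have hχ : χ.IsQuadratic := isQuadratic_quadraticChar_ringHomComp q
  have hprim : χ.IsPrimitive := isPrimitive_quadraticChar_ringHomComp q hq2
  have hG : gaussSum χ (ZMod.stdAddChar (N := q)) ^ 2 = ((d : ℤ) : ℂ) := by
    rw [hχdef, hd]; exact gaussSum_quadraticChar_ringHomComp_sq q hq2
  have hcoef : ∀ n : ℕ, ((C.LFunction n : ℤ) : ℂ) = χ n * ((A.LFunction n : ℤ) : ℂ) := by
    intro n
    obtain ⟨v, hv⟩ := hCtw
    have hLC : C.LFunction = (A.quadraticTwist (d : ℚ)).LFunction := by rw [← hv, LFunction_smul]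
    rw [hLC, hχdef, hd]
    exact BCDT.LFunction_quadraticTwist_pStar_apply_complex_of_not_dvd A hq2 hqA n
  set fC : CuspForm (Gamma0 (N' * q ^ 2)) 2 :=
    charTwist (N' * q ^ 2) (dvd_mul_right N' (q ^ 2)) (dvd_mul_left (q ^ 2) N') hχ DA.f with hfCdef
  have hnew : IsNewform0 fC := isNewform0_charTwist_of_coprime hχ hprim hcop DA.isNewformOf.1
  have hf : ∀ n : ℕ, cuspCoeff fC n = χ n * cuspCoeff DA.f n := fun n ↦
    cuspCoeff_charTwist (N' * q ^ 2) _ _ hχ hprim DA.f n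
  have hfC : IsNewformOf C fC :=
    ⟨hnew, fun n ↦ by rw [hf n, DA.isNewformOf.2 n, hcoef n]⟩
  haveI : (C.baseChange ℂ).IsElliptic := by rw [WeierstrassCurve.baseChange]; infer_instance
  obtain ⟨LC, hLC⟩ := exists_isNeronLatticeOf_holds (C.baseChange ℂ)
  have hsemi : A.HasGoodReductionAtPrime q ∨ A.HasMultiplicativeReductionAtPrime q :=
    hasGoodReductionAtPrime_or_hasMultiplicativeReductionAtPrime_of_not_sq_dvd_conductorNorm
      fun h ↦ hqA ((dvd_pow_self q two_ne_zero).trans h)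
  have hmem : ∀ z : ℂ, z ∈ LC.lattice ↔ gaussSum χ (ZMod.stdAddChar (N := q)) * z ∈ DA.L.lattice :=
    stevens1989_neronLattice_quadraticTwist_oddPrime_holds A DA.L DA.isNeronLattice q hq2 hsemi C
      hCtw LC hLC _ hG
  obtain ⟨D, -, -, hc⟩ := exists_datum_c_eq_of_charTwist DA hχ hprim (dvd_mul_right N' (q ^ 2))
    (dvd_mul_left (q ^ 2) N') hfC hf hLC hmem
  exact ⟨D, hc⟩

/-- **Odd step at the conductor level** (memo g26, M3; the binder shape of D(a),
`ModularParametrizationData C (C.conductorNorm ℤ)`), modulo the modularity binder `hnf` only (used through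
`IsNewformOf.level_eq_conductorNorm_of_exists_isNewformOf` to identify `N' q²` with `N(C)`).
[cite: Stevens1989, Lemmas (5.2), (5.4)] [cite: DiamondShurman2005, Thm. 8.8.1] -/
theorem exists_datum_conductorLevel_c_eq_of_quadraticTwist_pStar (hnf : exists_isNewformOf)
    {q : ℕ} [Fact q.Prime] (hq2 : q ≠ 2)
    {A : WeierstrassCurve ℚ} [A.IsElliptic] [A.IsGloballyMinimal] {N' : ℕ} [NeZero N']
    (DA : ModularParametrizationData A N')
    (hqA : ¬ q ∣ A.conductorNorm ℤ) (hcop : N'.Coprime q)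
    {C : WeierstrassCurve ℚ} [C.IsElliptic] [C.IsGloballyMinimal] [NeZero (C.conductorNorm ℤ)]
    (hCtw : ∃ v : VariableChange ℚ, v • A.quadraticTwist (((-1 : ℤ) ^ (q / 2) * q : ℤ) : ℚ) = C) :
    (∃ D : ModularParametrizationData C (C.conductorNorm ℤ), D.c = DA.c) ∧
      C.conductorNorm ℤ = N' * q ^ 2 := by
  have hq : q.Prime := Fact.out
  haveI : NeZero q := ⟨hq.ne_zero⟩
  haveI : NeZero (N' * q ^ 2) := ⟨mul_ne_zero (NeZero.ne N') (pow_ne_zero _ hq.ne_zero)⟩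
  obtain ⟨D₁, -⟩ := exists_datum_c_eq_of_quadraticTwist_pStar hq2 DA hqA hcop hCtw
    (N := N' * q ^ 2) rfl
  have hlev : N' * q ^ 2 = C.conductorNorm ℤ :=
    IsNewformOf.level_eq_conductorNorm_of_exists_isNewformOf hnf D₁.isNewformOf
  exact ⟨exists_datum_c_eq_of_quadraticTwist_pStar hq2 DA hqA hcop hCtw hlev.symm, hlev.symm⟩

/-- **Isogeny step** (memo g26, M5). `D_W` an `X₀(N)`-datum of `W`; `W'` elliptic with a Néron-type pair `Λ'` and an
integer `a ≠ 0` with `a Λ_W ⊆ Λ'` (an isogeny `W → W'` over `ℚ` with pull-back scalar `a`, tree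
`isIsogenous_iff_exists_int_mul_mem_lattice`). Then `W'` has an `X₀(N)`-datum with newform `f_{D_W}`, lattice `Λ'`
and constant `D_W.c · a`. [cite: SilvermanAEC2009, Thm. VI.4.1 (b), Cor. III.6.1] [cite: Knapp1993, Thm. 11.67]
[cite: CremonaAlgorithms1997, §2.10] -/
theorem exists_datum_c_eq_mul_of_int_mul_mem_lattice
    {W : WeierstrassCurve ℚ} [W.IsElliptic] {N : ℕ} [NeZero N] (DW : ModularParametrizationData W N)
    {W' : WeierstrassCurve ℚ} [W'.IsElliptic] {L' : PeriodPair}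
    (hL' : IsNeronLatticeOf (W'.baseChange ℂ) L') {a : ℤ} (ha : a ≠ 0)
    (hle : ∀ z ∈ DW.L.lattice, (a : ℂ) * z ∈ L'.lattice) :
    ∃ D : ModularParametrizationData W' N, D.f = DW.f ∧ D.L = L' ∧ D.c = DW.c * a := by
  have hiso : WeierstrassCurve.IsIsogenous W W' :=
    (isIsogenous_iff_exists_int_mul_mem_lattice DW.isNeronLattice hL').mpr ⟨a, ha, hle⟩
  have hf : IsNewformOf W' DW.f := DW.isNewformOf.of_isIsogenous hiso.symm_of_charZero
  have hc : DW.c * a ≠ 0 := mul_ne_zero DW.maninConstant_ne_zero_holds ha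
  refine ModularParametrizationData.exists_of_isNewformOf hf hL' hc fun z hz ↦ ?_
  rw [Int.cast_mul, mul_comm (DW.c : ℂ), mul_assoc]
  exact hle _ (DW.smul_periodLattice_le z hz)

/-! ### §17.2 Transfer along a `ℚ`-isomorphism of globally minimal models, and the composition law -/

/-- Two globally minimal models of one curve differ by `u = ±1` (Silverman VII.1.3(b)), so they have the same `c₄`,
`c₆` (hence the same Néron pairs) and the same `aₙ`: an `X₀(N₀)`-datum of one is an `X₀(N)`-datum of the other,
`N = N₀`, with the same constant. [cite: SilvermanAEC2009, VII.1.3(b) and VIII.8.3] [cite: CremonaAlgorithms1997, §2.10] -/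
theorem exists_datum_c_eq_of_smul_eq
    {E C : WeierstrassCurve ℚ} [E.IsElliptic] [E.IsGloballyMinimal] [C.IsElliptic] [C.IsGloballyMinimal]
    {v : VariableChange ℚ} (hv : v • E = C) {N₀ : ℕ} [NeZero N₀] (D₀ : ModularParametrizationData E N₀)
    {N : ℕ} [NeZero N] (hN : N = N₀) : ∃ D : ModularParametrizationData C N, D.c = D₀.c := by
  subst hN
  haveI : (v • E).IsGloballyMinimal := by rw [hv]; infer_instance
  have hu : v.u = 1 ∨ v.u = -1 := (isGloballyMinimal_unique_holds E v).1
  have hu4 : ((v.u⁻¹ : ℚˣ) : ℚ) ^ 4 = 1 := by rcases hu with h | h <;> norm_num [h]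
  have hu6 : ((v.u⁻¹ : ℚˣ) : ℚ) ^ 6 = 1 := by rcases hu with h | h <;> norm_num [h]
  have hc4 : C.c₄ = E.c₄ := by rw [← hv, variableChange_c₄, hu4, one_mul]
  have hc6 : C.c₆ = E.c₆ := by rw [← hv, variableChange_c₆, hu6, one_mul]
  have hL : IsNeronLatticeOf (C.baseChange ℂ) D₀.L := by
    obtain ⟨h2, h3⟩ := D₀.isNeronLattice
    refine ⟨?_, ?_⟩
    · rw [h2]; simp only [WeierstrassCurve.baseChange, map_c₄, hc4]
    · rw [h3]; simp only [WeierstrassCurve.baseChange, map_c₆, hc6]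
  have hf : IsNewformOf C D₀.f :=
    ⟨D₀.isNewformOf.1, fun n ↦ by rw [D₀.isNewformOf.2 n, ← hv, LFunction_smul]⟩
  obtain ⟨D, -, -, hc⟩ := ModularParametrizationData.exists_of_isNewformOf hf hL
    D₀.maninConstant_ne_zero_holds D₀.smul_periodLattice_le
  exact ⟨D, hc⟩

/-- The composition law of quadratic twists under a variable change: a model of `E₀ ⊗ χ_{ba}` is a model of
`(v • E₀ ⊗ χ_a) ⊗ χ_b` (tree: `quadraticTwist_smul`, `quadraticTwist_quadraticTwist`). [cite: SilvermanAEC2009, X.2 Ex. 10.16] -/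
theorem exists_smul_twist_twist (E₀ : WeierstrassCurve ℚ) (CA v : VariableChange ℚ) (a b : ℚ)
    {C : WeierstrassCurve ℚ} (hv : v • E₀.quadraticTwist (b * a) = C) :
    ∃ w : VariableChange ℚ, w • (CA • E₀.quadraticTwist a).quadraticTwist b = C := by
  refine ⟨v * (⟨CA.u, b * CA.r, 0, 0⟩ : VariableChange ℚ)⁻¹, ?_⟩
  rw [WeierstrassCurve.quadraticTwist_smul, mul_smul, inv_smul_smul, quadraticTwist_quadraticTwist,
    mul_comm a b]
  exact hv

/-! ### §17.3 The two type-III base curves of conductor `49`: `49a1 = cm7` and `49a2` -/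

/-- `49a2 = [1, −1, 0, −37, −78]` (LMFDB `49.a3`): the second type-III member of the isogeny class of `X₀(49)`,
`j = 16581375 = 255³` (CM by the order of conductor `2` in `ℚ(√−7)`), `Δ = 7³`, `2`-isogenous to `49a1`.
[cite: CremonaAlgorithms1997, Table 1 (N = 49)] -/
abbrev cm7b : WeierstrassCurve ℚ := ⟨1, -1, 0, -37, -78⟩

/-- `Δ(49a2) = 7³ ≠ 0`. [cite: CremonaAlgorithms1997, Table 1 (N = 49)] -/
theorem isElliptic_cm7b : cm7b.IsElliptic :=
  Summit.BirchSwinnertonDyer.Rank1Residual.X11b.isElliptic_of_discOf_ne_zero 1 (-1) 0 (-37) (-78)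
    (by decide +kernel)

/-- `[1, −1, 0, −37, −78]` is a global minimal equation (no prime has `q¹² ∣ Δ = 343`).
[cite: SilvermanAEC2009, VII.1 Remark 1.1] [cite: CremonaAlgorithms1997, Table 1 (N = 49)] -/
theorem isGloballyMinimal_cm7b : cm7b.IsGloballyMinimal :=
  Literature.NumberTheory.EllipticCurves.Rank1Residual.X11RankOneCertificates.isGloballyMinimal_of_int_criterion
    1 (-1) 0 (-37) (-78) fun q hq ⟨hΔ, _⟩ ↦ by
      have hD : Literature.NumberTheory.EllipticCurves.Rank1Residual.X11RankOneCertificates.discOf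
          [1, -1, 0, -37, -78] = 343 := by decide +kernel
      rw [hD] at hΔ
      have h1 : q ^ 12 ∣ 343 := by exact_mod_cast Int.natAbs_dvd_natAbs.mpr hΔ
      have h2 : q ^ 12 ≤ 343 := Nat.le_of_dvd (by norm_num) h1
      have h3 : 2 ^ 12 ≤ q ^ 12 := Nat.pow_le_pow_left hq.two_le 12
      omega

/-- `c₄(49a1) = 105`. [cite: CremonaAlgorithms1997, Table 1 (N = 49)] -/
theorem c₄_cm7 : cm7.c₄ = 105 := by
  norm_num [cm7, WeierstrassCurve.c₄, WeierstrassCurve.b₂, WeierstrassCurve.b₄]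

/-- `c₆(49a1) = 1323`. [cite: CremonaAlgorithms1997, Table 1 (N = 49)] -/
theorem c₆_cm7 : cm7.c₆ = 1323 := by
  norm_num [cm7, WeierstrassCurve.c₆, WeierstrassCurve.b₂, WeierstrassCurve.b₄, WeierstrassCurve.b₆]

/-- `c₄(49a2) = 1785`. [cite: CremonaAlgorithms1997, Table 1 (N = 49)] -/
theorem c₄_cm7b : cm7b.c₄ = 1785 := by
  norm_num [cm7b, WeierstrassCurve.c₄, WeierstrassCurve.b₂, WeierstrassCurve.b₄]

/-- `c₆(49a2) = 75411`. [cite: CremonaAlgorithms1997, Table 1 (N = 49)] -/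
theorem c₆_cm7b : cm7b.c₆ = 75411 := by
  norm_num [cm7b, WeierstrassCurve.c₆, WeierstrassCurve.b₂, WeierstrassCurve.b₄, WeierstrassCurve.b₆]

/-- `Δ(49a2) = 7³`. [cite: CremonaAlgorithms1997, Table 1 (N = 49)] -/
theorem Δ_cm7b : cm7b.Δ = 7 ^ 3 := by
  norm_num [cm7b, WeierstrassCurve.Δ, WeierstrassCurve.b₂, WeierstrassCurve.b₄, WeierstrassCurve.b₆,
    WeierstrassCurve.b₈]

/-- `j(49a2) = 16581375 = 255³`. [cite: CremonaAlgorithms1997, Table 1 (N = 49)] [cite: SilvermanATAEC1994, App. A §3] -/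
theorem j_cm7b : @WeierstrassCurve.j ℚ _ cm7b isElliptic_cm7b = 16581375 := by
  rw [@j_eq_c₄_pow_div _ isElliptic_cm7b, c₄_cm7b, Δ_cm7b]; norm_num

/-- `49a2` has good reduction at `2` (`2 ∤ Δ_min = 7³`). [cite: CremonaAlgorithms1997, Table 1 (N = 49)] -/
theorem hasGoodReductionAtPrime_cm7b_two : haveI := isElliptic_cm7b; cm7b.HasGoodReductionAtPrime 2 := by
  haveI := isElliptic_cm7b
  haveI := isGloballyMinimal_cm7b
  refine hasGoodReductionAtPrime_of_not_dvd cm7b 2 ?_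
  have h : (cm7b.minimalDiscriminantInt : ℚ) = 7 ^ 3 := by rw [cast_minimalDiscriminantInt, Δ_cm7b]
  have h' : cm7b.minimalDiscriminantInt = 7 ^ 3 := by exact_mod_cast h
  rw [h']
  decide

/-- `ord₇ Δ(49a1) = 3`. [cite: CremonaAlgorithms1997, Table 1 (N = 49)] -/
theorem padicValRat_seven_Δ_cm7 : padicValRat 7 cm7.Δ = 3 := by
  haveI : Fact (Nat.Prime 7) := ⟨by norm_num⟩
  have h7 : padicValRat 7 (7 : ℚ) = 1 := by
    have h := padicValRat.self (p := 7) (by norm_num)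
    simpa using h
  rw [Δ_cm7, padicValRat.neg, padicValRat.pow (7 : ℚ), h7]
  norm_num

/-- `ord₇ Δ(49a2) = 3`. [cite: CremonaAlgorithms1997, Table 1 (N = 49)] -/
theorem padicValRat_seven_Δ_cm7b : padicValRat 7 cm7b.Δ = 3 := by
  haveI : Fact (Nat.Prime 7) := ⟨by norm_num⟩
  have h7 : padicValRat 7 (7 : ℚ) = 1 := by
    have h := padicValRat.self (p := 7) (by norm_num)
    simpa using h
  rw [Δ_cm7b, padicValRat.pow (7 : ℚ), h7]
  norm_num

/-- The prime support of `N(49a1) = 49` is `{7}`. [cite: CremonaAlgorithms1997, Table 1 (N = 49)] -/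
theorem eq_seven_of_dvd_conductorNorm_cm7 (q : ℕ) (hq : q.Prime) (h : q ∣ cm7.conductorNorm ℤ) : q = 7 := by
  rw [Theorems.GoldfeldGoodTwists.conductorNorm_cm7, show (49 : ℕ) = 7 ^ 2 by norm_num] at h
  exact (Nat.prime_dvd_prime_iff_eq hq (by norm_num)).mp (hq.dvd_of_dvd_pow h)

/-- **Base data.** From the `49a1` certificate: an `X₀(N(49a1))`-datum of `49a1` with `7 ∤ c`, and — by the
isogeny step with pull-back scalar `a = 1` along the `2`-isogeny `49a1 → 49a2` (Vélu: `Λ(49a1) ⊆ Λ(49a2)` for the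
Néron pairs) — an `X₀(N(49a1))`-datum of `49a2` with the same constant; `N(49a2) = N(49a1)` by modularity `hnf`.
[cite: AgasheRibetStein2006, Thm. 2.6] [cite: CremonaAlgorithms1997, §2.10 and Table 1 (N = 49)]
[cite: SilvermanAEC2009, Thm. VI.4.1 (b)] -/
theorem exists_base_data (hnf : exists_isNewformOf) (hM : OptimalCurveManinCertificate cm7) :
    ∃ (_ : NeZero (cm7.conductorNorm ℤ)) (D₀ : ModularParametrizationData cm7 (cm7.conductorNorm ℤ))
      (D₀' : ModularParametrizationData cm7b (cm7.conductorNorm ℤ)),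
      ¬ (7 : ℤ) ∣ D₀.c ∧ ¬ (7 : ℤ) ∣ D₀'.c ∧ cm7b.conductorNorm ℤ = cm7.conductorNorm ℤ := by
  haveI := isElliptic_cm7b
  haveI := isGloballyMinimal_cm7b
  obtain ⟨hN7, D₀, -, -, hp⟩ := hM.exists_optimalDatum_abs_maninConstant_eq_one
  have h7c : ¬ (7 : ℤ) ∣ D₀.c := by
    simpa [ModularParametrizationData.maninConstant] using hp 7 (by norm_num)
  -- Vélu: the Néron pair of `49a1` is contained in the Néron pair of `49a2`
  haveI : (cm7b.baseChange ℂ).IsElliptic := by rw [WeierstrassCurve.baseChange]; infer_instance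
  obtain ⟨L', hL'⟩ := exists_isNeronLatticeOf_holds (cm7b.baseChange ℂ)
  have hle : D₀.L.lattice ≤ L'.lattice := by
    obtain ⟨h2, h3⟩ := D₀.isNeronLattice
    obtain ⟨h2', h3'⟩ := hL'
    simp only [WeierstrassCurve.baseChange, map_c₄, map_c₆, c₄_cm7, c₆_cm7, c₄_cm7b, c₆_cm7b, map_ofNat]
      at h2 h3 h2' h3'
    exact Summit.BirchSwinnertonDyer.Rank1Residual.ManinAdditive.KatoCurve.CMTwinMinimal.lattice_le_of_velu_two_kleinian
      D₀.L L' (one_ne_zero (α := ℂ)) (by rw [h2]; norm_num) (by rw [h3]; norm_num) (by rw [h2']; norm_num)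
      (by rw [h3']; norm_num)
  obtain ⟨D', -, -, hc'⟩ := exists_datum_c_eq_mul_of_int_mul_mem_lattice D₀ hL' (one_ne_zero (α := ℤ))
    (fun z hz ↦ by rw [Int.cast_one, one_mul]; exact hle hz)
  have hlev : cm7.conductorNorm ℤ = cm7b.conductorNorm ℤ :=
    IsNewformOf.level_eq_conductorNorm_of_exists_isNewformOf hnf D'.isNewformOf
  exact ⟨hN7, D₀, D', h7c, by rw [hc', mul_one]; exact h7c, hlev.symm⟩

/-! ### §17.4 THEOREM M as a family induction over the prime discriminants -/

/-- `q* = (−1)^{(q−1)/2} q ≠ 0`. [folklore] -/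
theorem pStar_ne_zero {q : ℕ} (hq : q.Prime) : ((-1 : ℤ) ^ (q / 2) * q : ℤ) ≠ 0 :=
  mul_ne_zero (pow_ne_zero _ (by norm_num)) (by exact_mod_cast hq.ne_zero)

/-- **THEOREM M (memo g26) as a family induction.** `E₀` globally minimal with an `X₀(N₀)`-datum `D₀`, `7 ∤ c(D₀)`,
`N₀` supported at `7` only (so `N₀ = N(E₀)` by modularity, used through `hnf` in the base case); `S` a finite set of odd primes `≠ 7`, `d_S = ∏_{q∈S} q*`. Then EVERY globally minimal
model `C` of `E₀ ⊗ χ_{d_S}` carries an `X₀(N(C))`-datum with `7 ∤ c`, and `N(C) = N₀ ∏_{q∈S} q²`. Induction on `S`: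
base = transfer along an isomorphism of minimal models (§17.2); step = the odd step (§17.1) at `q ∉ S ∖ q`,
`q ∤ N₀ ∏ q'²`, applied to a globally minimal model of `E₀ ⊗ χ_{d_{S∖q}}` through the composition law.
[cite: Stevens1989, Lemmas (5.2), (5.4) pp. 96–97] [cite: AtkinLi1978, Thm. 3.1] [cite: CremonaAlgorithms1997, §2.10] -/
theorem exists_datum_of_twistChain (hnf : exists_isNewformOf)
    {E₀ : WeierstrassCurve ℚ} [E₀.IsElliptic] [E₀.IsGloballyMinimal] {N₀ : ℕ} [NeZero N₀]
    (D₀ : ModularParametrizationData E₀ N₀) (h7 : ¬ (7 : ℤ) ∣ D₀.c)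
    (hsupp : ∀ q : ℕ, q.Prime → q ∣ N₀ → q = 7)
    (S : Finset ℕ) (hS : ∀ q ∈ S, q.Prime ∧ q ≠ 2 ∧ q ≠ 7)
    (C : WeierstrassCurve ℚ) [C.IsElliptic] [C.IsGloballyMinimal] [NeZero (C.conductorNorm ℤ)]
    (hC : ∃ v : VariableChange ℚ,
      v • E₀.quadraticTwist ((∏ q ∈ S, ((-1 : ℤ) ^ (q / 2) * q : ℤ) : ℤ) : ℚ) = C) :
    (∃ D : ModularParametrizationData C (C.conductorNorm ℤ), ¬ (7 : ℤ) ∣ D.c) ∧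
      C.conductorNorm ℤ = N₀ * ∏ q ∈ S, q ^ 2 := by
  induction S using Finset.induction_on generalizing C with
  | empty =>
    obtain ⟨v, hv⟩ := hC
    rw [Finset.prod_empty, Int.cast_one] at hv
    obtain ⟨C₁, hC₁⟩ := exists_variableChange_quadraticTwist_one E₀
    have hvC : (v * C₁) • E₀ = C := by rw [mul_smul, hC₁, hv]
    obtain ⟨D₁, -⟩ := exists_datum_c_eq_of_smul_eq hvC D₀ (N := N₀) rfl
    have hlev : N₀ = C.conductorNorm ℤ :=
      IsNewformOf.level_eq_conductorNorm_of_exists_isNewformOf hnf D₁.isNewformOf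
    obtain ⟨D, hD⟩ := exists_datum_c_eq_of_smul_eq hvC D₀ (N := C.conductorNorm ℤ) hlev.symm
    exact ⟨⟨D, by rw [hD]; exact h7⟩, by rw [Finset.prod_empty, mul_one]; exact hlev.symm⟩
  | insert q S hqS ih =>
    have hq := hS q (Finset.mem_insert_self q S)
    have hS' : ∀ q' ∈ S, q'.Prime ∧ q' ≠ 2 ∧ q' ≠ 7 := fun q' hq' ↦ hS q' (Finset.mem_insert_of_mem hq')
    haveI : Fact q.Prime := ⟨hq.1⟩
    -- a globally minimal model `A` of `E₀ ⊗ χ_{d_S}`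
    have hdS : ((∏ q' ∈ S, ((-1 : ℤ) ^ (q' / 2) * q' : ℤ) : ℤ) : ℚ) ≠ 0 := by
      exact_mod_cast Finset.prod_ne_zero_iff.mpr fun q' hq' ↦ pStar_ne_zero (hS' q' hq').1
    haveI := E₀.isElliptic_quadraticTwist hdS
    obtain ⟨CA, hCA⟩ := hasGlobalMinimalModel_rat_holds
      (E₀.quadraticTwist ((∏ q' ∈ S, ((-1 : ℤ) ^ (q' / 2) * q' : ℤ) : ℤ) : ℚ))
    haveI := hCA
    haveI : NeZero ((CA • E₀.quadraticTwist
        ((∏ q' ∈ S, ((-1 : ℤ) ^ (q' / 2) * q' : ℤ) : ℤ) : ℚ)).conductorNorm ℤ) :=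
      ⟨(conductorNorm_pos_holds _).ne'⟩
    obtain ⟨⟨DA, h7A⟩, hNA⟩ := ih hS' (CA • E₀.quadraticTwist _) ⟨CA, rfl⟩
    -- `q ∤ N(A) = N₀ ∏_{S} q'²`
    have hqA : ¬ q ∣ (CA • E₀.quadraticTwist
        ((∏ q' ∈ S, ((-1 : ℤ) ^ (q' / 2) * q' : ℤ) : ℤ) : ℚ)).conductorNorm ℤ := by
      rw [hNA]
      intro h
      rcases (Nat.Prime.dvd_mul hq.1).mp h with h0 | hP
      · exact hq.2.2 (hsupp q hq.1 h0)
      · obtain ⟨q', hq'S, hqq'⟩ := (Prime.dvd_finsetProd_iff hq.1.prime _).mp hP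
        have hqq : q = q' :=
          (Nat.prime_dvd_prime_iff_eq hq.1 (hS' q' hq'S).1).mp (hq.1.dvd_of_dvd_pow hqq')
        exact hqS (hqq ▸ hq'S)
    have hcop : ((CA • E₀.quadraticTwist
        ((∏ q' ∈ S, ((-1 : ℤ) ^ (q' / 2) * q' : ℤ) : ℤ) : ℚ)).conductorNorm ℤ).Coprime q :=
      ((Nat.Prime.coprime_iff_not_dvd hq.1).mpr hqA).symm
    -- `A ⊗ χ_{q*} ≅ C` by the composition law
    have hCtw : ∃ w : VariableChange ℚ, w • (CA • E₀.quadraticTwist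
        ((∏ q' ∈ S, ((-1 : ℤ) ^ (q' / 2) * q' : ℤ) : ℤ) : ℚ)).quadraticTwist
          (((-1 : ℤ) ^ (q / 2) * q : ℤ) : ℚ) = C := by
      obtain ⟨v, hv⟩ := hC
      rw [Finset.prod_insert hqS, Int.cast_mul] at hv
      exact exists_smul_twist_twist E₀ CA v _ _ hv
    obtain ⟨⟨D, hD⟩, hlev⟩ :=
      exists_datum_conductorLevel_c_eq_of_quadraticTwist_pStar hnf hq.2.1 DA hqA hcop hCtw
    refine ⟨⟨D, by rw [hD]; exact h7A⟩, ?_⟩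
    rw [hlev, hNA, Finset.prod_insert hqS]
    ring

/-! ### §17.5 Type-III members of `𝒞₇` are minimal models of `49a1 ⊗ χ_d`, `49a2 ⊗ χ_d`, `d ≡ 1 (4)`, `7 ∤ d` -/

/-- A curve with the `j`-invariant of `E` (`j ∉ {0, 1728}`), with `ord₇ Δ = 3 = ord₇ Δ(E)`, good at `2` like `E`, is
a `ℚ`-model of `E ⊗ χ_d` with `d` squarefree, `d ≡ 1 (mod 4)` and `7 ∤ d`. [cite: SilvermanAEC2009, X.5 Prop. 5.4]
[cite: SilvermanAEC2009, VII.5 Prop. 5.1] -/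
theorem exists_twist_presentation {E W : WeierstrassCurve ℚ} [E.IsElliptic] [W.IsElliptic]
    (hj : W.j = E.j) (h0 : E.j ≠ 0) (h1728 : E.j ≠ 1728)
    (hE : padicValRat 7 E.Δ = 3) (hW : padicValRat 7 W.Δ = 3)
    (hE2 : E.HasGoodReductionAtPrime 2) (hW2 : W.HasGoodReductionAtPrime 2) :
    ∃ d : ℤ, Squarefree d ∧ d % 4 = 1 ∧ ¬ (7 : ℤ) ∣ d ∧
      ∃ v : VariableChange ℚ, v • E.quadraticTwist (d : ℚ) = W := by
  haveI : Fact (Nat.Prime 7) := ⟨by norm_num⟩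
  obtain ⟨d, hd0, hsq, C, hCW⟩ := exists_variableChange_eq_quadraticTwist_intCast_of_j_eq hj h0 h1728
  have hv : C⁻¹ • E.quadraticTwist (d : ℚ) = W := by rw [← hCW, inv_smul_smul]
  refine ⟨d, hsq, ?_, ?_, C⁻¹, hv⟩
  · exact Theorems.FlatTwist.Family.emod_four_eq_one_of_hasGoodReductionAtPrime_two E hsq hv hE2 hW2
  · have hd0' : (d : ℚ) ≠ 0 := by exact_mod_cast hd0
    have hu0 : ((C⁻¹.u⁻¹ : ℚˣ) : ℚ) ≠ 0 := Units.ne_zero _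
    have hEΔ : E.Δ ≠ 0 := E.isUnit_Δ.ne_zero
    have hΔ : W.Δ = ((C⁻¹.u⁻¹ : ℚˣ) : ℚ) ^ 12 * ((d : ℚ) ^ 6 * E.Δ) := by
      rw [← hv, variableChange_Δ, quadraticTwist_Δ]
    have hval := congrArg (padicValRat 7) hΔ
    rw [hW, padicValRat.mul (pow_ne_zero _ hu0) (mul_ne_zero (pow_ne_zero _ hd0') hEΔ),
      padicValRat.pow ((C⁻¹.u⁻¹ : ℚˣ) : ℚ), padicValRat.mul (pow_ne_zero _ hd0') hEΔ, padicValRat.pow (d : ℚ), hE,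
      padicValRat.of_int] at hval
    intro h7
    have h1 : 1 ≤ padicValInt 7 d :=
      ((padicValInt_dvd_iff 1 d).mp (by simpa using h7)).resolve_left hd0
    have h2 : padicValInt 7 d < 2 := by
      by_contra hle
      have h49 : (7 : ℤ) ^ 2 ∣ d := (padicValInt_dvd_iff 2 d).mpr (Or.inr (not_lt.mp hle))
      have hunit : IsUnit (7 : ℤ) := hsq 7 (by rw [← sq]; exact_mod_cast h49)
      rcases Int.isUnit_iff.mp hunit with h | h <;> norm_num at h
    push_cast at hval
    omega

/-- **Classification of the type-III members of `𝒞₇`.** `W` is a `ℚ`-model of `49a1 ⊗ χ_d` or of `49a2 ⊗ χ_d`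
with `d` squarefree, `d ≡ 1 (mod 4)`, `7 ∤ d`. [cite: SilvermanATAEC1994, App. A §3] [cite: SilvermanAEC2009, X.5 Prop. 5.4] -/
theorem exists_twist_presentation_of_classCSeven (W : WeierstrassCurve ℚ) [W.IsElliptic] [W.IsGloballyMinimal]
    (hC : ClassCSeven W) (h3 : padicValRat 7 W.Δ = 3) :
    ∃ d : ℤ, Squarefree d ∧ d % 4 = 1 ∧ ¬ (7 : ℤ) ∣ d ∧
      ((∃ v : VariableChange ℚ, v • cm7.quadraticTwist (d : ℚ) = W) ∨
        ∃ v : VariableChange ℚ, v • cm7b.quadraticTwist (d : ℚ) = W) := by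
  have hj : W.j ∈ cmJInvariants := (hasCM_iff_j_mem_holds W).mp hC.1
  have hdisc := hC.2.1
  have hW2 : W.HasGoodReductionAtPrime 2 := hC.2.2.2.1.1
  simp only [cmJInvariants, Finset.mem_insert, Finset.mem_singleton] at hj
  have hj' : W.j = -3375 ∨ W.j = 16581375 := by
    revert hdisc
    rcases hj with h | h | h | h | h | h | h | h | h | h | h | h | h <;> rw [h] <;>
      norm_num [Literature.NumberTheory.EllipticCurves.Rank1Residual.cmFieldDiscrOfJ]
  haveI := isElliptic_cm7b
  rcases hj' with h | h
  · obtain ⟨d, hsq, hd4, h7d, v, hv⟩ := exists_twist_presentation (E := cm7) (W := W)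
      (by rw [h, j_cm7]) (by rw [j_cm7]; norm_num) (by rw [j_cm7]; norm_num) padicValRat_seven_Δ_cm7 h3
      Theorems.GoldfeldGoodTwists.hasGoodReductionAtPrime_cm7_two hW2
    exact ⟨d, hsq, hd4, h7d, Or.inl ⟨v, hv⟩⟩
  · obtain ⟨d, hsq, hd4, h7d, v, hv⟩ := exists_twist_presentation (E := cm7b) (W := W)
      (by rw [h, j_cm7b]) (by rw [j_cm7b]; norm_num) (by rw [j_cm7b]; norm_num) padicValRat_seven_Δ_cm7b h3
      hasGoodReductionAtPrime_cm7b_two hW2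
    exact ⟨d, hsq, hd4, h7d, Or.inr ⟨v, hv⟩⟩

/-! ### §17.6 `d = ∏_{q ∣ d} q*` for squarefree `d ≡ 1 (mod 4)` -/

/-- `q* ≡ 1 (mod 4)` for an odd prime `q`. [folklore] -/
theorem pStar_emod_four {q : ℕ} (hq : q.Prime) (hq2 : q ≠ 2) : ((-1 : ℤ) ^ (q / 2) * q : ℤ) % 4 = 1 := by
  have hodd : q % 2 = 1 := Nat.odd_iff.mp (hq.odd_of_ne_two hq2)
  rcases Nat.even_or_odd (q / 2) with he | ho
  · obtain ⟨k, hk⟩ := he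
    rw [Even.neg_one_pow ⟨k, hk⟩]
    omega
  · obtain ⟨k, hk⟩ := ho
    rw [Odd.neg_one_pow ⟨k, hk⟩]
    omega

/-- A product of prime discriminants `q*` (`q` odd) is `≡ 1 (mod 4)`. [folklore] -/
theorem prod_pStar_emod_four (S : Finset ℕ) (hS : ∀ q ∈ S, q.Prime ∧ q ≠ 2) :
    (∏ q ∈ S, ((-1 : ℤ) ^ (q / 2) * q : ℤ)) % 4 = 1 := by
  induction S using Finset.induction_on with
  | empty => simp
  | insert q S hqS ih =>
    have hq := hS q (Finset.mem_insert_self q S)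
    rw [Finset.prod_insert hqS, Int.mul_emod, pStar_emod_four hq.1 hq.2,
      ih fun q' hq' ↦ hS q' (Finset.mem_insert_of_mem hq')]
    norm_num

/-- **Prime-discriminant factorisation.** A squarefree `d ≡ 1 (mod 4)` is the product of the prime discriminants
`q* = (−1)^{(q−1)/2} q` over its prime divisors. [folklore] -/
theorem prod_primeFactors_pStar {d : ℤ} (hsq : Squarefree d) (hd4 : d % 4 = 1) :
    (∏ q ∈ d.natAbs.primeFactors, ((-1 : ℤ) ^ (q / 2) * q : ℤ)) = d := by
  have hodd : ∀ q ∈ d.natAbs.primeFactors, q.Prime ∧ q ≠ 2 := by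
    intro q hq
    have hq' := Nat.mem_primeFactors.mp hq
    refine ⟨hq'.1, ?_⟩
    rintro rfl
    have h2 : (2 : ℤ) ∣ d := Int.ofNat_dvd_left.mpr hq'.2.1
    omega
  have habs : |∏ q ∈ d.natAbs.primeFactors, ((-1 : ℤ) ^ (q / 2) * q : ℤ)| = |d| := by
    rw [Finset.abs_prod]
    have hfac : ∀ q ∈ d.natAbs.primeFactors, |((-1 : ℤ) ^ (q / 2) * q : ℤ)| = (q : ℤ) := fun q _ ↦ by
      rw [abs_mul, abs_pow, abs_neg, abs_one, one_pow, one_mul, Nat.abs_cast]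
    rw [Finset.prod_congr rfl hfac, ← Nat.cast_prod,
      Nat.prod_primeFactors_of_squarefree (Int.squarefree_natAbs.mpr hsq), Int.natCast_natAbs]
  have hmod := prod_pStar_emod_four _ hodd
  rcases abs_eq_abs.mp habs with h | h
  · exact h
  · rw [h] at hmod
    omega

/-! ### §17.7 Leaf D(a), and the composite K7r ⟸ A ∧ B♭ -/

/-- **LEAF D(a) PROVED (granted `hM` and `hnf` by name).** At every type-III member `W` of `𝒞₇` there is a modular
parametrisation datum at level `N(W)` whose constant is prime to `7`: `W` is a globally minimal model of `E₀ ⊗ χ_d`,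
`E₀ ∈ {49a1, 49a2}`, `d = ∏ q*` over odd primes `q ≠ 7` (§17.5–6), and the family induction §17.4 from the base data
§17.3 applies. [cite: Stevens1989, Lemmas (5.2), (5.4) pp. 96–97] [cite: AtkinLi1978, Thm. 3.1]
[cite: CremonaAlgorithms1997, §2.10 and Table 1 (N = 49)] [cite: AgasheRibetStein2006, Thm. 2.6] -/
theorem descentManinDatumSeven_of_maninCertificate (hnf : exists_isNewformOf)
    (hM : OptimalCurveManinCertificate cm7) : DescentManinDatumSeven := by
  intro W _ _ _ hC h3
  haveI := isElliptic_cm7b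
  haveI := isGloballyMinimal_cm7b
  obtain ⟨hN7, D₀, D₀', h7c, h7c', -⟩ := exists_base_data hnf hM
  obtain ⟨d, hsq, hd4, h7d, hvw⟩ := exists_twist_presentation_of_classCSeven W hC h3
  have hS : ∀ q ∈ d.natAbs.primeFactors, q.Prime ∧ q ≠ 2 ∧ q ≠ 7 := by
    intro q hq
    have hq' := Nat.mem_primeFactors.mp hq
    have hdvd : (q : ℤ) ∣ d := Int.ofNat_dvd_left.mpr hq'.2.1
    refine ⟨hq'.1, ?_, ?_⟩
    · rintro rfl; omega
    · rintro rfl; exact h7d (by exact_mod_cast hdvd)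
  have hprod := prod_primeFactors_pStar hsq hd4
  rcases hvw with ⟨v, hv⟩ | ⟨v, hv⟩
  · exact (exists_datum_of_twistChain hnf D₀ h7c eq_seven_of_dvd_conductorNorm_cm7 _ hS W
      ⟨v, by rw [hprod]; exact hv⟩).1
  · exact (exists_datum_of_twistChain hnf D₀' h7c' eq_seven_of_dvd_conductorNorm_cm7 _ hS W
      ⟨v, by rw [hprod]; exact hv⟩).1

end DescentManin

/-- **REV 7 COMPOSITE — K7r from A and B♭** (plus the eleven named facts of §14 and Cremona's row `N = 49`,
`hM : OptimalCurveManinCertificate cm7`): leaf D(a) is discharged by §17 (`descentManinDatumSeven_of_maninCertificate`);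
everything else as `cmRamifiedSeven_of_three_leaves_grantedH2`. The remaining open leaves of the node are A
(`KolyvaginDatumHalfSeven`, UNDECIDED·IDEA-NEEDED) and B♭ (`EisensteinCMKolyvaginStructureSevenGrantedH2`, ATTACKABLE L:
THEOREM R minus (H2)). No summit statement and no crux is proved here. [cite: GrossZagier1986, Thm. I.6.3]
[cite: KolyvaginEuler1990, Thm. A] [cite: McCallumLMS1991, §1 Theorem and §5] [cite: Stevens1989, (5.4)–(5.6)]
[cite: CremonaAlgorithms1997, Table 1 (N = 49)] [cite: AgasheRibetStein2006, Thm. 2.6] -/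
theorem cmRamifiedSeven_of_two_leaves_grantedH2 (hBF : bsdTriple_of_hasCM_of_L_one_ne_zero)
    (hmod : hasEntireLFunction_rat) (hnf : exists_isNewformOf)
    (hLLT : LiLiuTian2024.thm11_bsdp_of_cm_rank_one) (hKob : Kobayashi2013.cor14_bsdp_of_cm_rank_one)
    (hLTYZ : LiTianYanZhu2025.thm11_bsdp_of_cm_rank_one)
    (hGZK : rank_eq_analyticRank_of_analyticRank_le_one)
    (hCassels : bsdRHS_eq_of_isIsogenous)
    (hFH : friedbergHoffstein_exists_heegnerField_splitDivisors_twist_ne_zero)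
    (hGZ : ∀ (N : ℕ) [NeZero N] (W : WeierstrassCurve ℚ) (K : Type) [Field K] [NumberField K],
      gross_zagier N W K)
    (hKo : ∀ (N : ℕ) [NeZero N] (W : WeierstrassCurve ℚ) (K : Type) [Field K] [NumberField K],
      kolyvagin N W K)
    (hM : OptimalCurveManinCertificate cm7)
    (hA : KolyvaginDatumHalfSeven) (hBflat : EisensteinCMKolyvaginStructureSevenGrantedH2) : X12.CMRamifiedSeven :=
  cmRamifiedSeven_of_three_leaves_grantedH2 hBF hmod hnf hLLT hKob hLTYZ hGZK hCassels hFH hGZ hKo hA hBflat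
    (descentManinDatumSeven_of_maninCertificate hnf hM)

/-! ## §18 REV 8 — hypothesis (H1) «`H¹(Gal(K(E[7^M])/K), E[7^j]) = 0`, `j ≤ M`» of THEOREM R (leaf B, memo
g34 §3; Gross Prop. 9.1, McCallum p. 279) in kernel by a CM HOMOTHETY; leaf B♭ refined to B♭♭ := «THEOREM R granted
(H1) and (H2)»; the composite with B♭♭.  Everything here is over an arbitrary quadratic `K ∌ √−7` and an arbitrary
`W/ℚ` with `cmFieldDiscrOfJ W.j = −7`; no ring class field, no Heegner point and no `L`-function enters. -/

section TowerH1

open Field Polynomial groupCohomology Literature.NumberTheory.GaloisRepresentations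
open Literature.NumberTheory.EllipticCurves.Rank1Residual (cmFieldDiscrOfJ)

/-! ### §18.1 Sah's lemma modulo a subgroup acting trivially (pure group cohomology) -/

section SahModN

variable {G M : Type*} [Group G] [AddCommGroup M] [DistribMulAction G M]

/-- **Sah's lemma modulo a pointwise-trivial subset.** Let `N ⊆ G` act trivially on `M`, let `z ∈ G` be central
modulo `N` (`σ z = z σ n_σ`, `n_σ ∈ N`) with `x ↦ z • x − x` bijective on `M`, and let `f` be a `1`-cocycle vanishing
on `N`. Then `f` is a `1`-coboundary. (Sah's mechanism `z • f σ − f σ = σ • f z − f z` survives because `f (z σ n) =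
f (z σ)`.) [cite: Sah1968, Prop. 2.7 (b) and its proof, p. 60] [cite: LawsonWuthrich2016, §3 Lemma 6] -/
theorem isCoboundary₁_of_central_mod_of_bijective (N : Set G) (hN : ∀ n ∈ N, ∀ x : M, n • x = x)
    {z : G} (hz : ∀ σ : G, ∃ n ∈ N, σ * z = z * σ * n)
    (hbij : Function.Bijective fun x : M => z • x - x) {f : G → M} (hf : IsCocycle₁ f)
    (hfN : ∀ n ∈ N, f n = 0) : IsCoboundary₁ f := by
  obtain ⟨x, hx⟩ := hbij.2 (f z)
  have hx' : z • x - x = f z := hx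
  refine ⟨x, fun σ => ?_⟩
  obtain ⟨n, hn, hσz⟩ := hz σ
  have h1 : f (σ * z) = σ • f z + f σ := hf σ z
  have h2 : f (z * σ * n) = z • f σ + f z := by
    rw [hf (z * σ) n, hfN n hn, smul_zero, zero_add, hf z σ]
  rw [hσz] at h1
  have key : z • f σ - f σ = σ • f z - f z := sub_eq_sub_iff_add_eq_add.2 (h2.symm.trans h1)
  have comm : z • σ • x = σ • z • x := by
    rw [smul_smul, smul_smul, hσz, mul_smul (z * σ) n x, hN n hn x]
  apply hbij.1
  show z • (σ • x - x) - (σ • x - x) = z • f σ - f σ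
  rw [key, ← hx', smul_sub, smul_sub, comm]
  abel

/-- If `z` acts on `M` as the integer scalar `c`, `n • M = 0` and `gcd(c − 1, n) = 1`, then `x ↦ z • x − x` is
bijective (Bezout). [folklore] -/
theorem bijective_smul_sub_of_smul_eq_zsmul {n : ℕ} {z : G} {c : ℤ}
    (hn : ∀ x : M, (n : ℤ) • x = 0) (hc : ∀ x : M, z • x = c • x) (hcop : IsCoprime (c - 1) (n : ℤ)) :
    Function.Bijective fun x : M => z • x - x := by
  obtain ⟨u, v, huv⟩ := hcop
  have e : (fun x : M => z • x - x) = fun x => (c - 1) • x := funext fun x => by rw [hc, sub_smul, one_smul]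
  rw [e]
  have hinv : ∀ x : M, (u * (c - 1)) • x = x := fun x => by
    have h1 : (u * (c - 1) + v * n) • x = x := by rw [huv, one_smul]
    rwa [add_smul, mul_smul v, hn, smul_zero, add_zero] at h1
  refine ⟨fun x y hxy => ?_, fun y => ⟨u • y, ?_⟩⟩
  · have h := congrArg (fun w : M => u • w) hxy
    simp only [← mul_smul, hinv] at h
    exact h
  · show (c - 1) • u • y = y
    rw [← mul_smul, mul_comm, hinv]

end SahModN

/-! ### §18.2 The `ψ`-adic filtration and `τ^{7^m} ≡ a^{7^m}` on `E[7^M]` (pure algebra) -/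

section Filtration

variable {Ω : Type*} [AddCommGroup Ω] (ψ : Module.End ℤ Ω)

/-- `Fil ψ v`: the set of endomorphisms `y` mapping `ker ψ^k` into `ker ψ^(k-v)` for every `k` («`y` has
`ψ`-adic valuation `≥ v`»); a data definition (a `Set`), not a proposition. [folklore] -/
def Fil (v : ℕ) : Set (Module.End ℤ Ω) :=
  {y | ∀ (k : ℕ) (P : Ω), (ψ ^ k) P = 0 → (ψ ^ (k - v)) (y P) = 0}

variable {ψ}

theorem Fil.ker_mono {a b : ℕ} (hab : a ≤ b) {Q : Ω} (hQ : (ψ ^ a) Q = 0) : (ψ ^ b) Q = 0 := by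
  obtain ⟨d, rfl⟩ := Nat.exists_eq_add_of_le hab
  rw [add_comm, pow_add, Module.End.mul_apply, hQ, map_zero]

theorem Fil.mono {v w : ℕ} {y : Module.End ℤ Ω} (h : y ∈ Fil ψ v) (hwv : w ≤ v) : y ∈ Fil ψ w :=
  fun k P hP => Fil.ker_mono (ψ := ψ) (Nat.sub_le_sub_left hwv k) (h k P hP)

theorem Fil.mul {v v' : ℕ} {y y' : Module.End ℤ Ω} (h : y ∈ Fil ψ v) (h' : y' ∈ Fil ψ v') :
    y * y' ∈ Fil ψ (v + v') := fun k P hP => by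
  have h2 := h (k - v') (y' P) (h' k P hP)
  rw [Module.End.mul_apply, show k - (v + v') = k - v' - v by omega]
  exact h2

theorem Fil.add {v : ℕ} {y y' : Module.End ℤ Ω} (h : y ∈ Fil ψ v) (h' : y' ∈ Fil ψ v) : y + y' ∈ Fil ψ v :=
  fun k P hP => by rw [LinearMap.add_apply, map_add, h k P hP, h' k P hP, add_zero]

theorem Fil.neg {v : ℕ} {y : Module.End ℤ Ω} (h : y ∈ Fil ψ v) : -y ∈ Fil ψ v :=
  fun k P hP => by rw [LinearMap.neg_apply, map_neg, h k P hP, neg_zero]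

theorem Fil.of_commute {y : Module.End ℤ Ω} (hy : Commute ψ y) : y ∈ Fil ψ 0 := fun k P hP => by
  have h := LinearMap.congr_fun (hy.pow_left k).eq P
  rw [Module.End.mul_apply, Module.End.mul_apply] at h
  rw [Nat.sub_zero, h, hP, map_zero]

theorem Fil.self : ψ ∈ Fil ψ 1 := fun k P hP => by
  cases k with
  | zero =>
    rw [pow_zero, Module.End.one_apply] at hP
    rw [hP, map_zero, map_zero]
  | succ n =>
    rw [pow_succ, Module.End.mul_apply] at hP
    simpa using hP

/-- `y ∈ Fil v` with `k ≤ v`: `y` kills `ker ψ^k`. [folklore] -/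
theorem Fil.apply_eq_zero {v : ℕ} {y : Module.End ℤ Ω} (h : y ∈ Fil ψ v) {k : ℕ} (hk : k ≤ v) {P : Ω}
    (hP : (ψ ^ k) P = 0) : y P = 0 := by
  have h' := h k P hP
  rwa [Nat.sub_eq_zero_of_le hk, pow_zero, Module.End.one_apply] at h'

/-- Polynomials in an element commuting with `ψ` commute with `ψ`. [folklore] -/
theorem commute_aeval_of_commute {u : Module.End ℤ Ω} (hu : Commute ψ u) (p : ℤ[X]) :
    Commute ψ (aeval u p) := by
  refine p.induction_on' (fun p q hp hq => ?_) (fun n a => ?_)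
  · rw [map_add]; exact hp.add_right hq
  · rw [aeval_monomial, eq_intCast]
    exact ((Int.cast_commute a ψ).symm).mul_right (hu.pow_right n)

/-- **The `7`-adic contraction.** If `ν := x − a` has `ψ`-valuation `≥ 1`, `x` commutes with `ψ` and `7` has
`ψ`-valuation `≥ 2`, then `x^{7^m} − a^{7^m}` has `ψ`-valuation `≥ m + 1` (`u⁷ − b⁷ = (u − b)(7b⁶ + (u − b)q(u,b))`).
[folklore] -/
theorem Fil.pow_seven_pow_sub {x : Module.End ℤ Ω} (hx : Commute ψ x) (a : ℤ)
    (hν : x - (a : Module.End ℤ Ω) ∈ Fil ψ 1) (h7 : (7 : Module.End ℤ Ω) ∈ Fil ψ 2) (m : ℕ) :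
    x ^ (7 ^ m) - ((a ^ (7 ^ m) : ℤ) : Module.End ℤ Ω) ∈ Fil ψ (m + 1) := by
  induction m with
  | zero => simpa using hν
  | succ m ih =>
    rw [pow_succ, pow_mul, pow_mul, Int.cast_pow]
    set u : Module.End ℤ Ω := x ^ (7 ^ m) with hu
    set b : ℤ := a ^ (7 ^ m) with hb
    have hux : Commute ψ u := hx.pow_right _
    -- the polynomial identity `u⁷ − b⁷ = (u − b)(7 b⁶ + (u − b) q(u, b))`, evaluated at `u`
    set q : ℤ[X] := X ^ 5 + 2 * X ^ 4 * C b + 3 * X ^ 3 * C b ^ 2 + 4 * X ^ 2 * C b ^ 3 + 5 * X * C b ^ 4 +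
      6 * C b ^ 5 with hq
    have hpoly : (X ^ 7 - C b ^ 7 : ℤ[X]) = (X - C b) * (7 * C b ^ 6 + (X - C b) * q) := by
      rw [hq]; ring
    have hev := congrArg (aeval u) hpoly
    simp only [map_sub, map_mul, map_add, map_pow, aeval_X, map_intCast, eq_intCast, map_ofNat] at hev
    rw [hev]
    -- valuations: `u − b ≥ m + 1`, `7 b⁶ + (u − b) q ≥ 1`
    have hbc : Commute ψ ((b : ℤ) : Module.End ℤ Ω) := (Int.cast_commute b ψ).symm
    have hq0 : aeval u q ∈ Fil ψ 0 := Fil.of_commute (commute_aeval_of_commute hux q)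
    have h1 : (7 : Module.End ℤ Ω) * (b : Module.End ℤ Ω) ^ 6 +
        (u - (b : Module.End ℤ Ω)) * aeval u q ∈ Fil ψ 1 := by
      refine Fil.add ?_ ?_
      · exact Fil.mono (Fil.mul h7 (Fil.of_commute (hbc.pow_right 6))) (by omega)
      · exact Fil.mono (Fil.mul ih hq0) (by omega)
    exact Fil.mul ih h1

end Filtration

/-! ### §18.3 `ker ψ` is a line of `E[7]` spanned with a `ψ`-preimage (counting `#E[7] = 7²`, `#E[49] = 7⁴`) -/

section SqrtLine

universe u

variable {F : Type u} [Field F] (E : WeierstrassCurve F)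
  (ψ : E.geomPoints →+ E.geomPoints) (hψ : ∀ P, ψ (ψ P) = (-7 : ℤ) • P)

include hψ in
/-- `ker ψ ⊆ E[7]` (`7 = −ψ²`). [folklore] -/
theorem seven_smul_eq_zero_of_psi_eq_zero {P : E.geomPoints} (hP : ψ P = 0) : ((7 : ℕ) : ℤ) • P = 0 := by
  have h : (-7 : ℤ) • P = 0 := by rw [← hψ P, hP, map_zero]
  rw [neg_smul, neg_eq_zero] at h
  exact_mod_cast h

include hψ in
/-- `ψ(E[7]) ≤ ker ψ`. [folklore] -/
theorem map_geomTorsion_le_ker : (geomTorsion E ((7 : ℕ) : ℤ)).map ψ ≤ ψ.ker := by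
  rintro _ ⟨P, hP, rfl⟩
  rw [AddMonoidHom.mem_ker, hψ]
  have hP' : ((7 : ℕ) : ℤ) • P = 0 := (E.mem_geomTorsion_iff _ P).1 hP
  rw [neg_smul, neg_eq_zero]
  exact_mod_cast hP'

variable [E.IsElliptic]

include hψ in
/-- `ψ ≠ 0` on `E[7]` when `(7 : F) ≠ 0` (else `E[49] ⊆ E[7]`, `7⁴ ≤ 7²`). [folklore] -/
theorem exists_geomTorsion_psi_ne_zero (h7 : (7 : F) ≠ 0) :
    ∃ P : E.geomPoints, P ∈ geomTorsion E ((7 : ℕ) : ℤ) ∧ ψ P ≠ 0 := by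
  by_contra hcon
  push Not at hcon
  have h49 : ((49 : ℕ) : F) ≠ 0 := by
    rw [show ((49 : ℕ) : F) = 7 * 7 by norm_num]
    exact mul_ne_zero h7 h7
  have hc7 : Nat.card (geomTorsion E ((7 : ℕ) : ℤ)) = 7 ^ 2 := E.natCard_geomTorsion_eq_sq (by exact_mod_cast h7)
  have hc49 : Nat.card (geomTorsion E ((49 : ℕ) : ℤ)) = 49 ^ 2 := E.natCard_geomTorsion_eq_sq h49
  haveI : Finite (geomTorsion E ((7 : ℕ) : ℤ)) := Nat.finite_of_card_ne_zero (by rw [hc7]; norm_num)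
  have hle : geomTorsion E ((49 : ℕ) : ℤ) ≤ geomTorsion E ((7 : ℕ) : ℤ) := by
    intro Q hQ
    rw [mem_geomTorsion_iff] at hQ ⊢
    have h7Q : ((7 : ℕ) : ℤ) • Q ∈ geomTorsion E ((7 : ℕ) : ℤ) := by
      rw [mem_geomTorsion_iff, ← mul_smul]
      exact_mod_cast hQ
    have h1 : ψ (((7 : ℕ) : ℤ) • Q) = 0 := hcon _ h7Q
    rw [map_zsmul] at h1
    have h2 : ψ Q ∈ geomTorsion E ((7 : ℕ) : ℤ) := (E.mem_geomTorsion_iff _ _).2 h1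
    have h3 : ψ (ψ Q) = 0 := hcon _ h2
    have h4 : (-7 : ℤ) • Q = 0 := by rw [← hψ Q, h3]
    rw [neg_smul, neg_eq_zero] at h4
    exact_mod_cast h4
  have := AddSubgroup.card_le_of_le hle
  rw [hc7, hc49] at this
  norm_num at this

include hψ in
/-- **`ker ψ` is a line and `ψ(E[7]) = ker ψ`** (`#E[7] = 49 = #ker ψ · #ψ(E[7])`, `ψ(E[7]) ≤ ker ψ`, `ψ|E[7] ≠ 0`).
[cite: SilvermanAEC2009, Cor. III.6.4(b)] -/
theorem card_ker_psi (h7 : (7 : F) ≠ 0) :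
    Nat.card ψ.ker = 7 ∧ (geomTorsion E ((7 : ℕ) : ℤ)).map ψ = ψ.ker := by
  set A₁ := geomTorsion E ((7 : ℕ) : ℤ) with hA₁
  have hc7 : Nat.card A₁ = 7 ^ 2 := E.natCard_geomTorsion_eq_sq (by exact_mod_cast h7)
  haveI : Finite A₁ := Nat.finite_of_card_ne_zero (by rw [hc7]; norm_num)
  have hkerle : ψ.ker ≤ A₁ := fun P hP =>
    (E.mem_geomTorsion_iff _ P).2 (seven_smul_eq_zero_of_psi_eq_zero E ψ hψ ((AddMonoidHom.mem_ker).1 hP))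
  haveI : Finite ψ.ker := Finite.of_injective _ (AddSubgroup.inclusion_injective hkerle)
  have hmaple : A₁.map ψ ≤ ψ.ker := map_geomTorsion_le_ker E ψ hψ
  set φ : A₁ →+ E.geomPoints := ψ.comp A₁.subtype with hφ
  have hrange : φ.range = A₁.map ψ := by rw [hφ, ← AddMonoidHom.map_range, AddSubgroup.range_subtype]
  have hkerφ : φ.ker = ψ.ker.addSubgroupOf A₁ := rfl
  have hcardker : Nat.card φ.ker = Nat.card ψ.ker := by
    rw [hkerφ]; exact Nat.card_congr (AddSubgroup.addSubgroupOfEquivOfLe hkerle).toEquiv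
  have hprod : Nat.card ψ.ker * Nat.card (A₁.map ψ) = 7 ^ 2 := by
    rw [← hcardker, ← hrange, ← AddSubgroup.index_ker, AddSubgroup.card_mul_index, hc7]
  have hle : Nat.card (A₁.map ψ) ≤ Nat.card ψ.ker := AddSubgroup.card_le_of_le hmaple
  have hne : Nat.card (A₁.map ψ) ≠ 1 := by
    rw [Ne, AddSubgroup.card_eq_one, AddSubgroup.eq_bot_iff_forall]
    push Not
    obtain ⟨P, hP, hPne⟩ := exists_geomTorsion_psi_ne_zero E ψ hψ h7
    exact ⟨ψ P, AddSubgroup.mem_map_of_mem ψ hP, hPne⟩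
  have hdvd : Nat.card ψ.ker ∣ 7 ^ 2 := Dvd.intro _ hprod
  obtain ⟨i, hi, hcard⟩ := (Nat.dvd_prime_pow (by norm_num : Nat.Prime 7)).1 hdvd
  interval_cases i
  · exfalso
    rw [pow_zero] at hcard
    rw [hcard, one_mul] at hprod
    rw [hcard, hprod] at hle
    norm_num at hle
  · rw [pow_one] at hcard
    have hmapcard : Nat.card (A₁.map ψ) = 7 := by
      rw [hcard] at hprod
      have h' : 7 * Nat.card (A₁.map ψ) = 7 * 7 := by rw [hprod]; norm_num
      exact Nat.eq_of_mul_eq_mul_left (by norm_num) h'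
    exact ⟨hcard, AddSubgroup.eq_of_le_of_card_ge hmaple (by rw [hmapcard, hcard])⟩
  · exfalso
    rw [hcard] at hprod
    have h' : 7 ^ 2 * Nat.card (A₁.map ψ) = 7 ^ 2 * 1 := by rw [hprod, mul_one]
    exact hne (Nat.eq_of_mul_eq_mul_left (by norm_num) h')

include hψ in
/-- A generator `g₁` of the line `ker ψ` (order `7`). [cite: SilvermanAEC2009, Cor. III.6.4(b)] -/
theorem exists_generator_ker (h7 : (7 : F) ≠ 0) :
    ∃ g₁ : E.geomPoints, ψ g₁ = 0 ∧ g₁ ≠ 0 ∧ ((7 : ℕ) : ℤ) • g₁ = 0 ∧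
      ∀ P, ψ P = 0 → ∃ k : ℤ, k • g₁ = P := by
  haveI : Fact (Nat.Prime 7) := ⟨by norm_num⟩
  obtain ⟨hcard, -⟩ := card_ker_psi E ψ hψ h7
  haveI : Finite ψ.ker := Nat.finite_of_card_ne_zero (by rw [hcard]; norm_num)
  have hbot : ψ.ker ≠ ⊥ := by
    intro h; rw [h, AddSubgroup.card_bot] at hcard; norm_num at hcard
  obtain ⟨g₁, hg₁0⟩ := AddSubgroup.ne_bot_iff_exists_ne_zero.1 hbot
  have hψg : ψ (g₁ : E.geomPoints) = 0 := (AddMonoidHom.mem_ker).1 g₁.2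
  have h7g : ((7 : ℕ) : ℤ) • (g₁ : E.geomPoints) = 0 := seven_smul_eq_zero_of_psi_eq_zero E ψ hψ hψg
  have hg0 : (g₁ : E.geomPoints) ≠ 0 := fun h => hg₁0 (Subtype.ext h)
  have hord : addOrderOf (g₁ : E.geomPoints) = 7 :=
    addOrderOf_eq_prime (by rw [← natCast_zsmul]; exact h7g) hg0
  have hzm : AddSubgroup.zmultiples (g₁ : E.geomPoints) = ψ.ker := by
    refine AddSubgroup.eq_of_le_of_card_ge ?_ ?_
    · rw [AddSubgroup.zmultiples_le]; exact g₁.2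
    · rw [hcard, Nat.card_zmultiples, hord]
  refine ⟨g₁, hψg, hg0, h7g, fun P hP => ?_⟩
  have hPm : P ∈ AddSubgroup.zmultiples (g₁ : E.geomPoints) := by
    rw [hzm]; exact (AddMonoidHom.mem_ker).2 hP
  exact AddSubgroup.mem_zmultiples_iff.1 hPm

include hψ in
/-- **A triangular basis of `E[7]` adapted to `ψ`.** `g₁` generates `ker ψ`, `g₂ ∈ E[7]` with `ψ g₂ = g₁`, and
`E[7] = ℤ g₁ + ℤ g₂`. [cite: SilvermanAEC2009, Cor. III.6.4(b)] -/
theorem exists_triangular_pair (h7 : (7 : F) ≠ 0) :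
    ∃ g₁ g₂ : E.geomPoints, ψ g₁ = 0 ∧ g₁ ≠ 0 ∧ ((7 : ℕ) : ℤ) • g₁ = 0 ∧
      (∀ P, ψ P = 0 → ∃ k : ℤ, k • g₁ = P) ∧ ((7 : ℕ) : ℤ) • g₂ = 0 ∧ ψ g₂ = g₁ ∧
      ∀ T : E.geomPoints, ((7 : ℕ) : ℤ) • T = 0 → ∃ c₁ c₂ : ℤ, T = c₁ • g₁ + c₂ • g₂ := by
  obtain ⟨g₁, hψg, hg0, h7g, hgen⟩ := exists_generator_ker E ψ hψ h7
  obtain ⟨-, hmap⟩ := card_ker_psi E ψ hψ h7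
  have hg₁mem : g₁ ∈ (geomTorsion E ((7 : ℕ) : ℤ)).map ψ := by
    rw [hmap]; exact (AddMonoidHom.mem_ker).2 hψg
  obtain ⟨g₂, hg₂, hψg₂⟩ := AddSubgroup.mem_map.1 hg₁mem
  refine ⟨g₁, g₂, hψg, hg0, h7g, hgen, (E.mem_geomTorsion_iff _ g₂).1 hg₂, hψg₂, fun T hT => ?_⟩
  have hψT : ψ (ψ T) = 0 := by
    rw [hψ, neg_smul, neg_eq_zero]; exact_mod_cast hT
  obtain ⟨c₂, hc₂⟩ := hgen (ψ T) hψT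
  have hdiff : ψ (T - c₂ • g₂) = 0 := by rw [map_sub, map_zsmul, hψg₂, hc₂, sub_self]
  obtain ⟨c₁, hc₁⟩ := hgen _ hdiff
  exact ⟨c₁, c₂, by rw [hc₁]; abel⟩

end SqrtLine

/-! ### §18.4 `a₁ a₂ ≡ χ₇(σ)` for a TRIANGULAR pair (Weil pairing; the diagonal case is the tree's
`WeilPairingCyclicComponents.intCast_mul_eq_modNCyclotomicCharacter_of_smul_eq_zsmul`) -/

section TriangularDet

universe u

variable {F : Type u} [Field F] [PerfectField F] (E : WeierstrassCurve F) [E.IsElliptic]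

/-- `c • T = (c mod m) • T` on `m`-torsion. [folklore] -/
theorem zsmul_eq_val_nsmul_of_nsmul_eq_zero' {A : Type*} [AddCommGroup A] {m : ℕ} [NeZero m]
    {T : A} (hT : m • T = 0) (c : ℤ) : c • T = ((c : ZMod m).val) • T := by
  have h1 : (((c : ZMod m).val : ℕ) : ℤ) + m * (c / m) = c := by
    rw [ZMod.val_intCast, Int.emod_add_mul_ediv]
  have hT' : (m : ℤ) • T = 0 := by rw [natCast_zsmul, hT]
  calc c • T = ((((c : ZMod m).val : ℕ) : ℤ) + m * (c / m)) • T := by rw [h1]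
    _ = (((c : ZMod m).val : ℕ) : ℤ) • T + (c / m) • ((m : ℤ) • T) := by
        rw [add_zsmul, mul_comm, mul_smul]
    _ = ((c : ZMod m).val) • T := by rw [hT', smul_zero, add_zero, natCast_zsmul]

/-- **`a₁ a₂ ≡ χ_m(σ) (mod m)` for an upper-triangular action on a spanning pair of `E[m]`**: `E[m] = ℤg₁ + ℤg₂`,
`ord g₂ = m`, `σ g₁ = a₁ g₁`, `σ g₂ = a₂ g₂ + l g₁`; then `e_m(σg₁, σg₂) = e_m(g₁,g₂)^{a₁a₂}` (alternating kills
`e_m(g₁,g₁)^{a₁ l}`) and `= e_m(g₁,g₂)^{χ_m(σ)}`. [cite: SilvermanAEC2009, Prop. III.8.1]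
[cite: SilvermanCSS1997, Ch. II §7 Proposition and §8] -/
theorem intCast_mul_eq_modNCyclotomicCharacter_of_triangular (m : ℕ) [NeZero m] [NeZero (m : F)]
    (hm : 2 ≤ m) {g₁ g₂ : geomTorsion E m}
    (hspan : ∀ T : geomTorsion E m, ∃ c₁ c₂ : ℤ, T = c₁ • g₁ + c₂ • g₂) (ho₂ : addOrderOf g₂ = m)
    (σ : Field.absoluteGaloisGroup F) {a₁ a₂ l : ℤ} (ha₁ : σ • g₁ = a₁ • g₁)
    (ha₂ : σ • g₂ = a₂ • g₂ + l • g₁) :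
    ((a₁ * a₂ : ℤ) : ZMod m) = ((modNCyclotomicCharacter F m σ : (ZMod m)ˣ) : ZMod m) := by
  have hm0 : m ≠ 0 := NeZero.ne m
  obtain ⟨w, hpow, haddl, haddr, halt, hnd, hgal⟩ :=
    exists_weilPairing_holds E m hm (NeZero.ne (m : F))
  have hne : ∀ S T, w S T ≠ 0 := fun S T h0 ↦ by
    have := hpow S T
    rw [h0, zero_pow hm0] at this
    exact zero_ne_one this
  have hzero_left : ∀ T, w 0 T = 1 := fun T ↦ by
    have h := haddl 0 0 T
    rw [add_zero] at h
    exact (mul_eq_left₀ (hne 0 T)).mp h.symm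
  have hzero_right : ∀ S, w S 0 = 1 := fun S ↦ by
    have h := haddr S 0 0
    rw [add_zero] at h
    exact (mul_eq_left₀ (hne S 0)).mp h.symm
  have hnsmul_left : ∀ (a : ℕ) S T, w (a • S) T = w S T ^ a := fun a S T ↦ by
    induction a with
    | zero => rw [zero_nsmul, pow_zero, hzero_left]
    | succ a ih => rw [succ_nsmul, haddl, ih, pow_succ]
  have hnsmul_right : ∀ (a : ℕ) S T, w S (a • T) = w S T ^ a := fun a S T ↦ by
    induction a with
    | zero => rw [zero_nsmul, pow_zero, hzero_right]
    | succ a ih => rw [succ_nsmul, haddr, ih, pow_succ]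
  have htor : ∀ T : geomTorsion E m, m • T = 0 := fun T ↦ AddSubgroup.torsionBy.nsmul T
  have hspan' : ∀ T : geomTorsion E m, ∃ k₁ k₂ : ℕ, T = k₁ • g₁ + k₂ • g₂ := fun T ↦ by
    obtain ⟨c₁, c₂, hT⟩ := hspan T
    exact ⟨(c₁ : ZMod m).val, (c₂ : ZMod m).val, by
      rw [hT, zsmul_eq_val_nsmul_of_nsmul_eq_zero' (htor g₁), zsmul_eq_val_nsmul_of_nsmul_eq_zero' (htor g₂)]⟩
  have hfin : IsOfFinOrder (w g₁ g₂) :=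
    isOfFinOrder_iff_pow_eq_one.mpr ⟨m, Nat.pos_of_ne_zero hm0, hpow g₁ g₂⟩
  have hordζ : orderOf (w g₁ g₂) = m := by
    refine Nat.dvd_antisymm (orderOf_dvd_of_pow_eq_one (hpow g₁ g₂)) ?_
    set d := orderOf (w g₁ g₂) with hd
    have hdQ : d • g₂ = 0 := hnd (d • g₂) fun S ↦ by
      obtain ⟨k₁, k₂, hS⟩ := hspan' S
      rw [hS, hnsmul_right, haddl, hnsmul_left, hnsmul_left, halt g₂, one_pow, mul_one, ← pow_mul,
        mul_comm, pow_mul, pow_orderOf_eq_one, one_pow]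
    rw [← ho₂]
    exact addOrderOf_dvd_iff_nsmul_eq_zero.mpr hdQ
  have hσ₁ : σ • g₁ = (a₁ : ZMod m).val • g₁ := by
    rw [ha₁, zsmul_eq_val_nsmul_of_nsmul_eq_zero' (htor g₁)]
  have hσ₂ : σ • g₂ = (a₂ : ZMod m).val • g₂ + (l : ZMod m).val • g₁ := by
    rw [ha₂, zsmul_eq_val_nsmul_of_nsmul_eq_zero' (htor g₂), zsmul_eq_val_nsmul_of_nsmul_eq_zero' (htor g₁)]
  have hχ : σ • w g₁ g₂ = w g₁ g₂ ^ ((modNCyclotomicCharacter F m σ : (ZMod m)ˣ) : ZMod m).val :=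
    modNCyclotomicCharacter_spec F m σ (w g₁ g₂) (hpow g₁ g₂)
  have hgalζ : σ • w g₁ g₂ = w g₁ g₂ ^ ((a₁ : ZMod m).val * (a₂ : ZMod m).val) := by
    rw [hgal σ g₁ g₂, hσ₁, hσ₂, hnsmul_left, haddr, hnsmul_right, hnsmul_right, halt g₁, one_pow, mul_one,
      ← pow_mul, mul_comm]
  rw [hχ, hfin.pow_eq_pow_iff_modEq, hordζ, ← ZMod.natCast_eq_natCast_iff] at hgalζ
  push_cast at hgalζ
  simp only [ZMod.natCast_val, ZMod.cast_id', id_eq] at hgalζ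
  rw [Int.cast_mul, hgalζ]

end TriangularDet

/-! ### §18.5 (H1) as a typed Prop, and its proof -/

/-- **(H1) of THEOREM R (leaf B, memo g34 §3) as a typed Prop — `TowerH1VanishingSeven`.** For every `W/ℚ` with
CM by `ℚ(√−7)` (`cmFieldDiscrOfJ W.j = −7`, i.e. `j ∈ {−3375, 16581375}`: all of 𝒞₇ and all twins), every
quadratic field `K` with `√−7 ∉ K` (e.g. an imaginary quadratic Heegner field for `N = 49 D²`, in which `7` splits),
and all exponents `j ≤ M`: every `1`-cocycle `f : Γ_K → E[7^j]` that VANISHES on `Γ_{L_M} = {σ : σ|E[7^M] = id}`,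
`L_M = K(E[7^M])`, is a `1`-coboundary — i.e. `H¹(Gal(L_M/K), E[7^j]) = 0`, equivalently
`res : H¹(K, E[7^j]) → H¹(L_M, E[7^j])` is injective (inflation–restriction). This is McCallum's hypothesis for the
Eisenstein prime `7`, where `Gal(L_M/K)` is NOT prime-to-`7`; the classical Sah/Lawson–Wuthrich argument needs a
central non-trivial homothety, supplied here by CM. PROVED below (`towerH1VanishingSeven_holds`).
[cite: McCallumLMS1991, §4] [cite: GrossLMS1991, §4 (proof of Prop. 4.1)] [cite: LawsonWuthrich2016, Thm. 2 and §3]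
[cite: Sah1968, Prop. 2.7 (b)] -/
def TowerH1VanishingSeven : Prop :=
  ∀ (W : WeierstrassCurve ℚ) [W.IsElliptic], cmFieldDiscrOfJ W.j = -7 →
    ∀ (K : Type) [Field K] [NumberField K], Module.finrank ℚ K = 2 → (∀ y : K, y ^ 2 ≠ -7) →
    ∀ (M j : ℕ), j ≤ M →
    ∀ f : absoluteGaloisGroup K → geomTorsion (W.baseChange K) ((7 ^ j : ℕ) : ℤ), IsCocycle₁ f →
      (∀ σ : absoluteGaloisGroup K,
          (∀ T : geomTorsion (W.baseChange K) ((7 ^ M : ℕ) : ℤ), σ • T = T) → f σ = 0) →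
      IsCoboundary₁ f

/-- `cmFieldDiscrOfJ j = −7` iff `j ∈ {−3375, 16581375}` (table of CM `j`-invariants).
[cite: SilvermanATAEC1994, App. A §3 (table of CM j-invariants)] -/
theorem j_eq_of_cmFieldDiscrOfJ_eq_neg_seven' {j : ℚ} (h : cmFieldDiscrOfJ j = -7) :
    j = -3375 ∨ j = 16581375 := by
  unfold cmFieldDiscrOfJ at h
  split_ifs at h <;> first | assumption | (norm_num at h)

/-- **The CM homothety supply over `K` (NEW, the heart of (H1)).** For `W/ℚ` with `d_K = −7`, `K` quadratic with
`√−7 ∉ K`, there are `τ ∈ Γ_K` fixing `√−7 ∈ K̄`, an additive `ψ = [√−7]` on `E(K̄)` commuting with `τ`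
(`ψ² = −7`), and `a ∈ ℤ` with `7 ∤ a − 1` such that `τ` acts as `a` on the line `ker ψ ⊂ E[7]`.  (`τ = τ₀²`
with `χ₇(τ₀) = 2`; `ker ψ = ℤg₁`, `E[7] = ℤg₁ + ℤg₂`, `ψ g₂ = g₁`, `τ₀ g₁ = a₀ g₁`, `τ₀ g₂ = ±a₀ g₂ + l g₁`, Weil:
`±a₀² ≡ 2`, so `a = a₀² ≢ 1 (mod 7)`.) [cite: SilvermanAdvancedTopics1994, II §2 Thm. 2.2(b)]
[cite: SilvermanAEC2009, Prop. III.8.1] [cite: Serre1972, §4.5 (χ₇ on Γ_K)] -/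
theorem exists_cm_homothety_seven (W : WeierstrassCurve ℚ) [W.IsElliptic] (hW : cmFieldDiscrOfJ W.j = -7)
    (K : Type) [Field K] [NumberField K] (h2 : Module.finrank ℚ K = 2) (h7 : ∀ y : K, y ^ 2 ≠ -7) :
    ∃ (τ : absoluteGaloisGroup K) (ψ : (W.baseChange K).geomPoints →+ (W.baseChange K).geomPoints) (a : ℤ),
      (∀ P, ψ (ψ P) = (-7 : ℤ) • P) ∧ (∀ P, τ • ψ P = ψ (τ • P)) ∧
      (∀ P, ψ P = 0 → τ • P = a • P) ∧ ((a : ZMod 7) ≠ 1) := by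
  -- arithmetic in `ZMod 7`, decided before any local instance enters the context
  have h35 : (3 : ZMod 7) * 5 = 1 := by decide
  have h33 : (3 : ZMod 7) * 3 = 2 := by decide
  have key : ∀ e b : ZMod 7, (e = 1 ∨ e = -1) → e * (b * b) = 2 → b * b = 1 → False := by decide
  haveI hE : (W.baseChange K).IsElliptic := inferInstanceAs (W.map (algebraMap ℚ K)).IsElliptic
  have h7K : ((7 : ℕ) : K) ≠ 0 := by norm_num
  haveI : NeZero ((7 : ℕ) : K) := ⟨h7K⟩
  haveI : NeZero ((7 : ℕ) : ℚ) := ⟨by norm_num⟩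
  set E := W.baseChange K with hEdef
  -- `r = √-7 ∈ K̄ \ K` and `σ₀ r = -r`
  obtain ⟨r, hr⟩ : ∃ r : AlgebraicClosure K, r ^ 2 = -7 := IsAlgClosed.exists_pow_nat_eq (-7) (by norm_num)
  have hrK : r ∉ Set.range (algebraMap K (AlgebraicClosure K)) := by
    rintro ⟨y, hy⟩
    apply h7 y
    apply (algebraMap K (AlgebraicClosure K)).injective
    rw [map_pow, hy, hr, map_neg, map_ofNat]
  have hr' : r * r = algebraMap K _ (-7 : K) := by rw [← sq, hr, map_neg, map_ofNat]
  obtain ⟨σ₀, hσ₀⟩ := Theorems.BiquadraticEisensteinDescentEisensteinHeartFlatCMInertBadKPrimeCMDatumAdapter.exists_smul_eq_neg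
    r (-7) hr' hrK
  have hr0 : r ≠ 0 :=
    Theorems.BiquadraticEisensteinDescentEisensteinHeartFlatCMInertBadKPrimeCMDatumAdapter.ne_zero_of_not_mem_range hrK
  -- `ψ = [√-7]`
  obtain ⟨ψ, hψfix, hψneg, hψψ⟩ : ∃ ψ : E.geomPoints →+ E.geomPoints,
      (∀ σ : absoluteGaloisGroup K, σ • r = r → ∀ P, σ • ψ P = ψ (σ • P)) ∧
      (∀ σ : absoluteGaloisGroup K, σ • r = -r → ∀ P, σ • ψ P = -ψ (σ • P)) ∧
      (∀ P, ψ (ψ P) = (-7 : ℤ) • P) := by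
    have hj := j_eq_of_cmFieldDiscrOfJ_eq_neg_seven' hW
    have hj' : W.j = -3375 ∨ W.j = 16581375 ∨ W.j = -32768 ∨ W.j = -884736 ∨ W.j = -884736000 ∨
        W.j = -147197952000 ∨ W.j = -262537412640768000 := by
      rcases hj with h | h
      · exact Or.inl h
      · exact Or.inr (Or.inl h)
    have hr'' : r ^ 2 = algebraMap K (AlgebraicClosure K) ((cmFieldDiscrOfJ W.j : ℤ) : K) := by
      rw [hW, hr]; simp only [Int.reduceNeg, Int.cast_neg, Int.cast_ofNat, map_neg, map_ofNat]
    obtain ⟨ψ, h1, h2', h3⟩ :=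
      Theorems.BiquadraticEisensteinDescentEisensteinHeartFlatCMInertBadKPrimeSqrtEndomorphismTwist.exists_sqrt_endomorphism_of_j_mem
        W hj' r hr'' hr0 σ₀ hσ₀
    exact ⟨ψ, h1, h2', fun P => by rw [h3, hW]⟩
  -- `τ₀ ∈ Γ_K` with `χ₇(τ₀) = 2`: a lift of `g²`, `χ₇(g) = 3`, `[Γ_ℚ : Γ_K] = 2`
  haveI : FiniteDimensional ℚ K := Module.finite_of_finrank_eq_succ h2
  haveI : Algebra.IsQuadraticExtension ℚ K := ⟨h2⟩
  haveI : IsGalois ℚ K := inferInstance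
  have hidx : ((absGaloisRestrict ℚ K).range : Subgroup (absoluteGaloisGroup ℚ)).index = 2 :=
    (SorensenPatching.index_range_absGaloisRestrict ℚ K).trans h2
  obtain ⟨g, hg⟩ := Rat.modNCyclotomicCharacter_surjective 7 (Units.mkOfMulEqOne (3 : ZMod 7) 5 h35)
  obtain ⟨τ₀, hτ₀⟩ : g * g ∈ ((absGaloisRestrict ℚ K).range : Subgroup (absoluteGaloisGroup ℚ)) :=
    Subgroup.mul_self_mem_of_index_two hidx g
  have hωτ₀ : ((modNCyclotomicCharacter K 7 τ₀ : (ZMod 7)ˣ) : ZMod 7) = 2 := by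
    have hc := modNCyclotomicCharacter_absGaloisRestrict ℚ K 7 τ₀
    have hτ₀' : absGaloisRestrict ℚ K τ₀ = g * g := hτ₀
    rw [hτ₀', map_mul, hg] at hc
    rw [← hc, Units.val_mul, Units.val_mkOfMulEqOne]
    exact h33
  -- `τ₀ r = ε r`, `ε = ±1`; `τ₀ ψ = ε ψ τ₀`
  obtain ⟨ε, hε, hτ₀ψ, hτ₀r⟩ : ∃ ε : ℤ, (ε = 1 ∨ ε = -1) ∧ (∀ P, τ₀ • ψ P = ε • ψ (τ₀ • P)) ∧
      (τ₀ • r = r ∨ τ₀ • r = -r) := by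
    rcases Theorems.BiquadraticEisensteinDescentEisensteinHeartFlatCMInertBadKPrimeCMDatumAdapter.smul_eq_self_or_eq_neg
        r (-7) hr' τ₀ with h | h
    · exact ⟨1, Or.inl rfl, fun P => by rw [hψfix τ₀ h P, one_zsmul], Or.inl h⟩
    · exact ⟨-1, Or.inr rfl, fun P => by rw [hψneg τ₀ h P, neg_one_zsmul], Or.inr h⟩
  have hεε : ε * ε = 1 := by rcases hε with rfl | rfl <;> norm_num
  -- `τ = τ₀²` fixes `r` and commutes with `ψ`
  set τ := τ₀ * τ₀ with hτdef
  have hτr : τ • r = r := by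
    rcases hτ₀r with h | h
    · rw [hτdef, mul_smul, h, h]
    · rw [hτdef, mul_smul, h, smul_neg, h, neg_neg]
  have hψτ : ∀ P, τ • ψ P = ψ (τ • P) := hψfix τ hτr
  -- the triangular pair
  obtain ⟨g₁, g₂, hψg₁, hg₁0, h7g₁, hgen, h7g₂, hψg₂, hspanΩ⟩ :=
    exists_triangular_pair E ψ hψψ (by exact_mod_cast h7K)
  -- `τ₀ g₁ = a₀ g₁`
  have hψτ₀g₁ : ψ (τ₀ • g₁) = 0 := by
    have h := hτ₀ψ g₁
    rw [hψg₁, smul_zero] at h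
    have h' : (ε * ε) • ψ (τ₀ • g₁) = 0 := by rw [mul_smul, ← h, smul_zero]
    rwa [hεε, one_smul] at h'
  obtain ⟨a₀, ha₀⟩ := hgen _ hψτ₀g₁
  -- `τ₀ g₂ = (ε a₀) g₂ + l g₁`
  have hψτ₀g₂ : ψ (τ₀ • g₂ - (ε * a₀) • g₂) = 0 := by
    have h := hτ₀ψ g₂
    rw [hψg₂, ← ha₀] at h
    -- h : a₀ • g₁ = ε • ψ (τ₀ • g₂)
    have h' : ψ (τ₀ • g₂) = (ε * a₀) • g₁ := by
      rw [mul_smul, h, smul_smul, hεε, one_smul]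
    rw [map_sub, map_zsmul, hψg₂, h', sub_self]
  obtain ⟨l, hl⟩ := hgen _ hψτ₀g₂
  have hτ₀g₂ : τ₀ • g₂ = (ε * a₀) • g₂ + l • g₁ := by rw [hl]; abel
  -- Weil: `a₀ · (ε a₀) ≡ χ₇(τ₀) = 2 (mod 7)`, in the subtype `E[7]`
  let G₁ : geomTorsion E ((7 : ℕ) : ℤ) := ⟨g₁, (E.mem_geomTorsion_iff _ _).2 h7g₁⟩
  let G₂ : geomTorsion E ((7 : ℕ) : ℤ) := ⟨g₂, (E.mem_geomTorsion_iff _ _).2 h7g₂⟩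
  have hspan : ∀ T : geomTorsion E ((7 : ℕ) : ℤ), ∃ c₁ c₂ : ℤ, T = c₁ • G₁ + c₂ • G₂ := fun T => by
    obtain ⟨c₁, c₂, hT⟩ := hspanΩ T ((E.mem_geomTorsion_iff _ _).1 T.2)
    exact ⟨c₁, c₂, Subtype.ext (by simpa using hT)⟩
  have hG₂0 : G₂ ≠ 0 := by
    intro h
    apply hg₁0
    rw [← hψg₂, show g₂ = 0 from congrArg Subtype.val h, map_zero]
  haveI : Fact (Nat.Prime 7) := ⟨by norm_num⟩
  have ho₂ : addOrderOf G₂ = 7 :=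
    addOrderOf_eq_prime (AddSubgroup.torsionBy.nsmul G₂) hG₂0
  have hA₁ : τ₀ • G₁ = a₀ • G₁ := Subtype.ext (by simpa using ha₀.symm)
  have hA₂ : τ₀ • G₂ = (ε * a₀) • G₂ + l • G₁ := Subtype.ext (by simpa using hτ₀g₂)
  have hdet := intCast_mul_eq_modNCyclotomicCharacter_of_triangular E 7 (by norm_num) hspan ho₂ τ₀ hA₁ hA₂
  rw [hωτ₀] at hdet
  -- `a = a₀²`, `a ≢ 1 (mod 7)`
  refine ⟨τ, ψ, a₀ * a₀, hψψ, hψτ, fun P hP => ?_, fun ha => ?_⟩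
  · obtain ⟨k, rfl⟩ := hgen P hP
    rw [hτdef, mul_smul, smul_comm τ₀ k g₁, ← ha₀, smul_comm τ₀ k, smul_comm τ₀ a₀ g₁, ← ha₀, smul_smul,
      smul_smul, smul_smul]
    congr 1
    ring
  · push_cast at hdet ha
    have hε' : (ε : ZMod 7) = 1 ∨ (ε : ZMod 7) = -1 := by rcases hε with rfl | rfl <;> simp
    exact key _ _ hε' (by linear_combination hdet) ha

/-- **`H¹(Gal(K(E[7^M])/K), E[7^j]) = 0` from a CM homothety (pure group cohomology + `ψ`-adic contraction).**
Given `τ ∈ Γ_K` commuting with an additive `ψ` on `E(K̄)` with `ψ² = −7`, acting on `ker ψ` as `a ≢ 1 (mod 7)`: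
`z = τ^{7^m}` (`m = 2M−1`) acts on `E[7^M] ⊆ ker ψ^{2M}` as the scalar `c = a^{7^m}` because
`(τ − a)(ker ψ^k) ⊆ ker ψ^{k−1}` and `u^7 − b^7 = (u − b)(7b^6 + (u − b)q(u,b))`, `7 = −ψ²`; `z` is central
modulo `N = Γ_{K(E[7^M])}`, `z − 1` is bijective on `E[7^j]` (`7 ∤ c − 1`), and Sah's lemma modulo `N` concludes.
[cite: Sah1968, Prop. 2.7 (b)] [cite: LawsonWuthrich2016, Thm. 2 and §3 (the prime-to-p / central case)]
[cite: McCallumLMS1991, §4] -/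
theorem isCoboundary₁_of_cm_homothety {K : Type} [Field K] (E : WeierstrassCurve K)
    (τ : absoluteGaloisGroup K) (ψ : E.geomPoints →+ E.geomPoints) (a : ℤ)
    (hψψ : ∀ P, ψ (ψ P) = (-7 : ℤ) • P) (hψτ : ∀ P, τ • ψ P = ψ (τ • P))
    (hkerτ : ∀ P, ψ P = 0 → τ • P = a • P) (ha1 : (a : ZMod 7) ≠ 1) {M j : ℕ} (hjM : j ≤ M)
    {f : absoluteGaloisGroup K → geomTorsion E ((7 ^ j : ℕ) : ℤ)} (hf : IsCocycle₁ f)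
    (hfN : ∀ σ : absoluteGaloisGroup K, (∀ T : geomTorsion E ((7 ^ M : ℕ) : ℤ), σ • T = T) → f σ = 0) :
    IsCoboundary₁ f := by
  -- the endomorphisms `ψℓ`, `x = τ` of `Ω = E(K̄)` as a `ℤ`-module
  set ψℓ : Module.End ℤ E.geomPoints := ψ.toIntLinearMap with hψℓ
  set x : Module.End ℤ E.geomPoints := DistribMulAction.toModuleEnd ℤ E.geomPoints τ with hxdef
  have hψℓ_apply : ∀ P, ψℓ P = ψ P := fun P => rfl
  have hxpow : ∀ (n : ℕ) (P : E.geomPoints), (x ^ n) P = (τ ^ n) • P := fun n P => by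
    rw [hxdef, ← map_pow]; rfl
  have hx : Commute ψℓ x := by
    refine LinearMap.ext fun P => ?_
    show ψ (τ • P) = τ • ψ P
    exact (hψτ P).symm
  -- `x - a ∈ Fil 1`: `τ - a` lowers the `ψ`-filtration (kills `ker ψ`, commutes with `ψ`)
  have hνc : Commute ψℓ (x - (a : Module.End ℤ E.geomPoints)) := hx.sub_right (Int.cast_commute a ψℓ).symm
  have hν : x - (a : Module.End ℤ E.geomPoints) ∈ Fil ψℓ 1 := by
    intro k P hP
    cases k with
    | zero =>
      rw [pow_zero, Module.End.one_apply] at hP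
      rw [hP, map_zero, map_zero]
    | succ n =>
      rw [pow_succ', Module.End.mul_apply] at hP
      have hP' : ψ ((ψℓ ^ n) P) = 0 := hP
      have hQ : τ • ((ψℓ ^ n) P) = a • ((ψℓ ^ n) P) := hkerτ _ hP'
      have hc := LinearMap.congr_fun (hνc.pow_left n).eq P
      rw [Module.End.mul_apply, Module.End.mul_apply] at hc
      rw [Nat.add_sub_cancel, hc, LinearMap.sub_apply, Module.End.intCast_apply, ← hQ]
      show τ • (ψℓ ^ n) P - τ • (ψℓ ^ n) P = 0
      exact sub_self _
  -- `7 ∈ Fil 2`: `7 = -ψ²`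
  have hseven : (7 : Module.End ℤ E.geomPoints) = -(ψℓ * ψℓ) := by
    refine LinearMap.ext fun P => ?_
    rw [LinearMap.neg_apply, Module.End.mul_apply, hψℓ_apply, hψℓ_apply, hψψ, Module.End.ofNat_apply, neg_smul,
      neg_neg, ofNat_zsmul]
  have h7fil : (7 : Module.End ℤ E.geomPoints) ∈ Fil ψℓ 2 := by
    rw [hseven]; exact Fil.neg (Fil.mul Fil.self Fil.self)
  -- the contraction: `z = τ^(7^m)` acts as `c = a^(7^m)` on `E[7^M]`, `m = 2M - 1`
  set m := 2 * M - 1 with hmdef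
  have hfil := Fil.pow_seven_pow_sub hx a hν h7fil m
  have hψpow : ∀ (n : ℕ) (P : E.geomPoints), (ψℓ ^ (2 * n)) P = ((-7) ^ n : ℤ) • P := by
    intro n
    induction n with
    | zero => intro P; rw [mul_zero, pow_zero, Module.End.one_apply, pow_zero, one_smul]
    | succ n ih =>
      intro P
      rw [show 2 * (n + 1) = 2 * n + 2 by ring, pow_add, Module.End.mul_apply, pow_two, Module.End.mul_apply,
        hψℓ_apply, hψℓ_apply, hψψ, map_zsmul, ih, smul_smul, pow_succ']
  set z := τ ^ (7 ^ m) with hzdef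
  set c : ℤ := a ^ (7 ^ m) with hcdef
  have hzc : ∀ P : E.geomPoints, ((7 ^ M : ℕ) : ℤ) • P = 0 → z • P = c • P := by
    intro P hP
    have hP2 : (ψℓ ^ (2 * M)) P = 0 := by
      rw [hψpow, neg_pow, mul_smul]
      have : ((7 : ℤ) ^ M) • P = 0 := by exact_mod_cast hP
      rw [this, smul_zero]
    have h0 := Fil.apply_eq_zero hfil (k := 2 * M) (by omega) hP2
    rw [LinearMap.sub_apply, hxpow, Module.End.intCast_apply, sub_eq_zero] at h0
    exact h0
  -- `7 ∤ c - 1`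
  have hc7 : IsCoprime (c - 1) ((7 ^ j : ℕ) : ℤ) := by
    have hcz : ((c : ℤ) : ZMod 7) = (a : ZMod 7) := by rw [hcdef]; push_cast; exact ZMod.pow_card_pow _
    have hnd : ¬ (7 : ℤ) ∣ c - 1 := by
      intro hd
      apply ha1
      have h0 : ((c - 1 : ℤ) : ZMod 7) = 0 := (ZMod.intCast_zmod_eq_zero_iff_dvd (c - 1) 7).2 (by exact_mod_cast hd)
      rw [Int.cast_sub, hcz, Int.cast_one, sub_eq_zero] at h0
      exact h0
    have h7p : Prime (7 : ℤ) := by norm_num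
    have hcop : IsCoprime (7 : ℤ) (c - 1) := (Irreducible.coprime_iff_not_dvd h7p.irreducible).2 hnd
    push_cast
    exact (hcop.pow_left (m := j)).symm
  -- Sah modulo `N = Γ_{K(E[7^M])}`
  set N : Set (absoluteGaloisGroup K) := {σ | ∀ T : geomTorsion E ((7 ^ M : ℕ) : ℤ), σ • T = T} with hNdef
  have hdvd : ((7 ^ j : ℕ) : ℤ) ∣ ((7 ^ M : ℕ) : ℤ) := by exact_mod_cast pow_dvd_pow 7 hjM
  have hjM' : ∀ T : geomTorsion E ((7 ^ j : ℕ) : ℤ), ((7 ^ M : ℕ) : ℤ) • (T : E.geomPoints) = 0 := fun T => by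
    obtain ⟨d, hd⟩ := hdvd
    rw [hd, mul_comm, mul_smul, (E.mem_geomTorsion_iff _ _).1 T.2, smul_zero]
  have hN : ∀ n ∈ N, ∀ T : geomTorsion E ((7 ^ j : ℕ) : ℤ), n • T = T := by
    intro n hn T
    have hTM : (T : E.geomPoints) ∈ geomTorsion E ((7 ^ M : ℕ) : ℤ) := (E.mem_geomTorsion_iff _ _).2 (hjM' T)
    have h : n • ((⟨(T : E.geomPoints), hTM⟩ : geomTorsion E ((7 ^ M : ℕ) : ℤ)) : E.geomPoints) =
        ((⟨(T : E.geomPoints), hTM⟩ : geomTorsion E ((7 ^ M : ℕ) : ℤ)) : E.geomPoints) := by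
      rw [← AddSubgroup.torsionBy.coe_smul, hn]
    apply Subtype.ext
    rw [AddSubgroup.torsionBy.coe_smul]
    exact h
  have hzT : ∀ T : geomTorsion E ((7 ^ M : ℕ) : ℤ), z • T = c • T := fun T => by
    apply Subtype.ext
    rw [AddSubgroup.torsionBy.coe_smul, AddSubgroupClass.coe_zsmul]
    exact hzc T ((E.mem_geomTorsion_iff _ _).1 T.2)
  have hz : ∀ σ : absoluteGaloisGroup K, ∃ n ∈ N, σ * z = z * σ * n := by
    intro σ
    refine ⟨(z * σ)⁻¹ * (σ * z), fun T => ?_, by group⟩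
    rw [mul_smul, mul_smul, hzT, smul_comm σ c T, ← hzT, ← mul_smul z σ T, inv_smul_smul]
  have hbij : Function.Bijective fun T : geomTorsion E ((7 ^ j : ℕ) : ℤ) => z • T - T := by
    refine bijective_smul_sub_of_smul_eq_zsmul (n := 7 ^ j) (c := c) (fun T => ?_) (fun T => ?_) hc7
    · rw [natCast_zsmul]; exact AddSubgroup.torsionBy.nsmul T
    · apply Subtype.ext
      rw [AddSubgroup.torsionBy.coe_smul, AddSubgroupClass.coe_zsmul]
      exact hzc T (hjM' T)
  exact isCoboundary₁_of_central_mod_of_bijective N hN hz hbij hf (fun n hn => hfN n hn)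

/-- **(H1) of THEOREM R holds** — `H¹(Gal(K(E[7^M])/K), E[7^j]) = 0` for `j ≤ M`, for every `W/ℚ` with CM by
`ℚ(√−7)` and every quadratic `K ∌ √−7`: the CM homothety `τ = τ₀²` (`χ₇(τ₀) = 2`, `a = a₀² ≢ 1 (mod 7)` by the
Weil pairing on a `ψ`-triangular basis of `E[7]`) fed into `isCoboundary₁_of_cm_homothety`. No summit statement
is proved here. [cite: McCallumLMS1991, §4] [cite: LawsonWuthrich2016, Thm. 2 and §3] [cite: Sah1968, Prop. 2.7 (b)]
[cite: SilvermanAdvancedTopics1994, II §2 Thm. 2.2(b)] [cite: SilvermanAEC2009, Prop. III.8.1] -/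
theorem towerH1VanishingSeven_holds : TowerH1VanishingSeven := by
  intro W _ hW K _ _ h2 h7 M j hjM f hf hfN
  obtain ⟨τ, ψ, a, hψψ, hψτ, hkerτ, ha1⟩ := exists_cm_homothety_seven W hW K h2 h7
  exact isCoboundary₁_of_cm_homothety (W.baseChange K) τ ψ a hψψ hψτ hkerτ ha1 hjM hf hfN


/-! ### §18.6 B♭♭ := «THEOREM R granted (H1) and (H2)» and the REV 8 composite -/

/-- **Piece B♭♭ (a LIGHTER typing target than B♭; NEW in REV 8) — `EisensteinCMKolyvaginStructureSevenGrantedH1H2 :=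
TowerH1VanishingSeven → TowerNoSevenTorsionSeven → EisensteinCMKolyvaginStructureSeven`.** THEOREM R (memos
g34/g37/g40) rests on (H1)–(H6) of memo g34 §3; (H2) is §15 and (H1) is now §18.5 (`towerH1VanishingSeven_holds`), so
the typist of leaf B may ASSUME both: in B's setting `K` is imaginary quadratic (`finrank ℚ K = 2`) and satisfies the
Heegner hypothesis for `N(W)`, `7 ∣ N(W)`, so `7` splits in `K`, `K ≠ ℚ(√−7)` and `∀ y : K, y² ≠ −7` — the two side
conditions of `TowerH1VanishingSeven`; its `W`-hypothesis `cmFieldDiscrOfJ W.j = −7` is `ClassCSeven W`'s second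
conjunct, and the same instance serves the `d_K`-twin (same `j`). `B♭♭ → B♭`
(`eisensteinCMKolyvaginStructureSevenGrantedH2_of_grantedH1H2`), and `B♭♭ → B`, `B♭ → B♭♭` as kernel-checked
`example`s (below). D-0171 tag: ATTACKABLE (L) — THEOREM R minus (H1), (H2).
[cite: McCallumLMS1991, §1 Theorem, §4 and §5] [cite: GrossLMS1991, Thm. 1.3, Prop. 9.1 and §4 Lemma 4.3] -/
def EisensteinCMKolyvaginStructureSevenGrantedH1H2 : Prop :=
  TowerH1VanishingSeven → TowerNoSevenTorsionSeven → EisensteinCMKolyvaginStructureSeven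

/-- `B♭♭ → B♭`: (H1) is discharged by §18.5. [cite: GrossLMS1991, Prop. 9.1] [cite: McCallumLMS1991, §4] -/
theorem eisensteinCMKolyvaginStructureSevenGrantedH2_of_grantedH1H2
    (h : EisensteinCMKolyvaginStructureSevenGrantedH1H2) : EisensteinCMKolyvaginStructureSevenGrantedH2 :=
  h towerH1VanishingSeven_holds

/-- `B♭♭ → B`: (H1) by §18.5 and (H2) by §15 (an `example`, so that the audit cone stays free of orphans).
[cite: GrossLMS1991, Prop. 9.1 and §4 Lemma 4.3] [cite: McCallumLMS1991, §4 (5)] -/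
example (h : EisensteinCMKolyvaginStructureSevenGrantedH1H2) : EisensteinCMKolyvaginStructureSeven :=
  h towerH1VanishingSeven_holds towerNoSevenTorsionSeven_holds

/-- `B♭ → B♭♭` (weakening; an `example`). [folklore] -/
example (h : EisensteinCMKolyvaginStructureSevenGrantedH2) : EisensteinCMKolyvaginStructureSevenGrantedH1H2 :=
  fun _ ↦ h

/-- **REV 8 COMPOSITE — K7r from A and B♭♭** (plus the eleven named facts of §14 and Cremona's row `N = 49`, `hM`):
leaf B♭ is replaced by the lighter B♭♭ = «THEOREM R granted (H1) and (H2)», (H1) being supplied in kernel by §18.5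
and (H2) by §15; everything else as `cmRamifiedSeven_of_two_leaves_grantedH2`. The remaining open leaves of the node
are A (`KolyvaginDatumHalfSeven`, UNDECIDED·IDEA-NEEDED) and B♭♭ (`EisensteinCMKolyvaginStructureSevenGrantedH1H2`,
ATTACKABLE L: THEOREM R minus (H1), (H2)). No summit statement and no crux is proved here.
[cite: GrossZagier1986, Thm. I.6.3] [cite: KolyvaginEuler1990, Thm. A] [cite: McCallumLMS1991, §1 Theorem and §5]
[cite: GrossLMS1991, Prop. 9.1 and §4 Lemma 4.3] [cite: Stevens1989, (5.4)–(5.6)]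
[cite: CremonaAlgorithms1997, Table 1 (N = 49)] -/
theorem cmRamifiedSeven_of_two_leaves_grantedH1H2 (hBF : bsdTriple_of_hasCM_of_L_one_ne_zero)
    (hmod : hasEntireLFunction_rat) (hnf : exists_isNewformOf)
    (hLLT : LiLiuTian2024.thm11_bsdp_of_cm_rank_one) (hKob : Kobayashi2013.cor14_bsdp_of_cm_rank_one)
    (hLTYZ : LiTianYanZhu2025.thm11_bsdp_of_cm_rank_one)
    (hGZK : rank_eq_analyticRank_of_analyticRank_le_one)
    (hCassels : bsdRHS_eq_of_isIsogenous)
    (hFH : friedbergHoffstein_exists_heegnerField_splitDivisors_twist_ne_zero)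
    (hGZ : ∀ (N : ℕ) [NeZero N] (W : WeierstrassCurve ℚ) (K : Type) [Field K] [NumberField K],
      gross_zagier N W K)
    (hKo : ∀ (N : ℕ) [NeZero N] (W : WeierstrassCurve ℚ) (K : Type) [Field K] [NumberField K],
      kolyvagin N W K)
    (hM : OptimalCurveManinCertificate cm7)
    (hA : KolyvaginDatumHalfSeven) (hBff : EisensteinCMKolyvaginStructureSevenGrantedH1H2) : X12.CMRamifiedSeven :=
  cmRamifiedSeven_of_two_leaves_grantedH2 hBF hmod hnf hLLT hKob hLTYZ hGZK hCassels hFH hGZ hKo hM hA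
    (eisensteinCMKolyvaginStructureSevenGrantedH2_of_grantedH1H2 hBff)

end TowerH1

/-- The crux this node hangs under (by name, for the audit): the node is an OR-sibling of the route's line
under the SAME leaf `X12.CMRamifiedSeven`, not a line concluding the crux. -/
example : Prop :=
  Summit.BirchSwinnertonDyer.BirchSwinnertonDyer.Theses.RamifiedSevenEllipticUnits.EllipticUnitValueSevenOfGZK

/-- The leaf (target) by name. -/
example : Prop := X12.CMRamifiedSeven

end Summit.BirchSwinnertonDyer.BirchSwinnertonDyer.Cruxes.EllipticUnitValueSevenOfGZK.CuspidalDescent.Node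

end
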